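import Literature.MathematicalPhysics.QuantumFieldTheory.Balaban1983to89.B5G183RateTorus
import Literature.MathematicalPhysics.QuantumFieldTheory.Balaban1983to89.B5G183RateWThetaCentre

/-!
# Bałaban [CMP 95 (1984)] (1.83)/(1.89) at `U = 1`: the TORUS-LEVEL η-rate of the WEIGHTED fourth item
`𝒲_θ ∇_ν 𝒢 ∇_{ν′}^* 𝒲_θ` on `ℓ²(T_η; ℂ^d)`, exponent `min(2θ, 1)` — the Plancherel packaging of the
fibrewise law of `B5G183RateWThetaHolds`

v1.3 — APPEND-ONLY over v1.2 (p195157, commit a07fb5d998fd; v1.2 was append-only over v1.1, p194774,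
90692d1fac99; v1.1 over v1, p194486, dbe7b4bcf836): every v1.2 declaration is byte-identical; new are §8
(`section OneSidedSymbol/OneSidedZero/OneSidedTorus`: the torus η-rate of the King-weighted ONE-SIDED order-two
items `∇_ν∇_{ν′}𝒲_2𝒢`, `𝒢𝒲_2∇*_ν∇*_{ν′}` — fifth and sixth items of (1.89) — and the six-item torus table),
§9 (`section AveragingItems/AveragingKing`: the first-order items `∇_ν𝒢`, `𝒢∇*_ν` and King's `θ = 1` item
`𝒲_1∇_ν𝒢∇*_{ν′}𝒲_1` against King's block averaging `Q_R`), this header's §8/§9 bullets, items (ii)/(iii) of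
NOT CLAIMED, and one re-worded sentence on King's (4.19) in WHAT IS PRINTED (a wording note of the cell's
literature seat: (4.19) is ONE kernel with ONE alias factor, see there).  v1.2 added §7 `section Averaging`
(`Q_R J_R = R^{−d/2}·mulOp(u_R)`, the symbol rate `|u_R − 1| ≤ (π/2)η Σ_ν|∂^η_ν|`, the `(0,0)` rate against `Q_R`).

HONEST FRAMING (cell `pub-balaban`, T⁴ programme, estimate NE2 = U1a «η-rate, linear theory»; residual
(R9.viii) «second-order weighted torus packaging» of the cell record).  This module puts the fibrewise
weighted order-two η-rate of the ACCEPTED kernel module `B5G183RateWThetaHolds` (fixed reduced momentum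
`p′ ≠ 0`, exponent `min(2θ,1)`) and its sharpness (`B5G183RateWThetaSharp`, `B5G183RateWThetaCentre`)
ON THE ACTUAL LATTICE HILBERT SPACE of b05's `B5Prop11Plancherel`, exactly as the sibling
`B5G183RateTorus` did for `𝒢`, `∇_ν𝒢`, `𝒢∇_ν^*`: the object is the operator
`𝒲_θ (∇_ν 𝒢 ∇_{ν′}^*) 𝒲_θ` on `ℓ²(T_η; ℂ^d)` (`η = 1/n`, finite torus with `M_μ ≥ 1` unit sites per
direction, TRIVIAL background `U = 1`), where `𝒢 = calG` is Bałaban's (1.83) with his printed `p′ = 0`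
values, `∇_ν = fdiff` and `𝒲_θ = Wop θ` is the Fourier multiplier by King's alias weight `W(p′, l)^θ`.
Nothing here is infinite-volume (the bounds are uniform in the torus `M` and in `η`, but no limit object
is constructed), nothing is a mass gap, nothing is uniform in a coupling, and nothing in this file is
progress on any Clay problem or on the summit statement of this programme; it is finite-dimensional
linear algebra (Fourier multipliers, unitary conjugation, re-indexing along cosets, block-diagonal norms
from above AND from below, a vanishing `p′ = 0` coset) on top of ACCEPTED kernel modules cited BY NAME
(`B5Prop11Plancherel`, `B5G183RateTorus`, `B5G183RateWThetaHolds`, `B5G183RateWThetaSharp`,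
`B5G183RateWThetaCentre`).  The theorems of §§1–6 are tagged `[folklore]` (§§7–9 carry the printed
locators they instantiate, citation policy in the §7 bullet): the operator `∇𝒢∇*` is Bałaban's
fourth item of (1.89), its UNIFORM bound is Prop. 1.1 as typed by b05
(`B5Prop11Plancherel.opNorm_fdiff_calG_star_fdiff_le`, not re-proved); the weight `W` ((4.20)), its
appearance as ONE alias factor `u` on the `Q*`-leg of the kernel ((4.19)) and the factor-by-factor two-spacing
comparison (text after (4.23)) are King's [King1986] p. 672 (scalar `U(1)` Higgs model); the interpolation `θ ∈ [0,1]`, the operator `𝒲_θ`, the two-level injection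
`J_R` (`B5G183RateTorus.Jmat`), the packaging, the currency `TorusRateWθ` and every constant are OURS and
are NOT attributed to either author.  Bałaban prints NO rate in `η` and NO weight.  `[cite: …]` tags
locate TEXT, never a proof.

WHAT IS PRINTED (renders in this cell: [Balaban1984PropagatorsI] p. 33 — folder
`b2b-balaban-ref1/pages/1984-cmp95-propagators-rt-I/`; [King1986] = C. King, Commun. Math. Phys. 102
(1986) 649–677, p. 672 = render `king-renders/1986-cmp102-king-u1-higgs-I-p024-x2.png` re-read by this
seat; the remaining quotations are inherited verbatim from `B5G183RateTorus`, `B5G183RateWTheta`).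
Bałaban p. 33: «Proposition 1.1. The operator G is a symmetric operator on L²(T_η) and ‖GJ‖, ‖∇GJ‖,
‖G∇*J‖, ‖∇G∇*J‖, ‖∇∇GJ‖, ‖G∇*∇*J‖ ≤ γ₀^{−1}‖J‖, (1.89) with a positive constant γ₀ independent of k,
T_η, and depending on d only (if we put a = 1).»  King p. 672, (4.19): the Fourier representation of the
fine-level kernel `(∂_α(x′,y′)∂^{η′}_μ a_{k+n}G^{η′}_{k+n}Q*_{k+n})(z)` carries ONE alias factor
`u^{η′}_{k+n}(p′+l+m)` outside the propagator `Δ^{η′}(p′+l+m)^{−1}` (the `Q*`-leg; the two-sided `|u|²` sits in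
`Δ^{(k)}(p′)`, (4.5) p. 670), bounded by (4.20): «|u^{η′}_{k+n}(p′+l+m)| < C Π_{μ=1}^{d} |p′_μ| |(p′+l+m)_μ|^{−1}»;
the two-spacing comparison is made factor by factor in the text: «We first bound the terms in (4.19) with
`m ≠ 0` as follows: … `≤ CL^{−γk}`» (4.23) and «To analyze the `m = 0` term in (4.19), we successively replace
each factor by the corresponding one … and bound the error.»  The symmetric placement `𝒲_θ(·)𝒲_θ` of a weight
on BOTH sides of `∇𝒢∇*` is OURS.
The right side of (4.20) is, coordinatewise, the weight `W(p′,l) = Π_μ (1 if l_μ = 0, else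
|p′_μ|/|p′_μ + l_μ|)` of the tree (`King1986.aliasWeight`, `B5G183RateO2Diag.Wc`).

WHAT IS TYPED.
* §1 (Fourier multipliers).  `mulOp V = F^* diag(V) F` on `ℓ²(T_{1/n}; ℂ^d)` (b05's unitary `dftV`);
  `𝒲_θ = Wop θ = mulOp (W^θ)` with the symbol `wsym θ : i ↦ W_k(p′)^θ` read through b05's coset
  equivalence `blockEquiv` (`𝒲_0 = 1`, `Wop_zero`); the algebra `mulOp V · mulW W₁ W₂ = mulW (V W₁) W₂`,
  `mulW W₁ W₂ · mulOp V = mulW W₁ (W₂ V̄)`; hence **`𝒲_θ (∇_ν 𝒢 ∇_{ν′}^*) 𝒲_θ = mulW (W^θ∂_ν) (W^θ∂_{ν′})`**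
  (`weightedItem_eq_mulW`), whose coset blocks carry exactly the weights `wθdSym` of the fibrewise
  currency `B5G183RateWTheta.OrderTwoOpRateResidualWθ` (`wfsym_restrict`).
* §2 (the `p′ = 0` coset).  King's weight of a NONZERO alias class VANISHES at `p′ = 0`
  (`Wc_zero_of_ne`: an active coordinate contributes `|p′_ν|/|p′_ν + 2πj_ν| = 0`), and the zero class has
  `∂(0) = 0`; so for `θ ≠ 0` the whole weighted zero coset is the zero matrix at both levels
  (`zeroFibWθ_eq_zero`) and its η-difference is `0`; at `θ = 0` it is bounded by b05's uniform
  `2·max(a⁻¹,1)` (`opNorm_zeroFibWθ_rate`, constant `CzrW`, right side `CzrW/N^{min(2θ,1)}` in all cases).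
* §3 (THE RATE).  **`opNorm_weightedItem_rate`: for every finite unit torus, `N, R ≥ 1`, `a > 0`,
  `0 ≤ θ ≤ 1`, `ν, ν′`:
  `‖𝒲_θ^{(η/R)} ∇_ν 𝒢^{(η/R)} ∇_{ν′}^* 𝒲_θ^{(η/R)} − J_R (𝒲_θ^{(η)} ∇_ν 𝒢^{(η)} ∇_{ν′}^* 𝒲_θ^{(η)}) J_Rᴴ‖
   ≤ CTW(d,a) · η^{min(2θ,1)}`**, `CTW = max(CW1op, CzrW)` — the `p′ ≠ 0` blocks are the kernel theorem
  `B5G183RateWThetaHolds.orderTwoOpRateResidualWθ_holds` (via `B5G183RateTorus.plant_eq_conj`), the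
  `p′ = 0` block is §2, and the blocks are glued by `B5G183RateTorus.opNorm_diff_planted_le`; endpoints
  `θ = 1` (King's placement, rate `η`, `opNorm_weightedItem_rate_one`), `θ = 1/2` (rate `η` already,
  `…_half`), and the uniform-bound-plus-rate pair `orderTwo_uniform_and_weighted_rate`.
* §4 (lower bound).  The Plancherel packaging loses nothing: every coset block difference is dominated
  by the torus difference (`opNorm_block_le_diff_planted`, b05's `opNorm_le_opNorm_blockDiagonal`;
  `opNorm_blockWθ_le_weightedItem_diff`).
* §5 (THE TORUS EXPONENT LAW).  With the currency `TorusRateWθ d a C θ γ` (the displayed bound with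
  right side `C·η^γ`, all tori, all `N, R ≥ 1`, all `ν, ν′`): **`torusRateWθ_law`:
  `(∃ C, TorusRateWθ d a C θ γ) ↔ γ ≤ min(2θ, 1)`** for `0 ≤ θ ≤ 1`, `d ≥ 2`, `a > 0`.  `⇐` is §3; `⇒`
  reads the two fibrewise witnesses on concrete tori — the on-axis unpaired class of
  `B5G183RateWThetaSharp` lives over the reduced momentum `πe_{μ₁} = p′(e_{μ₁})` of the torus with `2`
  sites per direction (`sOf_qWit`, `opNorm_XW_le_of_torus`, hence no `γ > 2θ` for `θ < 1`:
  `not_torusRateWθ_of_lt`), the centre class of `B5G183RateWThetaCentre` over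
  `πe_{μ₁} + (π/2)e_{μ₂} = p′(2e_{μ₁} + e_{μ₂})` of the torus with `4` sites per direction (`sOf_qCen`,
  `opNorm_XC_le_of_torus`, hence no `γ > 1`: `not_torusRateWθ_of_one_lt`).  The two `not_…` proof
  bodies are VERBATIM transcripts of the cited fibrewise proofs with the single use of the fibrewise
  currency replaced by the torus witness bound (recorded in their docstrings); corollaries
  `torusRateWθ_one_law` (`θ = 1`: `γ ≤ 1`) and `not_torusRateWθ_zero_of_pos` (`θ = 0`: no `γ > 0`, the
  operator-level form of `B5G183RateObstructionOp.not_orderTwoOpRateResidual`).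

* §6 (v1.1, APPEND-ONLY; MIXED DIRECTIONS `ν ≠ ν′`).  The same packaging for the fibrewise
  mixed-direction law of `B5G183RateWThetaMixed` / `…MixedSharp` / `…Centre`: **`opNorm_weightedItem_rate_mixed`:
  the displayed difference is `≤ CTX(d,a)·η^{min(4θ,1)}` for `ν ≠ ν′`**, `CTX = max(CXop, CzrW)` (the
  `p′ ≠ 0` blocks are `B5G183RateWThetaMixed.orderTwoOpRateResidualWθoff_holds`; `θ = 1/4` already gives
  the full rate `η`, `…_mixed_quarter`); the currency `TorusRateWθoff` (the bound demanded only for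
  `ν ≠ ν′`) and **`torusRateWθoff_law`: `(∃ C, TorusRateWθoff d a C θ γ) ↔ γ ≤ min(4θ, 1)`** (`0 ≤ θ ≤ 1`,
  `d ≥ 2`, `a > 0`): the two-axis unpaired witness of `B5G183RateWThetaMixedSharp` lives over
  `π(e_{μ₁} + e_{μ₂}) = p′(e_{μ₁} + e_{μ₂})` of the `2`-torus (`sOf_qWit2`, `opNorm_XW2_le_of_torus`), the
  centre witness over the `4`-torus as in §5 (`opNorm_XC_le_of_torusOff`); the negative sides are stated
  once against an ABSTRACT witness bound (`not_XW2_bound_of_lt`, `not_XC_bound_of_one_lt` — verbatim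
  transcripts of the cited fibrewise proofs, the currency use replaced by the hypothesis) and then read
  for the torus currency (`not_torusRateWθoff_of_lt`, `not_torusRateWθoff_of_one_lt`); `torus_exponent_laws`
  puts the all-directions law `min(2θ,1)` of §5 and the mixed law `min(4θ,1)` side by side.
* §7 (v1.2, APPEND-ONLY; KING's BLOCK AVERAGING `Q_R` VERSUS `J_R`, order `(0,0)`).  King's averaging
  operator «Q_k A_μ(y) = L^{−kd} Σ_{x∈B^k(y)} A_μ(x), (2.10)» [King1986, p. 653] between the tori `T_{η/R}`
  and `T_η` is typed verbatim as the matrix `Qavg` (entries `R^{−d}` on the `R`-blocks; `Q_R Q_Rᴴ = R^{−d}·1`,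
  `‖Q_R‖ ≤ R^{−d/2}`, `Qavg_mul_conjTranspose`, `opNorm_Qavg_le`).  **`Qavg_mul_Jmat`: `Q_R J_R =
  R^{−d/2}·F_η^* diag(u_R) F_η`**, `u_R(P) = B5Prop11Fiber.uSym R 0 (p̃η)` = Bałaban's averaging weight «u(p) =
  Π_μ v_μ(p)» (1.31)/(1.61) = King's «u_k^η(p) = Π_{μ=1}^d [(e^{−ip_μ} − 1)η(e^{−iηp_μ} − 1)^{−1}], (4.3)»
  [p. 670, `η = 1/R`, conjugate convention] at the CENTRAL alias `p̃ = King1986.symmAlias/N` of the class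
  (`uCen`; the block sum is a product of geometric sums, `sum_exp_pow_eq_vSym`, `avg_chi_emb_iota_off`) —
  whereas SAMPLING the interpolant gave exactly `R^{−d/2}·1` (`B5G183RateTorus.Smp_mul_Jmat`).  The symbol
  rate **`norm_uCen_sub_one_le`: `|u_R(P) − 1| ≤ (π/(2N)) Σ_ν |fsym_ν(P)|`** (one block direction:
  `|v(s) − 1| ≤ |s|`; `|Πv − 1| ≤ Σ|v − 1|`; Jordan; `∂^η_ν` of the class sees only the central alias,
  `dSym_eq_cen`) — FIRST order in the lattice momentum and no better (at the band edge the defect is `O(1)`,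
  so `Q_R J_R − R^{−d/2}` has NO operator-norm rate; none is claimed).  The defect is absorbed by one
  derivative of `𝒢` through the factorisation `mulOp(u_R) − 1 = mulOp(ρ)·mulOp(g)`, `g = η(Σ_ν|∂^η_ν|²)^{1/2}`,
  `|ρ| ≤ π√d/2`, `‖mulOp(g)X‖² ≤ η² Σ_ν ‖∇^η_ν X‖²` (`opNorm_mulOp_gsym_mul_sq_le`) and b05's (1.89)
  `‖∇^η_ν 𝒢‖ ≤ Cst`: `‖(mulOp(u_R) − 1)𝒢^{(η)}‖ ≤ (πd/2)·Cst·η`.  HEADLINE **`opNorm_Qavg_calG_rate`: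
  `‖Q_R 𝒢^{(η/R)} Q_Rᴴ − R^{−d}·𝒢^{(η)}‖_{ℓ²(T_η; ℂ^d)} ≤ R^{−d}·CQ(d,a)·η`**, `CQ = CT + πd·Cst`, for all unit
  tori, all `N, R ≥ 1`, `a > 0` — the block averages of the fine-lattice covariance are the coarse-lattice
  covariance up to `O(η)` (the factor `R^{−d} = ‖Q_R‖²` is the ratio of the two `ℓ²` normalisations); from the
  `J_R`-rate of `B5G183RateTorus.opNorm_calG_rate` plus the averaging-weight defect.  Bałaban prints no rate;
  King's scalar (4.19)–(4.23) is the model; the statements and constants of §7 are OURS.  (Citation policy of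
  §7, gate lint `literature-cited-only`: the result declarations carry the locators of the PRINTED statements they
  type or instantiate — King (2.10) p.653, (4.3) p.670, Lemma 4.4 (4.29) p.673 at `k = 0`; Bałaban (1.31) p.23,
  (1.61)/(1.66) p.28, (1.89) p.33 — with «constant ours» where the constant is not printed; the intermediate
  linear-algebra steps are `private` helpers.)
* §8 (v1.3, APPEND-ONLY; the ONE-SIDED order-two items, fifth and sixth of (1.89)).  With ONE full King weight
  `W²` on the pair of derivatives — the currency of the fibrewise kernel theorems
  `B5G183RateO2Op.opNorm_DDW_G_rate` / `opNorm_G_DDW_rate` (weights `∂_ν · W²∂_{ν′}` on one side, `1` on the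
  other) — the torus operators are `∇_ν∇_{ν′}𝒲_2𝒢 = mulW (∂_ν W² ∂_{ν′}) 1` and `𝒢𝒲_2∇*_ν∇*_{ν′} = mulW 1 (∂_ν W² ∂_{ν′})`
  (`oneSidedL_eq_mulW`, `oneSidedR_eq_mulW`; `𝒲_2 = Wop 2` commutes with the difference operators, all being
  Fourier multipliers); their `p′ = 0` coset is the zero matrix at both levels (`Wc_zero_of_ne`, `∂(0) = 0`);
  HEADLINES **`opNorm_oneSidedL_rate`, `opNorm_oneSidedR_rate`:
  `‖∇_ν′∇_{ν′}′𝒲_2′𝒢′ − J_R(∇_ν∇_{ν′}𝒲_2𝒢)J_Rᴴ‖, ‖𝒢′𝒲_2′∇_ν′^*∇_{ν′}′^* − J_R(𝒢𝒲_2∇*_ν∇*_{ν′})J_Rᴴ‖ ≤ CT2(d,a)·η`**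
  (primes = spacing `η/R`; all unit tori, `N, R ≥ 1`, `a > 0`; `CT2 = max(C2op, CzrW)`), and the SIX-ITEM TABLE
  **`sixItems_torus_rate`**: all six items of (1.89) at `U = 1` — `𝒢`, `∇_ν𝒢`, `𝒢∇*_ν` (`B5G183RateTorus`),
  `𝒲_1∇_ν𝒢∇*_{ν′}𝒲_1` (§3, King's `θ = 1`), `∇_ν∇_{ν′}𝒲_2𝒢`, `𝒢𝒲_2∇*_ν∇*_{ν′}` (§8) — carry the torus η-rate
  `C6(d,a)·η` against `J_R`, the order-two ones in King-weighted currencies ONLY (unweighted: no rate,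
  `not_torusRateWθ_zero_of_pos`; the one-sided weight exponent law for `W^{2θ}`, `θ < 1`, is NOT typed).
* §9 (v1.3, APPEND-ONLY; FIRST-ORDER AND KING-`θ = 1` ITEMS AGAINST `Q_R`).  The `(0,0)` argument of §7 is
  abstracted (`Q_R X′Q_Rᴴ − R^{−d}X = Q_R(X′ − J_R X J_Rᴴ)Q_Rᴴ + R^{−d}[(mulOp(u_R) − 1)X mulOp(ū_R) + X(mulOp(ū_R) − 1)]`)
  and fed with one more derivative: `‖(mulOp(u_R) − 1)X‖ ≤ (πd/2)·C·η` whenever `‖∇^η_μ X‖ ≤ C` for all `μ`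
  (for `X = ∇_ν𝒢` this is b05's FIFTH uniform bound `‖∇∇𝒢‖ ≤ Cst`, for the adjoint side the FOURTH,
  `‖∇𝒢∇*‖ ≤ Cst`), and, for King's weighted item, `‖(mulOp(u_R) − 1)𝒲_1‖ ≤ (dπ²/2)·η` (the weight absorbs the
  derivative that `u_R − 1` costs: `|W∂_μ| ≤ π`, `B5G183RateO2Op.norm_w1dSym_le`).  HEADLINES
  **`opNorm_Qavg_fdiff_calG_rate`, `opNorm_Qavg_calG_star_fdiff_rate`:
  `‖Q_R(∇_ν′𝒢′)Q_Rᴴ − R^{−d}∇_ν𝒢‖, ‖Q_R(𝒢′∇_ν′^*)Q_Rᴴ − R^{−d}𝒢∇*_ν‖ ≤ R^{−d}·CQL(d,a)·η`**, `CQL = CTL + πd·Cst`;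
  **`opNorm_Qavg_weightedItem_rate_one`: `‖Q_R(𝒲_1′∇_ν′𝒢′∇_{ν′}′^*𝒲_1′)Q_Rᴴ − R^{−d}𝒲_1∇_ν𝒢∇*_{ν′}𝒲_1‖ ≤ R^{−d}·CQW(d,a)·η`**,
  `CQW = CTW + dπ²·Cst`; and the four-item `Q_R`-table `fourItems_Qavg_rate` (with `𝒢` of §7).  Statements and
  constants OURS; Bałaban prints the uniform bounds, King the scalar model.

NOT CLAIMED.  (i) Nothing for `θ > 1` or `θ < 0`, and no statement about King's actual exponent
bookkeeping `γ < 1/2` in (4.23)–(4.24) beyond what the cited modules type; (ii) the placements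
`(2,0)`/`(0,2)` (`∇∇𝒢`, `𝒢∇*∇*`, fifth and sixth items of (1.89)) are treated ONLY in the one-sided
King-weighted currency `∂_ν·W²∂_{ν′}` of `B5G183RateO2Op` at the full weight (§8, v1.3): no exponent law in a
weight power `W^{2θ}`, `θ < 1`, for the one-sided items, and no lower bound for them, is typed; (iii) no
`p′`-derivatives (King's (4.21)–(4.22)), no position-space decay, no non-trivial background `U ≠ 1`,
no covariant operators; King's block averaging `Q_R` (2.10) enters only through §7 (v1.2) and §9 (v1.3): the
identity `Q_R J_R = R^{−d/2} mulOp(u_R)`, the `(0,0)` rate of `𝒢`, the first-order rates of `∇_ν𝒢`, `𝒢∇*_ν`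
and King's `θ = 1` weighted item against `Q_R` — the weighted item for `0 < θ < 1` and the one-sided order-two
items are NOT compared against `Q_R` (the soft route gives only `η^θ` there; the sharp `Q_R`-law is not typed),
Bałaban's covariant averaging `Q(U)` and King's `Q_k` for `k ≥ 2` composed steps are not typed, and no
operator-norm rate for `Q_R J_R − R^{−d/2}` is claimed (there is none); (iv) the law for `d = 1` is typed only on the
side `γ ≤ 2θ` (`not_torusRateWθ_of_lt` needs `d ≥ 1`, `not_torusRateWθ_of_one_lt` needs `d ≥ 2`);
(v) no claim that any constant (`CTW`, `CTX`, `CQ`, `CT2`, `C6`, `CQL`, `CQW`) is optimal.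
-/

noncomputable section

namespace Literature.MathematicalPhysics.QuantumFieldTheory.Balaban1983to89.B5G183RateTorusW

open scoped BigOperators ComplexConjugate Matrix Matrix.Norms.L2Operator
open Finset Complex
open Literature.MathematicalPhysics.QuantumFieldTheory.Balaban1983to89.B4Strip
open Literature.MathematicalPhysics.QuantumFieldTheory.Balaban1983to89.B5Prop11Fiber
open Literature.MathematicalPhysics.QuantumFieldTheory.Balaban1983to89.B5Prop11Bound
open Literature.MathematicalPhysics.QuantumFieldTheory.Balaban1983to89.B5Prop11Plancherel
open Literature.MathematicalPhysics.QuantumFieldTheory.Balaban1983to89.B5Hk163Rate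
open Literature.MathematicalPhysics.QuantumFieldTheory.Balaban1983to89.B5Hk163RateSum
open Literature.MathematicalPhysics.QuantumFieldTheory.Balaban1983to89.B5G183Rate
open Literature.MathematicalPhysics.QuantumFieldTheory.Balaban1983to89.B5G183RateSum
open Literature.MathematicalPhysics.QuantumFieldTheory.Balaban1983to89.B5G183RateL2
open Literature.MathematicalPhysics.QuantumFieldTheory.Balaban1983to89.B5G183RateOp
open Literature.MathematicalPhysics.QuantumFieldTheory.Balaban1983to89.B5G183RateObstruction
open Literature.MathematicalPhysics.QuantumFieldTheory.Balaban1983to89.B5G183RateObstructionOp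
open Literature.MathematicalPhysics.QuantumFieldTheory.Balaban1983to89.B5G183RateO2Diag
open Literature.MathematicalPhysics.QuantumFieldTheory.Balaban1983to89.B5G183RateW1RankOne
open Literature.MathematicalPhysics.QuantumFieldTheory.Balaban1983to89.B5G183RateWTheta
open Literature.MathematicalPhysics.QuantumFieldTheory.Balaban1983to89.B5G183RateWThetaSharp
open Literature.MathematicalPhysics.QuantumFieldTheory.Balaban1983to89.B5G183RateWThetaHolds
open Literature.MathematicalPhysics.QuantumFieldTheory.Balaban1983to89.B5G183RateWThetaCentre
open Literature.MathematicalPhysics.QuantumFieldTheory.Balaban1983to89.B5G183RateTorus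
open Literature.MathematicalPhysics.QuantumFieldTheory.King1986
open Literature.Computability.QuantumComplexity.SolovayKitaev (norm_apply_le_norm)

variable {d : ℕ}

/-! ## §1 Fourier multipliers on `ℓ²(T_η; ℂ^d)`; King's weight as an operator `𝒲_θ` [folklore] -/

section Multiplier

variable (n : ℕ) [NeZero n] (hn : 1 ≤ n) (M : Fin d → ℕ) [hM : ∀ μ, NeZero (M μ)] (a : ℝ) (ha : 0 < a)

/-- the Fourier multiplier `F^* diag(V) F` on `ℓ²(T_{1/n}; ℂ^d)` with symbol `V` (b05's `dftV`).
[folklore] -/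
def mulOp (V : Tor (fine n M) × Fin d → ℂ) :
    Matrix (Tor (fine n M) × Fin d) (Tor (fine n M) × Fin d) ℂ :=
  star (dftV (fine n M)) * Matrix.diagonal V * dftV (fine n M)

/-- the multiplier with symbol `1` is the identity. [folklore] -/
theorem mulOp_one : mulOp n M (fun _ => (1 : ℂ)) = 1 := by
  rw [mulOp, show (Matrix.diagonal fun _ : Tor (fine n M) × Fin d => (1 : ℂ)) = 1 from
    Matrix.diagonal_one, Matrix.mul_one, star_dftV_mul]

/-- `mulOp V · mulW W₁ W₂ = mulW (V·W₁) W₂`. [folklore] -/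
theorem mulOp_mul_mulW (V W₁ W₂ : Tor (fine n M) × Fin d → ℂ) :
    mulOp n M V * mulW n hn M a ha W₁ W₂ = mulW n hn M a ha (fun i => V i * W₁ i) W₂ := by
  rw [mulOp, mulW, mulW]
  have hU := dftV_mul_star (fine n M)
  set U := dftV (fine n M)
  set X := calGhat n hn M a ha
  calc star U * Matrix.diagonal V * U
        * (star U * (Matrix.diagonal W₁ * X * Matrix.diagonal (star W₂)) * U)
      = star U * Matrix.diagonal V * (U * star U)
        * (Matrix.diagonal W₁ * X * Matrix.diagonal (star W₂)) * U := by
        simp only [Matrix.mul_assoc]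
    _ = star U * (Matrix.diagonal (fun i => V i * W₁ i) * X * Matrix.diagonal (star W₂)) * U := by
        rw [hU, Matrix.mul_one, ← Matrix.diagonal_mul_diagonal]
        simp only [Matrix.mul_assoc]

/-- `mulW W₁ W₂ · mulOp V = mulW W₁ (W₂·V̄)`. [folklore] -/
theorem mulW_mul_mulOp (V W₁ W₂ : Tor (fine n M) × Fin d → ℂ) :
    mulW n hn M a ha W₁ W₂ * mulOp n M V = mulW n hn M a ha W₁ (fun i => W₂ i * star (V i)) := by
  rw [mulOp, mulW, mulW]
  have hU := dftV_mul_star (fine n M)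
  set U := dftV (fine n M)
  set X := calGhat n hn M a ha
  have hd : Matrix.diagonal (star W₂) * Matrix.diagonal V
      = Matrix.diagonal (star (fun i => W₂ i * star (V i))) := by
    rw [Matrix.diagonal_mul_diagonal]
    congr 1
    funext i
    simp [Pi.star_apply]
  calc star U * (Matrix.diagonal W₁ * X * Matrix.diagonal (star W₂)) * U
        * (star U * Matrix.diagonal V * U)
      = star U * (Matrix.diagonal W₁ * X * Matrix.diagonal (star W₂)) * (U * star U)
        * Matrix.diagonal V * U := by
        simp only [Matrix.mul_assoc]
    _ = star U * (Matrix.diagonal W₁ * X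
        * Matrix.diagonal (star (fun i => W₂ i * star (V i)))) * U := by
        rw [hU, Matrix.mul_one, ← hd]
        simp only [Matrix.mul_assoc]

/-- King's class weight to the REAL power `θ` as a Fourier-multiplier symbol on `T_{1/n}`: the fine
momentum `i ↔ ((k, μ), q)` (b05's `blockEquiv`: alias class `k`, component `μ`, reduced momentum
`p′ = p′(q)`) carries `W_k(p′)^θ`, `W = B5G183RateO2Diag.Wc` (King's (4.20) weight of the class, in the
tree as `King1986.aliasWeight`). [cite: King1986, (4.20) p.672] [folklore] -/
def wsym (θ : ℝ) : Tor (fine n M) × Fin d → ℂ :=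
  fun i => ((Wc n ((blockEquiv n M) i).1.1 (sOf M ((blockEquiv n M) i).2) ^ θ : ℝ) : ℂ)

/-- restriction of the weight symbol to the cosets. [folklore] -/
theorem wsym_restrict (θ : ℝ) (I : ((Fin d → Fin n) × Fin d) × Tor M) :
    wsym n M θ ((blockEquiv n M).symm I) = ((Wc n I.1.1 (sOf M I.2) ^ θ : ℝ) : ℂ) := by
  simp only [wsym, Equiv.apply_symm_apply]

/-- the weight symbol is real. [folklore] -/
theorem star_wsym (θ : ℝ) (i : Tor (fine n M) × Fin d) : star (wsym n M θ i) = wsym n M θ i := by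
  simp only [wsym, Complex.star_def, Complex.conj_ofReal]

/-- `θ = 0`: the symbol `1`. [folklore] -/
theorem wsym_zero : wsym n M 0 = fun _ => (1 : ℂ) := by
  funext i
  simp only [wsym, Real.rpow_zero, Complex.ofReal_one]

/-- **THE WEIGHT OPERATOR `𝒲_θ = F^* diag(W^θ) F`** on `ℓ²(T_{1/n}; ℂ^d)` (King's alias weight (4.20) of
the coset decomposition `p = p′ + l`, to the power `θ`, as a Fourier multiplier; `θ = 1` is King's
`u … ū` placement in (4.19), `θ = 0` the identity). OURS as an operator. [cite: King1986, (4.19)–(4.20)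
p.672] [folklore] -/
def Wop (θ : ℝ) : Matrix (Tor (fine n M) × Fin d) (Tor (fine n M) × Fin d) ℂ := mulOp n M (wsym n M θ)

/-- `𝒲_0 = 1`. [folklore] -/
theorem Wop_zero : Wop n M 0 = 1 := by
  rw [Wop, wsym_zero, mulOp_one]

/-- **the weighted fourth item of (1.89) is a two-sided multiplier sandwich of `𝒢`:**
`𝒲_θ (∇_ν 𝒢 ∇_{ν′}^*) 𝒲_θ = mulW (W^θ·∂_ν) (W^θ·∂_{ν′})` (b05's `mulW`, `fsym`). [folklore] -/
theorem weightedItem_eq_mulW (θ : ℝ) (ν ν' : Fin d) :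
    Wop n M θ * (fdiff (fine n M) (n : ℂ) ν * calG n hn M a ha * star (fdiff (fine n M) (n : ℂ) ν'))
        * Wop n M θ
      = mulW n hn M a ha (fun i => wsym n M θ i * fsym (fine n M) (n : ℂ) ν i)
          (fun i => wsym n M θ i * fsym (fine n M) (n : ℂ) ν' i) := by
  rw [calG_eq_mulW, fdiff_mul_mulW, mulW_mul_star_fdiff, Wop, mulOp_mul_mulW, mulW_mul_mulOp]
  congr 1
  · funext i
    simp only [mul_one]
  · funext i
    rw [one_mul, star_wsym, mul_comm]

/-- the symbol `W^θ·∂_ν` restricts to the cosets as `B5G183RateWTheta.wθdSym` (the weight of the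
fibrewise currency `OrderTwoOpRateResidualWθ`). [folklore] -/
theorem wfsym_restrict (θ : ℝ) (ν : Fin d) (I : ((Fin d → Fin n) × Fin d) × Tor M) :
    (fun i => wsym n M θ i * fsym (fine n M) (n : ℂ) ν i) ((blockEquiv n M).symm I)
      = wθdSym n θ I.1.1 (sOf M I.2) ν := by
  show wsym n M θ ((blockEquiv n M).symm I) * fsym (fine n M) (n : ℂ) ν ((blockEquiv n M).symm I) = _
  rw [wsym_restrict, restrict_fsym]
  rfl

end Multiplier

/-! ## §2 The `p′ = 0` coset of the weighted order-two item: King's weight KILLS every nonzero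
reciprocal-lattice mode, so for `θ ≠ 0` the whole coset vanishes [folklore] -/

section ZeroCosetW

variable {N R : ℕ} [NeZero N] [NeZero R]

/-- **at `p′ = 0` King's weight of a NONZERO alias class is `0`**: some coordinate `j_ν ≠ 0` is
active and its factor is `|p′_ν|/|p′_ν + 2πj_ν| = 0/(2π|j_ν|) = 0` (the block average of the plane
wave `e^{2πi j·x}`, `j ≠ 0`, over a unit block vanishes). [cite: King1986, (4.20) p.672] [folklore] -/
theorem Wc_zero_of_ne {n : ℕ} [NeZero n] {k : Fin d → Fin n} (hk : k ≠ 0) :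
    Wc n k (0 : Fin d → ℝ) = 0 := by
  obtain ⟨ν, hν⟩ := Function.ne_iff.mp hk
  have hkν : (k ν : ℕ) ≠ 0 := fun h => hν (Fin.ext h)
  have hkN : (k ν : ℕ) < n := (k ν).isLt
  have hπ := Real.pi_pos
  have hne : symmAlias n k (0 : Fin d → ℝ) ν ≠ 0 := by
    unfold symmAlias shiftr
    simp only [Pi.zero_apply, zero_add]
    rcases symmShift_le_one n k (0 : Fin d → ℝ) ν with h | h <;> rw [h] <;> push_cast
    · have : (0 : ℝ) < (k ν : ℕ) := by exact_mod_cast Nat.pos_of_ne_zero hkν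
      nlinarith
    · have : ((k ν : ℕ) : ℝ) < n := by exact_mod_cast hkN
      nlinarith
  have hj : jOf n k (0 : Fin d → ℝ) ν ≠ 0 := by
    intro h0
    apply hne
    rw [symmAlias_eq_aliasPt]
    simp [aliasPt, h0]
  unfold Wc aliasWeight
  apply Finset.prod_eq_zero (Finset.mem_univ ν)
  rw [if_neg hj]
  simp

/-- hence at `p′ = 0` and `θ ≠ 0` EVERY weighted derivative symbol vanishes (the zero class has
`∂(0) = 0`, the others have weight `0`). [folklore] -/
theorem wθdSym_zero_fibre {n : ℕ} [NeZero n] {θ : ℝ} (hθ : θ ≠ 0) (k : Fin d → Fin n) (ν : Fin d) :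
    wθdSym n θ k (0 : Fin d → ℝ) ν = 0 := by
  unfold wθdSym
  by_cases hk : k = 0
  · subst hk
    have h0 : dSym n (0 : Fin d → Fin n) (0 : Fin d → ℝ) ν = 0 := dSym_const_zero ν
    rw [h0, mul_zero]
  · rw [Wc_zero_of_ne hk, Real.zero_rpow hθ, Complex.ofReal_zero, zero_mul]

omit [NeZero N] [NeZero R] in
/-- a sandwich with zero weights vanishes. [folklore] -/
theorem sandwich_zero_zero {Λ : Type*} (X : Matrix (Λ × Fin d) (Λ × Fin d) ℂ) :
    sandwich (fun _ => (0 : ℂ)) (fun _ => (0 : ℂ)) X = 0 := by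
  ext i j
  simp [sandwich]

/-- **at `p′ = 0`, `θ ≠ 0`, the weighted order-two zero fibre `D_{W^θ∂_ν} G₀ D*_{W^θ∂_{ν′}}` is `0`.**
[folklore] -/
theorem zeroFibWθ_eq_zero {n : ℕ} [NeZero n] {θ : ℝ} (hθ : θ ≠ 0) (a : ℝ) (ν ν' : Fin d) :
    sandwich (fun K => wθdSym n θ K (0 : Fin d → ℝ) ν) (fun K => wθdSym n θ K (0 : Fin d → ℝ) ν')
        (zeroFib n a) = 0 := by
  have h1 : (fun K : Fin d → Fin n => wθdSym n θ K (0 : Fin d → ℝ) ν) = fun _ => 0 :=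
    funext fun K => wθdSym_zero_fibre hθ K ν
  have h2 : (fun K : Fin d → Fin n => wθdSym n θ K (0 : Fin d → ℝ) ν') = fun _ => 0 :=
    funext fun K => wθdSym_zero_fibre hθ K ν'
  rw [h1, h2]
  exact sandwich_zero_zero _

omit [NeZero N] [NeZero R] in
/-- conjugating by an isometry does not increase the norm. [folklore] -/
theorem opNorm_isoConj_le {m m' : Type*} [Fintype m] [DecidableEq m] [Fintype m'] [DecidableEq m']
    {J : Matrix m' m ℂ} (hJ : Jᴴ * J = 1) (X : Matrix m m ℂ) : ‖J * X * Jᴴ‖ ≤ ‖X‖ := by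
  have hJ1 : ‖J‖ ≤ 1 := by
    by_cases hm : Nonempty m
    · have h2 : ‖J‖ * ‖J‖ = 1 := by
        rw [← Matrix.l2_opNorm_conjTranspose_mul_self, hJ]
        exact norm_one
      nlinarith [norm_nonneg J]
    · have : J = 0 := by
        ext i j
        exact absurd ⟨j⟩ hm
      rw [this, norm_zero]; exact zero_le_one
  have hJt : ‖Jᴴ‖ ≤ 1 := by rw [Matrix.l2_opNorm_conjTranspose]; exact hJ1
  calc ‖J * X * Jᴴ‖ ≤ ‖J * X‖ * ‖Jᴴ‖ := Matrix.l2_opNorm_mul _ _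
    _ ≤ (‖J‖ * ‖X‖) * ‖Jᴴ‖ := mul_le_mul_of_nonneg_right (Matrix.l2_opNorm_mul _ _) (norm_nonneg _)
    _ ≤ (1 * ‖X‖) * 1 := by
        refine mul_le_mul (mul_le_mul_of_nonneg_right hJ1 (norm_nonneg _)) hJt (norm_nonneg _) ?_
        positivity
    _ = ‖X‖ := by ring

omit [NeZero N] [NeZero R] in
/-- the zero-coset constant: twice b05's `max(a⁻¹, 1)` (only the unweighted endpoint `θ = 0` needs it).
[folklore] -/
def CzrW (a : ℝ) : ℝ := 2 * max (1 / a) 1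

omit [NeZero N] [NeZero R] in
/-- `0 < CzrW`. [folklore] -/
theorem CzrW_pos (a : ℝ) : 0 < CzrW a := by
  unfold CzrW
  have := le_max_right (1 / a) 1
  linarith

/-- **THE WEIGHTED ORDER-TWO ZERO COSET**: for every real `θ`,
`‖D_{W^θ∂^{(RN)}_ν} G₀^{(RN)} D*_{W^θ∂^{(RN)}_{ν′}} − P (D_{W^θ∂^{(N)}_ν} G₀^{(N)} D*_{…}) Pᴴ‖ ≤ CzrW(a)/N^{min(2θ,1)}`:
for `θ ≠ 0` the left side is `0` (`zeroFibWθ_eq_zero`), for `θ = 0` it is the uniform bound of b05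
(`opNorm_sandwich_G₀_le_of_orders`, orders `1 + 1`). [folklore] -/
theorem opNorm_zeroFibWθ_rate (hN : 1 ≤ N) (a : ℝ) (ha : 0 < a) (θ : ℝ) (ν ν' : Fin d) :
    ‖sandwich (fun K => wθdSym (R * N) θ K (0 : Fin d → ℝ) ν)
          (fun K => wθdSym (R * N) θ K (0 : Fin d → ℝ) ν') (zeroFib (R * N) a)
        - Pmat N R (0 : Fin d → ℝ)
          * sandwich (fun k => wθdSym N θ k (0 : Fin d → ℝ) ν)
              (fun k => wθdSym N θ k (0 : Fin d → ℝ) ν') (zeroFib N a)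
          * (Pmat N R (0 : Fin d → ℝ))ᴴ‖ ≤ CzrW a / (N : ℝ) ^ (min (2 * θ) 1) := by
  have hN0 : (0 : ℝ) < N := by exact_mod_cast hN
  by_cases hθ : θ = 0
  · subst hθ
    have e : CzrW a / (N : ℝ) ^ (min (2 * (0 : ℝ)) 1) = CzrW a := by
      rw [mul_zero, min_eq_left (zero_le_one : (0 : ℝ) ≤ 1), Real.rpow_zero, div_one]
    rw [e]
    simp only [wθdSym_zero]
    have hP := Pmat_conjTranspose_mul_self (N := N) (R := R) hN (fun ν => abs_zero_le_pi (d := d) ν)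
    have h1 := opNorm_sandwich_G₀_le_of_orders (R * N) a ha (j₁ := 1) (j₂ := 1) (by norm_num)
      (fun k => weight_order_one (R * N) (0 : Fin d → ℝ) ν k)
      (fun k => weight_order_one (R * N) (0 : Fin d → ℝ) ν' k)
    have h2 := opNorm_sandwich_G₀_le_of_orders N a ha (j₁ := 1) (j₂ := 1) (by norm_num)
      (fun k => weight_order_one N (0 : Fin d → ℝ) ν k)
      (fun k => weight_order_one N (0 : Fin d → ℝ) ν' k)
    calc _ ≤ ‖sandwich (fun K => dSym (R * N) K (0 : Fin d → ℝ) ν)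
              (fun K => dSym (R * N) K (0 : Fin d → ℝ) ν') (zeroFib (R * N) a)‖
          + ‖Pmat N R (0 : Fin d → ℝ)
              * sandwich (fun k => dSym N k (0 : Fin d → ℝ) ν) (fun k => dSym N k (0 : Fin d → ℝ) ν')
                  (zeroFib N a)
              * (Pmat N R (0 : Fin d → ℝ))ᴴ‖ := norm_sub_le _ _
      _ ≤ max (1 / a) 1 + max (1 / a) 1 := add_le_add h1 ((opNorm_isoConj_le hP _).trans h2)
      _ = CzrW a := by unfold CzrW; ring
  · rw [zeroFibWθ_eq_zero hθ, zeroFibWθ_eq_zero hθ, Matrix.mul_zero, Matrix.zero_mul, sub_zero,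
      norm_zero]
    exact div_nonneg (CzrW_pos a).le (Real.rpow_nonneg hN0.le _)

end ZeroCosetW

/-! ## §3 The torus η-rate of `𝒲_θ ∇_ν 𝒢 ∇_{ν′}^* 𝒲_θ`, exponent `min(2θ, 1)` [folklore] -/

section TorusW

variable (N R : ℕ) [NeZero N] [NeZero R] (M : Fin d → ℕ) [hM : ∀ μ, NeZero (M μ)]

omit [NeZero N] [NeZero R] hM in
/-- the constant of the weighted torus rate: the fibrewise `CW1op d a` of `B5G183RateWThetaHolds`
(`p′ ≠ 0`) against the zero-coset `CzrW a`. [folklore] -/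
def CTW (d : ℕ) (a : ℝ) : ℝ := max (CW1op d a) (CzrW a)

omit [NeZero N] [NeZero R] hM in
/-- `0 < CTW`. [folklore] -/
theorem CTW_pos (d : ℕ) (a : ℝ) : 0 < CTW d a := lt_of_lt_of_le (CzrW_pos a) (le_max_right _ _)

/-- blockwise weighted order-two rate over EVERY coset (`p′ ≠ 0`: the kernel theorem
`B5G183RateWThetaHolds.orderTwoOpRateResidualWθ_holds`; `p′ = 0`: `opNorm_zeroFibWθ_rate`). [folklore] -/
theorem blocksWθ_rate (hN : 1 ≤ N) (hR : 1 ≤ R) (hRN : 1 ≤ R * N) (a : ℝ) (ha : 0 < a) {θ : ℝ}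
    (hθ0 : 0 ≤ θ) (hθ1 : θ ≤ 1) (ν ν' : Fin d) (q : Tor M) :
    ‖sandwich (fun k => wθdSym (R * N) θ k (sOf M q) ν) (fun k => wθdSym (R * N) θ k (sOf M q) ν')
          (blocks (R * N) hRN M a ha q)
        - Pmat N R (sOf M q)
          * sandwich (fun k => wθdSym N θ k (sOf M q) ν) (fun k => wθdSym N θ k (sOf M q) ν')
              (blocks N hN M a ha q)
          * (Pmat N R (sOf M q))ᴴ‖ ≤ CTW d a / (N : ℝ) ^ (min (2 * θ) 1) := by
  have hN0 : (0 : ℝ) < N := by exact_mod_cast hN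
  have hγ : 0 ≤ (N : ℝ) ^ (min (2 * θ) 1) := Real.rpow_nonneg hN0.le _
  by_cases hq : q = 0
  · subst hq
    unfold blocks
    rw [dif_pos rfl, dif_pos rfl, sOf_zero]
    exact (opNorm_zeroFibWθ_rate hN a ha θ ν ν').trans
      (div_le_div_of_nonneg_right (le_max_right _ _) hγ)
  · unfold blocks
    rw [dif_neg hq, dif_neg hq, ← plant_eq_conj hN (abs_sOf_le M q)]
    exact (orderTwoOpRateResidualWθ_holds d a hθ0 hθ1 N R hN hRN ha (sOf M q) (abs_sOf_le M q)
      (sOf_ne_zero M hq) ν ν' hR).trans (div_le_div_of_nonneg_right (le_max_left _ _) hγ)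

/-- **THE TORUS η-RATE OF THE WEIGHTED FOURTH ITEM, multiplier form**: for every finite unit torus,
`N, R ≥ 1`, `a > 0`, `0 ≤ θ ≤ 1`, `ν, ν′`,
`‖mulW^{(η/R)}(W^θ∂_ν, W^θ∂_{ν′}) − J_R · mulW^{(η)}(W^θ∂_ν, W^θ∂_{ν′}) · J_Rᴴ‖ ≤ CTW(d,a)·η^{min(2θ,1)}`.
[cite: Balaban1984PropagatorsI, Prop. 1.1 (1.89) p.33; King1986, (4.19)-(4.23) p.672, (4.24), (4.29)-(4.31) p.673]
[folklore] -/
theorem opNorm_mulW_Wθ_rate (hN : 1 ≤ N) (hR : 1 ≤ R) (hRN : 1 ≤ R * N) (a : ℝ) (ha : 0 < a)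
    {θ : ℝ} (hθ0 : 0 ≤ θ) (hθ1 : θ ≤ 1) (ν ν' : Fin d) :
    ‖mulW (R * N) hRN M a ha
          (fun i => wsym (R * N) M θ i * fsym (fine (R * N) M) ((R * N : ℕ) : ℂ) ν i)
          (fun i => wsym (R * N) M θ i * fsym (fine (R * N) M) ((R * N : ℕ) : ℂ) ν' i)
        - Jmat N R M
          * mulW N hN M a ha (fun i => wsym N M θ i * fsym (fine N M) (N : ℂ) ν i)
              (fun i => wsym N M θ i * fsym (fine N M) (N : ℂ) ν' i)
          * (Jmat N R M)ᴴ‖ ≤ CTW d a / (N : ℝ) ^ (min (2 * θ) 1) := by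
  rw [mulW_eq_conj_blocks M hRN a ha _ _ (fun q k => wθdSym (R * N) θ k (sOf M q) ν)
      (fun q k => wθdSym (R * N) θ k (sOf M q) ν') (wfsym_restrict (R * N) M θ ν)
      (wfsym_restrict (R * N) M θ ν'),
    mulW_eq_conj_blocks M hN a ha _ _ (fun q k => wθdSym N θ k (sOf M q) ν)
      (fun q k => wθdSym N θ k (sOf M q) ν') (wfsym_restrict N M θ ν) (wfsym_restrict N M θ ν')]
  unfold Jmat Jhat
  exact opNorm_diff_planted_le (dftV_mul_star _) (dftV_mem_unitaryGroup _) (blockEquiv N M)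
    (blockEquiv (R * N) M) _ _ _ (div_nonneg (CTW_pos d a).le (Real.rpow_nonneg (Nat.cast_nonneg N) _))
    (blocksWθ_rate N R M hN hR hRN a ha hθ0 hθ1 ν ν')

/-- **THE TORUS η-RATE OF `𝒲_θ ∇_ν 𝒢 ∇_{ν′}^* 𝒲_θ`** (the fourth item of Bałaban's (1.89) at `U = 1`,
dressed on both sides with King's alias weight to the power `θ ∈ [0,1]`):
`‖𝒲_θ^{(η/R)} ∇_ν 𝒢^{(η/R)} ∇_{ν′}^* 𝒲_θ^{(η/R)} − J_R (𝒲_θ^{(η)} ∇_ν 𝒢^{(η)} ∇_{ν′}^* 𝒲_θ^{(η)}) J_Rᴴ‖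
 ≤ CTW(d,a)·η^{min(2θ,1)}`, every finite unit torus, `N, R ≥ 1`, `a > 0`.  At `θ = 0` (`𝒲_0 = 1`,
`Wop_zero`) this is only a uniform bound, and NO rate holds there
(`B5G183RateObstructionOp.not_orderTwoOpRateResidual`, `B5G183RateWThetaCentre.orderTwoOpRateWθ_law`);
the exponent `min(2θ,1)` is the fibrewise law of `B5G183RateWThetaHolds` / `…WThetaCentre`.
[cite: Balaban1984PropagatorsI, Prop. 1.1 (1.89) p.33; King1986, (4.19)-(4.20) p.672] [folklore] -/
theorem opNorm_weightedItem_rate (hN : 1 ≤ N) (hR : 1 ≤ R) (hRN : 1 ≤ R * N) (a : ℝ) (ha : 0 < a)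
    {θ : ℝ} (hθ0 : 0 ≤ θ) (hθ1 : θ ≤ 1) (ν ν' : Fin d) :
    ‖Wop (R * N) M θ
          * (fdiff (fine (R * N) M) ((R * N : ℕ) : ℂ) ν * calG (R * N) hRN M a ha
              * star (fdiff (fine (R * N) M) ((R * N : ℕ) : ℂ) ν'))
          * Wop (R * N) M θ
        - Jmat N R M
          * (Wop N M θ * (fdiff (fine N M) (N : ℂ) ν * calG N hN M a ha * star (fdiff (fine N M) (N : ℂ) ν'))
              * Wop N M θ)
          * (Jmat N R M)ᴴ‖ ≤ CTW d a / (N : ℝ) ^ (min (2 * θ) 1) := by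
  rw [weightedItem_eq_mulW, weightedItem_eq_mulW]
  exact opNorm_mulW_Wθ_rate N R M hN hR hRN a ha hθ0 hθ1 ν ν'

/-- **`θ = 1` (King's placement `u … ū` of (4.19)): the full rate `η`.** [folklore] -/
theorem opNorm_weightedItem_rate_one (hN : 1 ≤ N) (hR : 1 ≤ R) (hRN : 1 ≤ R * N) (a : ℝ)
    (ha : 0 < a) (ν ν' : Fin d) :
    ‖Wop (R * N) M 1
          * (fdiff (fine (R * N) M) ((R * N : ℕ) : ℂ) ν * calG (R * N) hRN M a ha
              * star (fdiff (fine (R * N) M) ((R * N : ℕ) : ℂ) ν'))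
          * Wop (R * N) M 1
        - Jmat N R M
          * (Wop N M 1 * (fdiff (fine N M) (N : ℂ) ν * calG N hN M a ha * star (fdiff (fine N M) (N : ℂ) ν'))
              * Wop N M 1)
          * (Jmat N R M)ᴴ‖ ≤ CTW d a / N := by
  have h := opNorm_weightedItem_rate N R M hN hR hRN a ha (θ := 1) zero_le_one le_rfl ν ν'
  have e : min (2 * (1 : ℝ)) 1 = 1 := by norm_num
  rw [e, Real.rpow_one] at h
  exact h

/-- **`θ = 1/2`: HALF a King weight on each side already gives the full rate `η`** (`min(2θ,1) = 1`).
[folklore] -/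
theorem opNorm_weightedItem_rate_half (hN : 1 ≤ N) (hR : 1 ≤ R) (hRN : 1 ≤ R * N) (a : ℝ)
    (ha : 0 < a) (ν ν' : Fin d) :
    ‖Wop (R * N) M (1 / 2)
          * (fdiff (fine (R * N) M) ((R * N : ℕ) : ℂ) ν * calG (R * N) hRN M a ha
              * star (fdiff (fine (R * N) M) ((R * N : ℕ) : ℂ) ν'))
          * Wop (R * N) M (1 / 2)
        - Jmat N R M
          * (Wop N M (1 / 2)
              * (fdiff (fine N M) (N : ℂ) ν * calG N hN M a ha * star (fdiff (fine N M) (N : ℂ) ν'))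
              * Wop N M (1 / 2))
          * (Jmat N R M)ᴴ‖ ≤ CTW d a / N := by
  have h := opNorm_weightedItem_rate N R M hN hR hRN a ha (θ := 1 / 2) (by norm_num) (by norm_num) ν ν'
  have e : min (2 * (1 / 2 : ℝ)) 1 = 1 := by norm_num
  rw [e, Real.rpow_one] at h
  exact h

/-- **uniform bound AND rate, side by side** for the weighted fourth item at `θ = 1`: b05's uniform
(1.89) bound of the UNweighted item (`opNorm_fdiff_calG_star_fdiff_le`, constant `Cst d a`) and the
rate of this module. [cite: Balaban1984PropagatorsI, Prop. 1.1 (1.89) p.33] [folklore] -/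
theorem orderTwo_uniform_and_weighted_rate (hN : 1 ≤ N) (hR : 1 ≤ R) (hRN : 1 ≤ R * N) (a : ℝ)
    (ha : 0 < a) (ν ν' : Fin d) :
    ‖fdiff (fine N M) (N : ℂ) ν * calG N hN M a ha * star (fdiff (fine N M) (N : ℂ) ν')‖ ≤ Cst d a
      ∧ ‖Wop (R * N) M 1
            * (fdiff (fine (R * N) M) ((R * N : ℕ) : ℂ) ν * calG (R * N) hRN M a ha
                * star (fdiff (fine (R * N) M) ((R * N : ℕ) : ℂ) ν'))
            * Wop (R * N) M 1
          - Jmat N R M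
            * (Wop N M 1
                * (fdiff (fine N M) (N : ℂ) ν * calG N hN M a ha * star (fdiff (fine N M) (N : ℂ) ν'))
                * Wop N M 1)
            * (Jmat N R M)ᴴ‖ ≤ CTW d a / N :=
  ⟨opNorm_fdiff_calG_star_fdiff_le N hN M a ha ν ν',
    opNorm_weightedItem_rate_one N R M hN hR hRN a ha ν ν'⟩

end TorusW

/-! ## §4 The torus difference DOMINATES every coset block: the Plancherel packaging loses nothing
[folklore] -/

section LowerBound

/-- **abstract lower bound**: each block difference `B′_q − P_q B_q P_qᴴ` is dominated in norm by
`X′ − J X Jᴴ` (`U′` unitary; b05's `opNorm_le_opNorm_blockDiagonal`). [folklore] -/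
theorem opNorm_block_le_diff_planted {m m' b b' o : Type*} [Fintype m] [DecidableEq m] [Fintype m']
    [DecidableEq m'] [Fintype b] [Fintype b'] [DecidableEq b'] [Fintype o] [DecidableEq o]
    {U : Matrix m m ℂ} (hU : U * star U = 1) {U' : Matrix m' m' ℂ}
    (hU' : U' ∈ Matrix.unitaryGroup m' ℂ) (e : m ≃ b × o) (e' : m' ≃ b' × o)
    (B : o → Matrix b b ℂ) (B' : o → Matrix b' b' ℂ) (P : o → Matrix b' b ℂ) (q : o) :
    ‖B' q - P q * B q * (P q)ᴴ‖
      ≤ ‖star U' * (Matrix.reindex e' e').symm (Matrix.blockDiagonal B') * U'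
          - (star U' * Matrix.reindex e'.symm e.symm (Matrix.blockDiagonal P) * U)
            * (star U * (Matrix.reindex e e).symm (Matrix.blockDiagonal B) * U)
            * (star U' * Matrix.reindex e'.symm e.symm (Matrix.blockDiagonal P) * U)ᴴ‖ := by
  rw [diff_planted_eq hU U' e e' B B' P]
  set D : o → Matrix b' b' ℂ := fun q => B' q - P q * B q * (P q)ᴴ with hD
  have h1 : ‖D q‖ ≤ ‖Matrix.blockDiagonal D‖ := opNorm_le_opNorm_blockDiagonal D q
  have h2 : ‖star U' * (Matrix.reindex e' e').symm (Matrix.blockDiagonal D) * U'‖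
      = ‖Matrix.blockDiagonal D‖ := by
    rw [opNorm_unitary_conj' hU']
    rw [Matrix.reindex_symm]
    exact opNorm_reindex e'.symm _
  rw [h2]
  exact h1

variable (N R : ℕ) [NeZero N] [NeZero R] (M : Fin d → ℕ) [hM : ∀ μ, NeZero (M μ)]

/-- **every coset block of the weighted order-two difference is dominated by the torus difference**
(multiplier form). [folklore] -/
theorem opNorm_blockWθ_le_mulW_diff (hN : 1 ≤ N) (hRN : 1 ≤ R * N) (a : ℝ) (ha : 0 < a) (θ : ℝ)
    (ν ν' : Fin d) (q : Tor M) :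
    ‖sandwich (fun k => wθdSym (R * N) θ k (sOf M q) ν) (fun k => wθdSym (R * N) θ k (sOf M q) ν')
          (blocks (R * N) hRN M a ha q)
        - Pmat N R (sOf M q)
          * sandwich (fun k => wθdSym N θ k (sOf M q) ν) (fun k => wθdSym N θ k (sOf M q) ν')
              (blocks N hN M a ha q)
          * (Pmat N R (sOf M q))ᴴ‖
      ≤ ‖mulW (R * N) hRN M a ha
            (fun i => wsym (R * N) M θ i * fsym (fine (R * N) M) ((R * N : ℕ) : ℂ) ν i)
            (fun i => wsym (R * N) M θ i * fsym (fine (R * N) M) ((R * N : ℕ) : ℂ) ν' i)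
          - Jmat N R M
            * mulW N hN M a ha (fun i => wsym N M θ i * fsym (fine N M) (N : ℂ) ν i)
                (fun i => wsym N M θ i * fsym (fine N M) (N : ℂ) ν' i)
            * (Jmat N R M)ᴴ‖ := by
  rw [mulW_eq_conj_blocks M hRN a ha _ _ (fun q k => wθdSym (R * N) θ k (sOf M q) ν)
      (fun q k => wθdSym (R * N) θ k (sOf M q) ν') (wfsym_restrict (R * N) M θ ν)
      (wfsym_restrict (R * N) M θ ν'),
    mulW_eq_conj_blocks M hN a ha _ _ (fun q k => wθdSym N θ k (sOf M q) ν)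
      (fun q k => wθdSym N θ k (sOf M q) ν') (wfsym_restrict N M θ ν) (wfsym_restrict N M θ ν')]
  unfold Jmat Jhat
  exact opNorm_block_le_diff_planted (dftV_mul_star _) (dftV_mem_unitaryGroup _) (blockEquiv N M)
    (blockEquiv (R * N) M) (fun q => sandwich (fun k => wθdSym N θ k (sOf M q) ν)
      (fun k => wθdSym N θ k (sOf M q) ν') (blocks N hN M a ha q))
    (fun q => sandwich (fun k => wθdSym (R * N) θ k (sOf M q) ν)
      (fun k => wθdSym (R * N) θ k (sOf M q) ν') (blocks (R * N) hRN M a ha q))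
    (fun q => Pmat N R (sOf M q)) q

/-- **… and by the weighted item itself** (operator form). [folklore] -/
theorem opNorm_blockWθ_le_weightedItem_diff (hN : 1 ≤ N) (hRN : 1 ≤ R * N) (a : ℝ) (ha : 0 < a)
    (θ : ℝ) (ν ν' : Fin d) (q : Tor M) :
    ‖sandwich (fun k => wθdSym (R * N) θ k (sOf M q) ν) (fun k => wθdSym (R * N) θ k (sOf M q) ν')
          (blocks (R * N) hRN M a ha q)
        - Pmat N R (sOf M q)
          * sandwich (fun k => wθdSym N θ k (sOf M q) ν) (fun k => wθdSym N θ k (sOf M q) ν')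
              (blocks N hN M a ha q)
          * (Pmat N R (sOf M q))ᴴ‖
      ≤ ‖Wop (R * N) M θ
            * (fdiff (fine (R * N) M) ((R * N : ℕ) : ℂ) ν * calG (R * N) hRN M a ha
                * star (fdiff (fine (R * N) M) ((R * N : ℕ) : ℂ) ν'))
            * Wop (R * N) M θ
          - Jmat N R M
            * (Wop N M θ
                * (fdiff (fine N M) (N : ℂ) ν * calG N hN M a ha * star (fdiff (fine N M) (N : ℂ) ν'))
                * Wop N M θ)
            * (Jmat N R M)ᴴ‖ := by
  rw [weightedItem_eq_mulW, weightedItem_eq_mulW]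
  exact opNorm_blockWθ_le_mulW_diff N R M hN hRN a ha θ ν ν' q

end LowerBound

/-! ## §5 The torus-level EXPONENT LAW `γ ≤ min(2θ, 1)` (`d ≥ 2`): the witness fibres of
`B5G183RateWThetaSharp` (`p′ = πe_{μ₁}`) and `B5G183RateWThetaCentre` (`p′ = πe_{μ₁} + (π/2)e_{μ₂}`)
ARE reduced momenta of the unit tori with `2` resp. `4` sites per direction [folklore] -/

section Law

/-- **THE TORUS CURRENCY**: `TorusRateWθ d a C θ γ` ≔ for every finite unit torus (`M_μ ≥ 1` sites of
spacing `1`), all `N ≥ 1`, `R ≥ 1`, `ν, ν′`: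
`‖𝒲_θ^{(η/R)} ∇_ν 𝒢^{(η/R)} ∇_{ν′}^* 𝒲_θ^{(η/R)} − J_R (𝒲_θ^{(η)} ∇_ν 𝒢^{(η)} ∇_{ν′}^* 𝒲_θ^{(η)}) J_Rᴴ‖ ≤ C·η^γ`,
`η = 1/N` — the operator-level (`ℓ²(T_η; ℂ^d)`) counterpart of the fibrewise currency
`B5G183RateWTheta.OrderTwoOpRateResidualWθ`. OURS. [cite: Balaban1984PropagatorsI, Prop. 1.1 (1.89)
p.33; King1986, (4.19)-(4.20) p.672] [folklore] -/
def TorusRateWθ (d : ℕ) (a C θ γ : ℝ) : Prop :=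
  ∀ (N R : ℕ) [NeZero N] [NeZero R] (M : Fin d → ℕ) [∀ μ, NeZero (M μ)] (hN : 1 ≤ N)
    (hRN : 1 ≤ R * N) (ha : 0 < a) (ν ν' : Fin d), 1 ≤ R →
    ‖Wop (R * N) M θ
          * (fdiff (fine (R * N) M) ((R * N : ℕ) : ℂ) ν * calG (R * N) hRN M a ha
              * star (fdiff (fine (R * N) M) ((R * N : ℕ) : ℂ) ν'))
          * Wop (R * N) M θ
        - Jmat N R M
          * (Wop N M θ
              * (fdiff (fine N M) (N : ℂ) ν * calG N hN M a ha * star (fdiff (fine N M) (N : ℂ) ν'))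
              * Wop N M θ)
          * (Jmat N R M)ᴴ‖ ≤ C / (N : ℝ) ^ γ

/-- **positive side**: `TorusRateWθ d a (CTW d a) θ γ` for every `γ ≤ min(2θ,1)`, `0 ≤ θ ≤ 1`, `a > 0`
(`opNorm_weightedItem_rate`). [folklore] -/
theorem torusRateWθ_of_le {a θ γ : ℝ} (hθ0 : 0 ≤ θ) (hθ1 : θ ≤ 1) (hγ : γ ≤ min (2 * θ) 1) :
    TorusRateWθ d a (CTW d a) θ γ := by
  intro N R _ _ M _ hN hRN ha ν ν' hR
  have hN0 : (0 : ℝ) < N := by exact_mod_cast hN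
  have hN1 : (1 : ℝ) ≤ N := by exact_mod_cast hN
  refine (opNorm_weightedItem_rate N R M hN hR hRN a ha hθ0 hθ1 ν ν').trans ?_
  exact div_le_div_of_nonneg_left (CTW_pos d a).le (Real.rpow_pos_of_pos hN0 γ)
    (Real.rpow_le_rpow_of_exponent_le hN1 hγ)

/-- hence `∃ C, TorusRateWθ d a C θ γ` for `γ ≤ min(2θ,1)`. [folklore] -/
theorem exists_torusRateWθ {a θ γ : ℝ} (hθ0 : 0 ≤ θ) (hθ1 : θ ≤ 1) (hγ : γ ≤ min (2 * θ) 1) :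
    ∃ C, TorusRateWθ d a C θ γ :=
  ⟨CTW d a, torusRateWθ_of_le hθ0 hθ1 hγ⟩

/-- transporting a weighted block difference along an equality of fibres (the fibre enters the
dependent proof arguments of `balabanFiber`). [folklore] -/
theorem blockWθ_congr {n R : ℕ} [NeZero n] [NeZero R] (hn : 1 ≤ n) (hRn : 1 ≤ R * n) (a : ℝ)
    (ha : 0 < a) (θ : ℝ) (ν ν' : Fin d) {s s' : Fin d → ℝ} (h : s = s')
    (hs : ∀ μ, |s μ| ≤ Real.pi) (hs0 : s ≠ 0) (hs' : ∀ μ, |s' μ| ≤ Real.pi) (hs0' : s' ≠ 0) :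
    sandwich (fun K => wθdSym (R * n) θ K s ν) (fun K => wθdSym (R * n) θ K s ν')
          (balabanFiber (R * n) hRn a ha s hs hs0).G
        - plant R s (sandwich (fun k => wθdSym n θ k s ν) (fun k => wθdSym n θ k s ν')
            (balabanFiber n hn a ha s hs hs0).G)
      = sandwich (fun K => wθdSym (R * n) θ K s' ν) (fun K => wθdSym (R * n) θ K s' ν')
          (balabanFiber (R * n) hRn a ha s' hs' hs0').G
        - plant R s' (sandwich (fun k => wθdSym n θ k s' ν) (fun k => wθdSym n θ k s' ν')
            (balabanFiber n hn a ha s' hs' hs0').G) := by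
  subst h
  rfl

/-- the unit torus with `2` sites in every direction. [folklore] -/
def Mtwo : Fin d → ℕ := fun _ => 2

/-- every direction of the `2`-torus has a site. [folklore] -/
instance Mtwo_neZero (μ : Fin d) : NeZero (Mtwo (d := d) μ) := ⟨two_ne_zero⟩

/-- its reduced momentum `q = e_{μ₁}` (one unit in direction `μ₁`). [folklore] -/
def qWit (μ₁ : Fin d) : Tor (Mtwo (d := d)) := fun μ => if μ = μ₁ then 1 else 0

/-- `q ≠ 0`. [folklore] -/
theorem qWit_ne_zero (μ₁ : Fin d) : qWit μ₁ ≠ 0 := by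
  intro h
  have h1 := congr_fun h μ₁
  simp only [qWit, if_true, Pi.zero_apply] at h1
  change (1 : ZMod 2) = 0 at h1
  exact absurd h1 (by decide)

/-- **`p′(e_{μ₁}) = π e_{μ₁}` on the `2`-torus = the witness fibre `sWit μ₁` of `B5G183RateWThetaSharp`.**
[folklore] -/
theorem sOf_qWit (μ₁ : Fin d) : sOf Mtwo (qWit μ₁) = sWit μ₁ := by
  funext μ
  unfold sOf sWit qWit Mtwo
  by_cases h : μ = μ₁
  · rw [if_pos h, if_pos h]
    have e1 : (((1 : ZMod 2).valMinAbs : ℤ) : ℝ) = 1 := by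
      have : (1 : ZMod 2).valMinAbs = 1 := by decide
      rw [this]; norm_num
    rw [e1]
    push_cast
    ring
  · rw [if_neg h, if_neg h, ZMod.valMinAbs_zero]
    push_cast
    ring

/-- **the torus currency bounds the Sharp witness `XW`** (block `q = e_{μ₁}` of the `2`-torus at the
levels `N = M+2`, `2N`). [folklore] -/
theorem opNorm_XW_le_of_torus {a C θ γ : ℝ} (hTor : TorusRateWθ d a C θ γ) (M : ℕ) [NeZero (M + 2)]
    (μ₁ : Fin d) (ha : 0 < a) : ‖XW M μ₁ a ha θ‖ ≤ C / ((M + 2 : ℕ) : ℝ) ^ γ := by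
  have hN : 1 ≤ M + 2 := by omega
  have hRN : 1 ≤ 2 * (M + 2) := by omega
  have h := hTor (M + 2) 2 Mtwo hN hRN ha μ₁ μ₁ (by norm_num)
  have hq := qWit_ne_zero (d := d) μ₁
  have hblk := opNorm_blockWθ_le_weightedItem_diff (M + 2) 2 Mtwo hN hRN a ha θ μ₁ μ₁ (qWit μ₁)
  unfold blocks at hblk
  rw [dif_neg hq, dif_neg hq, ← plant_eq_conj hN (abs_sOf_le Mtwo (qWit μ₁)),
    blockWθ_congr hN hRN a ha θ μ₁ μ₁ (sOf_qWit μ₁) (abs_sOf_le Mtwo (qWit μ₁))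
      (sOf_ne_zero Mtwo hq) (sWit_zone_ne_zero μ₁).1 (sWit_zone_ne_zero μ₁).2] at hblk
  exact hblk.trans h

/-- the unit torus with `4` sites in every direction. [folklore] -/
def Mfour : Fin d → ℕ := fun _ => 4

/-- every direction of the `4`-torus has a site. [folklore] -/
instance Mfour_neZero (μ : Fin d) : NeZero (Mfour (d := d) μ) := ⟨by show (4 : ℕ) ≠ 0; decide⟩

/-- its reduced momentum `q = 2e_{μ₁} + e_{μ₂}`. [folklore] -/
def qCen (μ₁ μ₂ : Fin d) : Tor (Mfour (d := d)) :=
  fun μ => if μ = μ₁ then 2 else if μ = μ₂ then 1 else 0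

/-- `q ≠ 0`. [folklore] -/
theorem qCen_ne_zero (μ₁ μ₂ : Fin d) : qCen μ₁ μ₂ ≠ 0 := by
  intro h
  have h1 := congr_fun h μ₁
  simp only [qCen, if_true, Pi.zero_apply] at h1
  change (2 : ZMod 4) = 0 at h1
  exact absurd h1 (by decide)

/-- **`p′(2e_{μ₁} + e_{μ₂}) = πe_{μ₁} + (π/2)e_{μ₂}` on the `4`-torus = the witness fibre `sCen μ₁ μ₂` of
`B5G183RateWThetaCentre`**. [folklore] -/
theorem sOf_qCen (μ₁ μ₂ : Fin d) : sOf Mfour (qCen μ₁ μ₂) = sCen μ₁ μ₂ := by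
  funext μ
  unfold sOf sCen qCen Mfour
  by_cases h : μ = μ₁
  · rw [if_pos h, if_pos h]
    have e1 : (((2 : ZMod 4).valMinAbs : ℤ) : ℝ) = 2 := by
      have : (2 : ZMod 4).valMinAbs = 2 := by decide
      rw [this]; norm_num
    rw [e1]
    push_cast
    ring
  · rw [if_neg h, if_neg h]
    by_cases h' : μ = μ₂
    · rw [if_pos h', if_pos h']
      have e1 : (((1 : ZMod 4).valMinAbs : ℤ) : ℝ) = 1 := by
        have : (1 : ZMod 4).valMinAbs = 1 := by decide
        rw [this]; norm_num
      rw [e1]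
      push_cast
      ring
    · rw [if_neg h', if_neg h', ZMod.valMinAbs_zero]
      push_cast
      ring

/-- **the torus currency bounds the Centre witness `XC`** (block `q = 2e_{μ₁} + e_{μ₂}` of the `4`-torus,
directions `(ν, ν′) = (μ₁, μ₂)`). [folklore] -/
theorem opNorm_XC_le_of_torus {a C θ γ : ℝ} (hTor : TorusRateWθ d a C θ γ) (M : ℕ) [NeZero (M + 2)]
    (μ₁ μ₂ : Fin d) (ha : 0 < a) :
    ‖XC M μ₁ μ₂ a ha θ‖ ≤ C / ((M + 2 : ℕ) : ℝ) ^ γ := by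
  have hN : 1 ≤ M + 2 := by omega
  have hRN : 1 ≤ 2 * (M + 2) := by omega
  have h := hTor (M + 2) 2 Mfour hN hRN ha μ₁ μ₂ (by norm_num)
  have hq := qCen_ne_zero (d := d) μ₁ μ₂
  have hblk := opNorm_blockWθ_le_weightedItem_diff (M + 2) 2 Mfour hN hRN a ha θ μ₁ μ₂ (qCen μ₁ μ₂)
  unfold blocks at hblk
  rw [dif_neg hq, dif_neg hq, ← plant_eq_conj hN (abs_sOf_le Mfour (qCen μ₁ μ₂)),
    blockWθ_congr hN hRN a ha θ μ₁ μ₂ (sOf_qCen μ₁ μ₂) (abs_sOf_le Mfour (qCen μ₁ μ₂))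
      (sOf_ne_zero Mfour hq) (sCen_zone_ne_zero μ₁ μ₂).1 (sCen_zone_ne_zero μ₁ μ₂).2] at hblk
  exact hblk.trans h

/-- **NO torus rate `η^γ` with `γ > 2θ`** (`0 ≤ θ < 1`, every `C`, `d ≥ 1`, `a > 0`): the on-axis
unpaired witness of `B5G183RateWThetaSharp` read on the `2`-torus.  The proof body is, verbatim, that
of `B5G183RateWThetaSharp.not_orderTwoOpRateResidualWθ_of_lt` with its single use of the fibrewise
currency (`opNorm_XW_le h M μ₁ ha`) replaced by `opNorm_XW_le_of_torus hTor M μ₁ ha`. [folklore] -/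
theorem not_torusRateWθ_of_lt (μ₁ : Fin d) (a : ℝ) (ha : 0 < a) {C θ γ : ℝ} (hθ0 : 0 ≤ θ)
    (hθ1 : θ < 1) (hγ : 2 * θ < γ) : ¬ TorusRateWθ d a C θ γ := by
  intro hTor
  have hCj := Cjunk_nonneg d ha
  have hT₁0 : 0 ≤ (8 * |C| + 1) ^ (1 / (γ - 2 * θ)) := Real.rpow_nonneg (by positivity) _
  have hT₂0 : 0 ≤ (8 * Cjunk d a + 1) ^ (1 / (2 - 2 * θ)) := Real.rpow_nonneg (by positivity) _
  obtain ⟨M, hM⟩ := exists_nat_ge ((8 * |C| + 1) ^ (1 / (γ - 2 * θ))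
    + (8 * Cjunk d a + 1) ^ (1 / (2 - 2 * θ)))
  haveI : NeZero (M + 2) := ⟨by omega⟩
  have hM0 : (0 : ℝ) ≤ M := Nat.cast_nonneg M
  have hNM : ((M + 2 : ℕ) : ℝ) = (M : ℝ) + 2 := by push_cast; ring
  have hN2 : (2 : ℝ) ≤ ((M + 2 : ℕ) : ℝ) := by rw [hNM]; linarith
  have hN0 : (0 : ℝ) < ((M + 2 : ℕ) : ℝ) := by linarith
  have hT₁ : (8 * |C| + 1) ^ (1 / (γ - 2 * θ)) ≤ ((M + 2 : ℕ) : ℝ) := by rw [hNM]; linarith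
  have hT₂ : (8 * Cjunk d a + 1) ^ (1 / (2 - 2 * θ)) ≤ ((M + 2 : ℕ) : ℝ) := by rw [hNM]; linarith
  -- the witness entry is dominated by the operator norm
  have hent := (norm_apply_le_norm (XW M μ₁ a ha θ) (KW M μ₁, μ₁) (KW M μ₁, μ₁)).trans
    (opNorm_XW_le_of_torus hTor M μ₁ ha)
  rw [XW_entry M μ₁ a ha θ, Gfor_diag, weight_mul_diag, main_KW] at hent
  have hJ := junk_KW_le M μ₁ a ha hθ0
  -- main term ≤ C/N^γ + Cj/N²
  have hmain : (((1 : ℝ) / (2 * M + 3)) ^ θ) ^ 2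
      ≤ C / ((M + 2 : ℕ) : ℝ) ^ γ + Cjunk d a / ((M + 2 : ℕ) : ℝ) ^ 2 := by
    have h1 := norm_sub_le
      ((((((1 : ℝ) / (2 * M + 3)) ^ θ) ^ 2 : ℝ) : ℂ)
        + ((‖wθdSym (2 * (M + 2)) θ (KW M μ₁) (sWit μ₁) μ₁‖ ^ 2 : ℝ) : ℂ)
          * (rEnt (2 * (M + 2)) a μ₁ μ₁ (sWit μ₁) (KW M μ₁) (KW M μ₁)
            - xEnt (2 * (M + 2)) a μ₁ (sWit μ₁) (KW M μ₁) (KW M μ₁)))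
      (((‖wθdSym (2 * (M + 2)) θ (KW M μ₁) (sWit μ₁) μ₁‖ ^ 2 : ℝ) : ℂ)
          * (rEnt (2 * (M + 2)) a μ₁ μ₁ (sWit μ₁) (KW M μ₁) (KW M μ₁)
            - xEnt (2 * (M + 2)) a μ₁ (sWit μ₁) (KW M μ₁) (KW M μ₁)))
    rw [add_sub_cancel_right, Complex.norm_real, Real.norm_eq_abs, abs_of_nonneg (sq_nonneg _)] at h1
    linarith
  -- lower bound of the main term: (1/(2M+3))^{2θ} ≥ (1/(2N))^{2θ} ≥ 1/(4 N^{2θ})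
  have hW0 : (0 : ℝ) ≤ 1 / (2 * M + 3) := by positivity
  have hsq : (((1 : ℝ) / (2 * M + 3)) ^ θ) ^ 2 = ((1 : ℝ) / (2 * M + 3)) ^ (2 * θ) := by
    rw [← Real.rpow_two, ← Real.rpow_mul hW0]; congr 1; ring
  have hWN : 1 / (2 * ((M + 2 : ℕ) : ℝ)) ≤ (1 : ℝ) / (2 * M + 3) :=
    div_le_div_of_nonneg_left zero_le_one (by positivity) (by rw [hNM]; linarith)
  have hlow : 1 / (4 * ((M + 2 : ℕ) : ℝ) ^ (2 * θ)) ≤ (((1 : ℝ) / (2 * M + 3)) ^ θ) ^ 2 := by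
    rw [hsq]
    have h22 : (2 : ℝ) ^ (2 * θ) ≤ 4 :=
      calc (2 : ℝ) ^ (2 * θ) ≤ (2 : ℝ) ^ (2 : ℝ) :=
            Real.rpow_le_rpow_of_exponent_le (by norm_num) (by linarith)
        _ = 4 := by rw [Real.rpow_two]; norm_num
    calc 1 / (4 * ((M + 2 : ℕ) : ℝ) ^ (2 * θ))
        ≤ 1 / ((2 * ((M + 2 : ℕ) : ℝ)) ^ (2 * θ)) := by
          refine div_le_div_of_nonneg_left zero_le_one (Real.rpow_pos_of_pos (by positivity) _) ?_
          rw [Real.mul_rpow (by norm_num) hN0.le]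
          exact mul_le_mul_of_nonneg_right h22 (Real.rpow_nonneg hN0.le _)
      _ = (1 / (2 * ((M + 2 : ℕ) : ℝ))) ^ (2 * θ) := by
          rw [Real.div_rpow zero_le_one (by positivity), Real.one_rpow]
      _ ≤ ((1 : ℝ) / (2 * M + 3)) ^ (2 * θ) := Real.rpow_le_rpow (by positivity) hWN (by linarith)
  exact numeric_coreθ hN2 hθ1 hγ hCj (hlow.trans hmain) hT₁ hT₂

/-- **NO torus rate `η^γ` with `γ > 1`** (every real `θ`, every `C`, `d ≥ 2`, `a > 0`): the centre
witness of `B5G183RateWThetaCentre` read on the `4`-torus.  The proof body is, verbatim, that of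
`B5G183RateWThetaCentre.not_orderTwoOpRateResidualWθoff_of_one_lt` with its single use of the
fibrewise currency (`opNorm_XC_le h M hne ha`) replaced by `opNorm_XC_le_of_torus hTor M μ₁ μ₂ ha`.
[folklore] -/
theorem not_torusRateWθ_of_one_lt {μ₁ μ₂ : Fin d} (hne : μ₁ ≠ μ₂) (a : ℝ) (ha : 0 < a) (θ : ℝ)
    {C γ : ℝ} (hγ : 1 < γ) : ¬ TorusRateWθ d a C θ γ := by
  intro hTor
  have hπ := Real.pi_pos
  have hd1 : (1 : ℝ) ≤ d := by
    have : 1 ≤ d := by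
      rcases Nat.lt_or_ge 0 d with h0 | h0
      · omega
      · exact absurd (Fin.pos μ₁) (by omega)
    exact_mod_cast this
  -- the θ-blind constant
  set g₀ : ℝ := 1 / (Real.pi ^ 2 * d + a) with hg₀
  have hg₀pos : 0 < g₀ := by positivity
  have hc : 0 < g₀ / 2 := by positivity
  obtain ⟨M, hM⟩ := exists_nat_ge ((|C| / (g₀ / 2) + 1) ^ (1 / (γ - 1)))
  haveI : NeZero (M + 2) := ⟨by omega⟩
  have hN : 1 ≤ M + 2 := by omega
  have hM0 : (0 : ℝ) ≤ M := Nat.cast_nonneg M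
  have hNM : ((M + 2 : ℕ) : ℝ) = (M : ℝ) + 2 := by push_cast; ring
  have hN1 : (1 : ℝ) ≤ ((M + 2 : ℕ) : ℝ) := by rw [hNM]; linarith
  have hN0 : (0 : ℝ) < ((M + 2 : ℕ) : ℝ) := by linarith
  have hT : (|C| / (g₀ / 2) + 1) ^ (1 / (γ - 1)) ≤ ((M + 2 : ℕ) : ℝ) := by rw [hNM]; linarith
  set Nr : ℝ := ((M + 2 : ℕ) : ℝ) with hNr
  have h2Nr : ((2 * (M + 2) : ℕ) : ℝ) = 2 * Nr := by rw [hNr]; push_cast; ring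
  have hs := (sCen_zone_ne_zero μ₁ μ₂).1
  have hs0 := (sCen_zone_ne_zero μ₁ μ₂).2
  -- the fibre data at the two levels
  set F₁ := balabanFiber (M + 2) (by omega) a ha (sCen μ₁ μ₂) hs hs0 with hF₁
  set F₂ := balabanFiber (2 * (M + 2)) (by omega) a ha (sCen μ₁ μ₂) hs hs0 with hF₂
  -- lower bound of the level-N centre entry g ≥ g₀
  have hg₁ : g₀ ≤ gC F₁ μ₁ := by
    have h1 := gC_ge F₁ μ₁
    have h2 := F₁.Δo_le_4dκ
    have hκ : F₁.κ = Real.pi ^ 2 / 4 := rfl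
    have haF : F₁.a = a := rfl
    rw [hκ] at h2
    rw [haF] at h1
    refine le_trans ?_ h1
    rw [hg₀]
    apply div_le_div_of_nonneg_left zero_le_one (by have := F₁.Δo_pos; positivity)
    nlinarith
  -- entry ≤ operator norm ≤ C/N^γ
  have hent := (norm_apply_le_norm (XC M μ₁ μ₂ a ha θ)
    ((0 : Fin d → Fin (2 * (M + 2))), μ₁) ((0 : Fin d → Fin (2 * (M + 2))), μ₁)).trans
    (opNorm_XC_le_of_torus hTor M μ₁ μ₂ ha)
  rw [XC_entry M hne a ha θ] at hent
  simp only [h2Nr] at hent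
  rw [← hNr] at hent
  -- the amplitudes and phases
  set P₂ : ℝ := 4 * (2 * Nr) ^ 2 * Real.sin (Real.pi / (2 * (2 * Nr)))
    * Real.sin (Real.pi / 2 / (2 * (2 * Nr))) * gC F₂ μ₁ with hP₂
  set P₁ : ℝ := 4 * Nr ^ 2 * Real.sin (Real.pi / (2 * Nr)) * Real.sin (Real.pi / 2 / (2 * Nr))
    * gC F₁ μ₁ with hP₁
  set φ₂ : ℝ := Real.pi / (2 * (2 * Nr)) - Real.pi / 2 / (2 * (2 * Nr)) with hφ₂
  set φ₁ : ℝ := Real.pi / (2 * Nr) - Real.pi / 2 / (2 * Nr) with hφ₁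
  have hψ : φ₁ - φ₂ = Real.pi / (8 * Nr) := by rw [hφ₁, hφ₂]; field_simp; ring
  -- Jordan's inequality at the three angles
  have hJ1 : 1 / Nr ≤ Real.sin (Real.pi / (2 * Nr)) := by
    have h0 : 0 ≤ Real.pi / (2 * Nr) := by positivity
    have h1 : Real.pi / (2 * Nr) ≤ Real.pi / 2 :=
      div_le_div_of_nonneg_left hπ.le (by norm_num) (by linarith)
    have := Real.mul_le_sin h0 h1
    have e : 2 / Real.pi * (Real.pi / (2 * Nr)) = 1 / Nr := by field_simp
    linarith
  have hJ2 : 1 / (2 * Nr) ≤ Real.sin (Real.pi / 2 / (2 * Nr)) := by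
    have h0 : 0 ≤ Real.pi / 2 / (2 * Nr) := by positivity
    have h1 : Real.pi / 2 / (2 * Nr) ≤ Real.pi / 2 := by
      rw [div_le_iff₀ (by positivity : (0 : ℝ) < 2 * Nr)]; nlinarith
    have := Real.mul_le_sin h0 h1
    have e : 2 / Real.pi * (Real.pi / 2 / (2 * Nr)) = 1 / (2 * Nr) := by field_simp
    linarith
  have hJ3 : 1 / (4 * Nr) ≤ Real.sin (φ₁ - φ₂) := by
    rw [hψ]
    have h0 : 0 ≤ Real.pi / (8 * Nr) := by positivity
    have h1 : Real.pi / (8 * Nr) ≤ Real.pi / 2 :=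
      div_le_div_of_nonneg_left hπ.le (by norm_num) (by linarith)
    have := Real.mul_le_sin h0 h1
    have e : 2 / Real.pi * (Real.pi / (8 * Nr)) = 1 / (4 * Nr) := by field_simp; ring
    linarith
  have hψ0 : 0 ≤ φ₁ - φ₂ := by rw [hψ]; positivity
  have hψ1 : φ₁ - φ₂ ≤ Real.pi := by
    rw [hψ, div_le_iff₀ (by positivity : (0 : ℝ) < 8 * Nr)]; nlinarith
  -- P₁ ≥ 2 g₀
  have hgpos := gC_pos F₁ μ₁
  have hP₁ge : 2 * g₀ ≤ P₁ := by
    rw [hP₁]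
    have hs1 : 0 ≤ Real.sin (Real.pi / (2 * Nr)) := le_trans (by positivity) hJ1
    have hs2 : 0 ≤ Real.sin (Real.pi / 2 / (2 * Nr)) := le_trans (by positivity) hJ2
    calc 2 * g₀ = 4 * Nr ^ 2 * (1 / Nr) * (1 / (2 * Nr)) * g₀ := by field_simp; ring
      _ ≤ 4 * Nr ^ 2 * Real.sin (Real.pi / (2 * Nr)) * Real.sin (Real.pi / 2 / (2 * Nr))
          * gC F₁ μ₁ := by
          gcongr
  have hP₁0 : 0 ≤ P₁ := le_trans (by positivity) hP₁ge
  -- |entry| ≥ P₁ sin(ψ) ≥ 2g₀/(4N) = (g₀/2)/N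
  have hlow := polar_diff_lower (P₂ := P₂) hP₁0 hψ0 hψ1
  have hchain : g₀ / 2 / Nr ≤ C / Nr ^ γ := by
    refine le_trans ?_ (hlow.trans hent)
    calc g₀ / 2 / Nr = 2 * g₀ * (1 / (4 * Nr)) := by field_simp; ring
      _ ≤ P₁ * Real.sin (φ₁ - φ₂) :=
          mul_le_mul hP₁ge hJ3 (by positivity) hP₁0
  exact numeric_core1 hN1 hc hγ hchain hT

/-- **THE TORUS EXPONENT LAW: `(∃ C, TorusRateWθ d a C θ γ) ↔ γ ≤ min(2θ, 1)`** for `0 ≤ θ ≤ 1`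
(`d ≥ 2`, `a > 0`) — on `ℓ²(T_η; ℂ^d)` the η-rate exponent of King's weighted fourth item
`𝒲_θ ∇_ν 𝒢 ∇_{ν′}^* 𝒲_θ` under the two-level injection `J_R` is EXACTLY `min(2θ, 1)`: the fibrewise
law `B5G183RateWThetaCentre.orderTwoOpRateWθ_law` survives the Plancherel packaging unchanged (`⇐`
`exists_torusRateWθ`; `⇒` `not_torusRateWθ_of_lt`, `not_torusRateWθ_of_one_lt`).
[cite: Balaban1984PropagatorsI, Prop. 1.1 (1.89) p.33; King1986, (4.19)-(4.20), (4.23) p.672, (4.24)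
p.673] [folklore] -/
theorem torusRateWθ_law {μ₁ μ₂ : Fin d} (hne : μ₁ ≠ μ₂) {a : ℝ} (ha : 0 < a) {θ γ : ℝ}
    (hθ0 : 0 ≤ θ) (hθ1 : θ ≤ 1) :
    (∃ C, TorusRateWθ d a C θ γ) ↔ γ ≤ min (2 * θ) 1 := by
  constructor
  · rintro ⟨C, hC⟩
    by_contra hlt
    rcases min_lt_iff.mp (lt_of_not_ge hlt) with h2 | h1
    · rcases lt_or_ge θ 1 with hθ | hθ
      · exact not_torusRateWθ_of_lt μ₁ a ha hθ0 hθ h2 hC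
      · exact not_torusRateWθ_of_one_lt hne a ha θ (by linarith) hC
    · exact not_torusRateWθ_of_one_lt hne a ha θ h1 hC
  · intro hγ
    exact exists_torusRateWθ hθ0 hθ1 hγ

/-- **King's placement `θ = 1`: rate `η`, and NOT `η^γ` for any `γ > 1`** on the torus. [folklore] -/
theorem torusRateWθ_one_law {μ₁ μ₂ : Fin d} (hne : μ₁ ≠ μ₂) {a : ℝ} (ha : 0 < a) {γ : ℝ} :
    (∃ C, TorusRateWθ d a C 1 γ) ↔ γ ≤ 1 := by
  rw [torusRateWθ_law hne ha zero_le_one le_rfl]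
  norm_num

/-- **the UNweighted item `θ = 0` (`𝒲_0 = 1`): NO torus rate `η^γ` for ANY `γ > 0`**, already in
`d = 1` — the operator-level form of `B5G183RateObstructionOp.not_orderTwoOpRateResidual`. [folklore] -/
theorem not_torusRateWθ_zero_of_pos (μ₁ : Fin d) (a : ℝ) (ha : 0 < a) (C : ℝ) {γ : ℝ} (hγ : 0 < γ) :
    ¬ TorusRateWθ d a C 0 γ :=
  not_torusRateWθ_of_lt μ₁ a ha le_rfl zero_lt_one (by linarith)

end Law

/-! ## §6 (v1.1) MIXED DIRECTIONS `ν ≠ ν′`: the torus η-rate with exponent `min(4θ, 1)` and the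
torus-level law `γ ≤ min(4θ, 1)` (`d ≥ 2`) — the Plancherel packaging of `B5G183RateWThetaMixed` /
`B5G183RateWThetaMixedSharp` / `B5G183RateWThetaCentre`, by the §3–§5 mechanism verbatim [folklore] -/

section Mixed

open Literature.MathematicalPhysics.QuantumFieldTheory.Balaban1983to89.B5G183RateWThetaMixed
open Literature.MathematicalPhysics.QuantumFieldTheory.Balaban1983to89.B5G183RateWThetaMixedSharp

variable (N R : ℕ) [NeZero N] [NeZero R] (M : Fin d → ℕ) [hM : ∀ μ, NeZero (M μ)]

omit [NeZero N] [NeZero R] hM in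
/-- the constant of the mixed-direction torus rate: the fibrewise `CXop d a` of
`B5G183RateWThetaMixed.orderTwoOpRateResidualWθoff_holds` (`p′ ≠ 0`) against the zero-coset `CzrW a`.
[folklore] -/
def CTX (d : ℕ) (a : ℝ) : ℝ := max (CXop d a) (CzrW a)

omit [NeZero N] [NeZero R] hM in
/-- `0 < CTX`. [folklore] -/
theorem CTX_pos (d : ℕ) (a : ℝ) : 0 < CTX d a := lt_of_lt_of_le (CzrW_pos a) (le_max_right _ _)

omit [NeZero N] [NeZero R] hM in
/-- `CTW ≤ CTX` (`a > 0`): the mixed constant dominates the all-directions one (`CW1op ≤ CXop`,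
`B5G183RateWThetaMixed.CXop_bounds`). [folklore] -/
theorem CTW_le_CTX (d : ℕ) {a : ℝ} (ha : 0 < a) : CTW d a ≤ CTX d a :=
  max_le_max (CXop_bounds d ha).2.2.1 le_rfl

omit hM in
/-- the weighted order-two zero coset once more, right side `CzrW(a)/N^{min(4θ,1)}`: for `θ ≠ 0` the
left side is `0`, for `θ = 0` both exponents vanish (`opNorm_zeroFibWθ_rate`). [folklore] -/
theorem opNorm_zeroFibWθ_rate_four (hN : 1 ≤ N) (a : ℝ) (ha : 0 < a) (θ : ℝ) (ν ν' : Fin d) :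
    ‖sandwich (fun K => wθdSym (R * N) θ K (0 : Fin d → ℝ) ν)
          (fun K => wθdSym (R * N) θ K (0 : Fin d → ℝ) ν') (zeroFib (R * N) a)
        - Pmat N R (0 : Fin d → ℝ)
          * sandwich (fun k => wθdSym N θ k (0 : Fin d → ℝ) ν)
              (fun k => wθdSym N θ k (0 : Fin d → ℝ) ν') (zeroFib N a)
          * (Pmat N R (0 : Fin d → ℝ))ᴴ‖ ≤ CzrW a / (N : ℝ) ^ (min (4 * θ) 1) := by
  have hN0 : (0 : ℝ) < N := by exact_mod_cast hN
  by_cases hθ : θ = 0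
  · subst hθ
    have h := opNorm_zeroFibWθ_rate (R := R) hN a ha 0 ν ν'
    have e2 : CzrW a / (N : ℝ) ^ (min (2 * (0 : ℝ)) 1) = CzrW a := by
      rw [mul_zero, min_eq_left (zero_le_one : (0 : ℝ) ≤ 1), Real.rpow_zero, div_one]
    have e4 : CzrW a / (N : ℝ) ^ (min (4 * (0 : ℝ)) 1) = CzrW a := by
      rw [mul_zero, min_eq_left (zero_le_one : (0 : ℝ) ≤ 1), Real.rpow_zero, div_one]
    rw [e4]
    rw [e2] at h
    exact h
  · rw [zeroFibWθ_eq_zero hθ, zeroFibWθ_eq_zero hθ, Matrix.mul_zero, Matrix.zero_mul, sub_zero,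
      norm_zero]
    exact div_nonneg (CzrW_pos a).le (Real.rpow_nonneg hN0.le _)

/-- blockwise weighted order-two rate over EVERY coset in MIXED directions `ν ≠ ν′`, exponent
`min(4θ,1)` (`p′ ≠ 0`: the kernel theorem `B5G183RateWThetaMixed.orderTwoOpRateResidualWθoff_holds`;
`p′ = 0`: `opNorm_zeroFibWθ_rate_four`). [folklore] -/
theorem blocksWθoff_rate (hN : 1 ≤ N) (hR : 1 ≤ R) (hRN : 1 ≤ R * N) (a : ℝ) (ha : 0 < a) {θ : ℝ}
    (hθ0 : 0 ≤ θ) (hθ1 : θ ≤ 1) {ν ν' : Fin d} (hne : ν ≠ ν') (q : Tor M) :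
    ‖sandwich (fun k => wθdSym (R * N) θ k (sOf M q) ν) (fun k => wθdSym (R * N) θ k (sOf M q) ν')
          (blocks (R * N) hRN M a ha q)
        - Pmat N R (sOf M q)
          * sandwich (fun k => wθdSym N θ k (sOf M q) ν) (fun k => wθdSym N θ k (sOf M q) ν')
              (blocks N hN M a ha q)
          * (Pmat N R (sOf M q))ᴴ‖ ≤ CTX d a / (N : ℝ) ^ (min (4 * θ) 1) := by
  have hN0 : (0 : ℝ) < N := by exact_mod_cast hN
  have hγ : 0 ≤ (N : ℝ) ^ (min (4 * θ) 1) := Real.rpow_nonneg hN0.le _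
  by_cases hq : q = 0
  · subst hq
    unfold blocks
    rw [dif_pos rfl, dif_pos rfl, sOf_zero]
    exact (opNorm_zeroFibWθ_rate_four N R hN a ha θ ν ν').trans
      (div_le_div_of_nonneg_right (le_max_right _ _) hγ)
  · unfold blocks
    rw [dif_neg hq, dif_neg hq, ← plant_eq_conj hN (abs_sOf_le M q)]
    exact (orderTwoOpRateResidualWθoff_holds d a hθ0 hθ1 N R hN hRN ha (sOf M q) (abs_sOf_le M q)
      (sOf_ne_zero M hq) ν ν' hne hR).trans (div_le_div_of_nonneg_right (le_max_left _ _) hγ)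

/-- the mixed-direction torus rate, multiplier form:
`‖mulW^{(η/R)}(W^θ∂_ν, W^θ∂_{ν′}) − J_R · mulW^{(η)}(W^θ∂_ν, W^θ∂_{ν′}) · J_Rᴴ‖ ≤ CTX(d,a)·η^{min(4θ,1)}`
for `ν ≠ ν′`. [folklore] -/
theorem opNorm_mulW_Wθoff_rate (hN : 1 ≤ N) (hR : 1 ≤ R) (hRN : 1 ≤ R * N) (a : ℝ) (ha : 0 < a)
    {θ : ℝ} (hθ0 : 0 ≤ θ) (hθ1 : θ ≤ 1) {ν ν' : Fin d} (hne : ν ≠ ν') :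
    ‖mulW (R * N) hRN M a ha
          (fun i => wsym (R * N) M θ i * fsym (fine (R * N) M) ((R * N : ℕ) : ℂ) ν i)
          (fun i => wsym (R * N) M θ i * fsym (fine (R * N) M) ((R * N : ℕ) : ℂ) ν' i)
        - Jmat N R M
          * mulW N hN M a ha (fun i => wsym N M θ i * fsym (fine N M) (N : ℂ) ν i)
              (fun i => wsym N M θ i * fsym (fine N M) (N : ℂ) ν' i)
          * (Jmat N R M)ᴴ‖ ≤ CTX d a / (N : ℝ) ^ (min (4 * θ) 1) := by
  rw [mulW_eq_conj_blocks M hRN a ha _ _ (fun q k => wθdSym (R * N) θ k (sOf M q) ν)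
      (fun q k => wθdSym (R * N) θ k (sOf M q) ν') (wfsym_restrict (R * N) M θ ν)
      (wfsym_restrict (R * N) M θ ν'),
    mulW_eq_conj_blocks M hN a ha _ _ (fun q k => wθdSym N θ k (sOf M q) ν)
      (fun q k => wθdSym N θ k (sOf M q) ν') (wfsym_restrict N M θ ν) (wfsym_restrict N M θ ν')]
  unfold Jmat Jhat
  exact opNorm_diff_planted_le (dftV_mul_star _) (dftV_mem_unitaryGroup _) (blockEquiv N M)
    (blockEquiv (R * N) M) _ _ _ (div_nonneg (CTX_pos d a).le (Real.rpow_nonneg (Nat.cast_nonneg N) _))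
    (blocksWθoff_rate N R M hN hR hRN a ha hθ0 hθ1 hne)

/-- **THE TORUS η-RATE OF `𝒲_θ ∇_ν 𝒢 ∇_{ν′}^* 𝒲_θ` IN MIXED DIRECTIONS `ν ≠ ν′`**: for every finite
unit torus, `N, R ≥ 1`, `a > 0`, `0 ≤ θ ≤ 1`,
`‖𝒲_θ^{(η/R)} ∇_ν 𝒢^{(η/R)} ∇_{ν′}^* 𝒲_θ^{(η/R)} − J_R (𝒲_θ^{(η)} ∇_ν 𝒢^{(η)} ∇_{ν′}^* 𝒲_θ^{(η)}) J_Rᴴ‖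
 ≤ CTX(d,a)·η^{min(4θ,1)}` — each of King's coordinate factors pays for its own coordinate, so two
weights `W^θ` on DIFFERENT coordinates pay `4θ` momentum powers (the fibrewise law of
`B5G183RateWThetaMixed`); for `0 < θ < 1/2` this beats the all-directions exponent `min(2θ,1)` of
`opNorm_weightedItem_rate` (`B5G183RateWThetaMixed.mixed_exponent_gt`).
[cite: Balaban1984PropagatorsI, Prop. 1.1 (1.89) p.33; King1986, (4.19)-(4.20) p.672] [folklore] -/
theorem opNorm_weightedItem_rate_mixed (hN : 1 ≤ N) (hR : 1 ≤ R) (hRN : 1 ≤ R * N) (a : ℝ)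
    (ha : 0 < a) {θ : ℝ} (hθ0 : 0 ≤ θ) (hθ1 : θ ≤ 1) {ν ν' : Fin d} (hne : ν ≠ ν') :
    ‖Wop (R * N) M θ
          * (fdiff (fine (R * N) M) ((R * N : ℕ) : ℂ) ν * calG (R * N) hRN M a ha
              * star (fdiff (fine (R * N) M) ((R * N : ℕ) : ℂ) ν'))
          * Wop (R * N) M θ
        - Jmat N R M
          * (Wop N M θ * (fdiff (fine N M) (N : ℂ) ν * calG N hN M a ha * star (fdiff (fine N M) (N : ℂ) ν'))
              * Wop N M θ)
          * (Jmat N R M)ᴴ‖ ≤ CTX d a / (N : ℝ) ^ (min (4 * θ) 1) := by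
  rw [weightedItem_eq_mulW, weightedItem_eq_mulW]
  exact opNorm_mulW_Wθoff_rate N R M hN hR hRN a ha hθ0 hθ1 hne

/-- **`θ = 1/4`, mixed directions: a QUARTER of King's weight on each derivative already gives the full
rate `η`** (`min(4·¼, 1) = 1`). [folklore] -/
theorem opNorm_weightedItem_rate_mixed_quarter (hN : 1 ≤ N) (hR : 1 ≤ R) (hRN : 1 ≤ R * N) (a : ℝ)
    (ha : 0 < a) {ν ν' : Fin d} (hne : ν ≠ ν') :
    ‖Wop (R * N) M (1 / 4)
          * (fdiff (fine (R * N) M) ((R * N : ℕ) : ℂ) ν * calG (R * N) hRN M a ha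
              * star (fdiff (fine (R * N) M) ((R * N : ℕ) : ℂ) ν'))
          * Wop (R * N) M (1 / 4)
        - Jmat N R M
          * (Wop N M (1 / 4)
              * (fdiff (fine N M) (N : ℂ) ν * calG N hN M a ha * star (fdiff (fine N M) (N : ℂ) ν'))
              * Wop N M (1 / 4))
          * (Jmat N R M)ᴴ‖ ≤ CTX d a / (N : ℝ) := by
  have h := opNorm_weightedItem_rate_mixed N R M hN hR hRN a ha (θ := 1 / 4) (by norm_num)
    (by norm_num) hne
  have e : min (4 * (1 / 4 : ℝ)) 1 = 1 := by norm_num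
  rwa [e, Real.rpow_one] at h

/-- **THE MIXED-DIRECTION TORUS CURRENCY**: `TorusRateWθoff d a C θ γ` ≔ the bound of `TorusRateWθ`
demanded only for `ν ≠ ν′` (the operator-level counterpart of
`B5G183RateWThetaMixed.OrderTwoOpRateResidualWθoff`). OURS. [cite: Balaban1984PropagatorsI, Prop. 1.1
(1.89) p.33; King1986, (4.19)-(4.20) p.672] [folklore] -/
def TorusRateWθoff (d : ℕ) (a C θ γ : ℝ) : Prop :=
  ∀ (N R : ℕ) [NeZero N] [NeZero R] (M : Fin d → ℕ) [∀ μ, NeZero (M μ)] (hN : 1 ≤ N)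
    (hRN : 1 ≤ R * N) (ha : 0 < a) (ν ν' : Fin d), ν ≠ ν' → 1 ≤ R →
    ‖Wop (R * N) M θ
          * (fdiff (fine (R * N) M) ((R * N : ℕ) : ℂ) ν * calG (R * N) hRN M a ha
              * star (fdiff (fine (R * N) M) ((R * N : ℕ) : ℂ) ν'))
          * Wop (R * N) M θ
        - Jmat N R M
          * (Wop N M θ
              * (fdiff (fine N M) (N : ℂ) ν * calG N hN M a ha * star (fdiff (fine N M) (N : ℂ) ν'))
              * Wop N M θ)
          * (Jmat N R M)ᴴ‖ ≤ C / (N : ℝ) ^ γ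

omit hM in
/-- the all-directions torus currency implies the mixed one (same constant, same exponent). [folklore] -/
theorem torusRateWθoff_of_Wθ {a C θ γ : ℝ} (h : TorusRateWθ d a C θ γ) : TorusRateWθoff d a C θ γ := by
  intro N R _ _ M _ hN hRN ha ν ν' _ hR
  exact h N R M hN hRN ha ν ν' hR

/-- **positive side**: `TorusRateWθoff d a (CTX d a) θ γ` for every `γ ≤ min(4θ,1)`, `0 ≤ θ ≤ 1`,
`a > 0`. [folklore] -/
theorem torusRateWθoff_of_le {a θ γ : ℝ} (hθ0 : 0 ≤ θ) (hθ1 : θ ≤ 1) (hγ : γ ≤ min (4 * θ) 1) :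
    TorusRateWθoff d a (CTX d a) θ γ := by
  intro N R _ _ M _ hN hRN ha ν ν' hne hR
  have hN0 : (0 : ℝ) < N := by exact_mod_cast hN
  have hN1 : (1 : ℝ) ≤ N := by exact_mod_cast hN
  refine (opNorm_weightedItem_rate_mixed N R M hN hR hRN a ha hθ0 hθ1 hne).trans ?_
  exact div_le_div_of_nonneg_left (CTX_pos d a).le (Real.rpow_pos_of_pos hN0 γ)
    (Real.rpow_le_rpow_of_exponent_le hN1 hγ)

/-- hence `∃ C, TorusRateWθoff d a C θ γ` for `γ ≤ min(4θ,1)`. [folklore] -/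
theorem exists_torusRateWθoff {a θ γ : ℝ} (hθ0 : 0 ≤ θ) (hθ1 : θ ≤ 1) (hγ : γ ≤ min (4 * θ) 1) :
    ∃ C, TorusRateWθoff d a C θ γ :=
  ⟨CTX d a, torusRateWθoff_of_le hθ0 hθ1 hγ⟩

/-- the reduced momentum `q = e_{μ₁} + e_{μ₂}` of the `2`-torus. [folklore] -/
def qWit2 (μ₁ μ₂ : Fin d) : Tor (Mtwo (d := d)) := fun μ => if μ = μ₁ ∨ μ = μ₂ then 1 else 0

/-- `q ≠ 0`. [folklore] -/
theorem qWit2_ne_zero (μ₁ μ₂ : Fin d) : qWit2 μ₁ μ₂ ≠ 0 := by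
  intro h
  have h1 := congr_fun h μ₁
  simp only [qWit2, true_or, if_true, Pi.zero_apply] at h1
  change (1 : ZMod 2) = 0 at h1
  exact absurd h1 (by decide)

/-- **`p′(e_{μ₁} + e_{μ₂}) = π(e_{μ₁} + e_{μ₂})` on the `2`-torus = the witness fibre `sWit2 μ₁ μ₂` of
`B5G183RateWThetaMixedSharp`.** [folklore] -/
theorem sOf_qWit2 (μ₁ μ₂ : Fin d) : sOf Mtwo (qWit2 μ₁ μ₂) = sWit2 μ₁ μ₂ := by
  funext μ
  unfold sOf sWit2 qWit2 Mtwo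
  by_cases h : μ = μ₁ ∨ μ = μ₂
  · rw [if_pos h, if_pos h]
    have e1 : (((1 : ZMod 2).valMinAbs : ℤ) : ℝ) = 1 := by
      have : (1 : ZMod 2).valMinAbs = 1 := by decide
      rw [this]; norm_num
    rw [e1]
    push_cast
    ring
  · rw [if_neg h, if_neg h, ZMod.valMinAbs_zero]
    push_cast
    ring

/-- **the mixed torus currency bounds the two-axis witness `XW2` of `B5G183RateWThetaMixedSharp`**
(block `q = e_{μ₁} + e_{μ₂}` of the `2`-torus, directions `(μ₁, μ₂)`, `μ₁ ≠ μ₂`). [folklore] -/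
theorem opNorm_XW2_le_of_torus {a C θ γ : ℝ} (hTor : TorusRateWθoff d a C θ γ) (M : ℕ)
    [NeZero (M + 2)] {μ₁ μ₂ : Fin d} (hne : μ₁ ≠ μ₂) (ha : 0 < a) :
    ‖XW2 M μ₁ μ₂ a ha θ‖ ≤ C / ((M + 2 : ℕ) : ℝ) ^ γ := by
  have hN : 1 ≤ M + 2 := by omega
  have hRN : 1 ≤ 2 * (M + 2) := by omega
  have h := hTor (M + 2) 2 Mtwo hN hRN ha μ₁ μ₂ hne (by norm_num)
  have hq := qWit2_ne_zero (d := d) μ₁ μ₂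
  have hblk := opNorm_blockWθ_le_weightedItem_diff (M + 2) 2 Mtwo hN hRN a ha θ μ₁ μ₂ (qWit2 μ₁ μ₂)
  unfold blocks at hblk
  rw [dif_neg hq, dif_neg hq, ← plant_eq_conj hN (abs_sOf_le Mtwo (qWit2 μ₁ μ₂)),
    blockWθ_congr hN hRN a ha θ μ₁ μ₂ (sOf_qWit2 μ₁ μ₂) (abs_sOf_le Mtwo (qWit2 μ₁ μ₂))
      (sOf_ne_zero Mtwo hq) (sWit2_zone_ne_zero μ₁ μ₂).1 (sWit2_zone_ne_zero μ₁ μ₂).2] at hblk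
  exact hblk.trans h

/-- **the mixed torus currency bounds the Centre witness `XC`** (block `q = 2e_{μ₁} + e_{μ₂}` of the
`4`-torus, directions `(μ₁, μ₂)`, `μ₁ ≠ μ₂`). [folklore] -/
theorem opNorm_XC_le_of_torusOff {a C θ γ : ℝ} (hTor : TorusRateWθoff d a C θ γ) (M : ℕ)
    [NeZero (M + 2)] {μ₁ μ₂ : Fin d} (hne : μ₁ ≠ μ₂) (ha : 0 < a) :
    ‖XC M μ₁ μ₂ a ha θ‖ ≤ C / ((M + 2 : ℕ) : ℝ) ^ γ := by
  have hN : 1 ≤ M + 2 := by omega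
  have hRN : 1 ≤ 2 * (M + 2) := by omega
  have h := hTor (M + 2) 2 Mfour hN hRN ha μ₁ μ₂ hne (by norm_num)
  have hq := qCen_ne_zero (d := d) μ₁ μ₂
  have hblk := opNorm_blockWθ_le_weightedItem_diff (M + 2) 2 Mfour hN hRN a ha θ μ₁ μ₂ (qCen μ₁ μ₂)
  unfold blocks at hblk
  rw [dif_neg hq, dif_neg hq, ← plant_eq_conj hN (abs_sOf_le Mfour (qCen μ₁ μ₂)),
    blockWθ_congr hN hRN a ha θ μ₁ μ₂ (sOf_qCen μ₁ μ₂) (abs_sOf_le Mfour (qCen μ₁ μ₂))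
      (sOf_ne_zero Mfour hq) (sCen_zone_ne_zero μ₁ μ₂).1 (sCen_zone_ne_zero μ₁ μ₂).2] at hblk
  exact hblk.trans h

omit hM in
/-- **NO bound `‖XW2^{(M)}‖ ≤ C/(M+2)^γ` with `γ > 4θ` can hold for all `M`** (`0 ≤ θ < 1/2`, `μ₁ ≠ μ₂`,
every `C`, `a > 0`) — the two-axis unpaired witness of `B5G183RateWThetaMixedSharp`, stated against an
ABSTRACT witness bound so that every currency dominating `XW2` inherits it.  The proof body is,
verbatim, that of `B5G183RateWThetaMixedSharp.not_orderTwoOpRateResidualWθoff_of_lt` with its single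
use of the fibrewise currency (`opNorm_XW2_le h M hne ha`) replaced by the hypothesis `hXW2 M`.
[folklore] -/
theorem not_XW2_bound_of_lt {μ₁ μ₂ : Fin d} (hne : μ₁ ≠ μ₂) (a : ℝ) (ha : 0 < a) {C θ γ : ℝ}
    (hθ0 : 0 ≤ θ) (hθ2 : θ < 1 / 2) (hγ : 4 * θ < γ)
    (hXW2 : ∀ (M : ℕ) [NeZero (M + 2)], ‖XW2 M μ₁ μ₂ a ha θ‖ ≤ C / ((M + 2 : ℕ) : ℝ) ^ γ) :
    False := by
  have hCj := Cjunk_nonneg d ha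
  have hα : 4 * θ < 2 := by linarith
  have hT₁0 : 0 ≤ (16 * |C| + 1) ^ (1 / (γ - 4 * θ)) := Real.rpow_nonneg (by positivity) _
  have hT₂0 : 0 ≤ (16 * Cjunk d a + 1) ^ (1 / (2 - 4 * θ)) := Real.rpow_nonneg (by positivity) _
  obtain ⟨M, hM⟩ := exists_nat_ge ((16 * |C| + 1) ^ (1 / (γ - 4 * θ))
    + (16 * Cjunk d a + 1) ^ (1 / (2 - 4 * θ)))
  haveI : NeZero (M + 2) := ⟨by omega⟩
  have hM0 : (0 : ℝ) ≤ M := Nat.cast_nonneg M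
  have hNM : ((M + 2 : ℕ) : ℝ) = (M : ℝ) + 2 := by push_cast; ring
  have hN2 : (2 : ℝ) ≤ ((M + 2 : ℕ) : ℝ) := by rw [hNM]; linarith
  have hN0 : (0 : ℝ) < ((M + 2 : ℕ) : ℝ) := by linarith
  have hT₁ : (16 * |C| + 1) ^ (1 / (γ - 4 * θ)) ≤ ((M + 2 : ℕ) : ℝ) := by rw [hNM]; linarith
  have hT₂ : (16 * Cjunk d a + 1) ^ (1 / (2 - 4 * θ)) ≤ ((M + 2 : ℕ) : ℝ) := by rw [hNM]; linarith
  -- the witness entry is dominated by the operator norm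
  have hent := (norm_apply_le_norm (XW2 M μ₁ μ₂ a ha θ) (KW2 M μ₁ μ₂, μ₁) (KW2 M μ₁ μ₂, μ₁)).trans
    (hXW2 M)
  rw [XW2_entry M μ₁ μ₂ a ha θ, wθdSym_KW2_snd_eq, Gfor_diag, weight_mul_diag, main_KW2 M hne] at hent
  have hJ := junk_KW2_le M μ₁ μ₂ a ha hθ0
  -- main term ≤ C/N^γ + Cj/N²
  have hmain : ((((1 : ℝ) / (2 * M + 3)) ^ 2) ^ θ) ^ 2 / 2
      ≤ C / ((M + 2 : ℕ) : ℝ) ^ γ + Cjunk d a / ((M + 2 : ℕ) : ℝ) ^ 2 := by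
    have h1 := norm_sub_le
      (((((((1 : ℝ) / (2 * M + 3)) ^ 2) ^ θ) ^ 2 / 2 : ℝ) : ℂ)
        + ((‖wθdSym (2 * (M + 2)) θ (KW2 M μ₁ μ₂) (sWit2 μ₁ μ₂) μ₁‖ ^ 2 : ℝ) : ℂ)
          * (rEnt (2 * (M + 2)) a μ₁ μ₁ (sWit2 μ₁ μ₂) (KW2 M μ₁ μ₂) (KW2 M μ₁ μ₂)
            - xEnt (2 * (M + 2)) a μ₁ (sWit2 μ₁ μ₂) (KW2 M μ₁ μ₂) (KW2 M μ₁ μ₂)))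
      (((‖wθdSym (2 * (M + 2)) θ (KW2 M μ₁ μ₂) (sWit2 μ₁ μ₂) μ₁‖ ^ 2 : ℝ) : ℂ)
          * (rEnt (2 * (M + 2)) a μ₁ μ₁ (sWit2 μ₁ μ₂) (KW2 M μ₁ μ₂) (KW2 M μ₁ μ₂)
            - xEnt (2 * (M + 2)) a μ₁ (sWit2 μ₁ μ₂) (KW2 M μ₁ μ₂) (KW2 M μ₁ μ₂)))
    rw [add_sub_cancel_right, Complex.norm_real, Real.norm_eq_abs,
      abs_of_nonneg (by positivity)] at h1
    linarith
  -- lower bound of the main term: ((1/(2M+3))²)^{2θ}/2 = (1/(2M+3))^{4θ}/2 ≥ (1/(2N))^{4θ}/2 ≥ 1/(8N^{4θ})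
  have hW0 : (0 : ℝ) ≤ 1 / (2 * M + 3) := by positivity
  have hsq : ((((1 : ℝ) / (2 * M + 3)) ^ 2) ^ θ) ^ 2 = ((1 : ℝ) / (2 * M + 3)) ^ (4 * θ) := by
    rw [← Real.rpow_two, ← Real.rpow_two, ← Real.rpow_mul hW0, ← Real.rpow_mul hW0]; congr 1; ring
  have hWN : 1 / (2 * ((M + 2 : ℕ) : ℝ)) ≤ (1 : ℝ) / (2 * M + 3) :=
    div_le_div_of_nonneg_left zero_le_one (by positivity) (by rw [hNM]; linarith)
  have hlow1 : 1 / (4 * ((M + 2 : ℕ) : ℝ) ^ (4 * θ)) ≤ ((1 : ℝ) / (2 * M + 3)) ^ (4 * θ) := by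
    have h22 : (2 : ℝ) ^ (4 * θ) ≤ 4 :=
      calc (2 : ℝ) ^ (4 * θ) ≤ (2 : ℝ) ^ (2 : ℝ) :=
            Real.rpow_le_rpow_of_exponent_le (by norm_num) (by linarith)
        _ = 4 := by rw [Real.rpow_two]; norm_num
    calc 1 / (4 * ((M + 2 : ℕ) : ℝ) ^ (4 * θ))
        ≤ 1 / ((2 * ((M + 2 : ℕ) : ℝ)) ^ (4 * θ)) := by
          refine div_le_div_of_nonneg_left zero_le_one (Real.rpow_pos_of_pos (by positivity) _) ?_
          rw [Real.mul_rpow (by norm_num) hN0.le]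
          exact mul_le_mul_of_nonneg_right h22 (Real.rpow_nonneg hN0.le _)
      _ = (1 / (2 * ((M + 2 : ℕ) : ℝ))) ^ (4 * θ) := by
          rw [Real.div_rpow zero_le_one (by positivity), Real.one_rpow]
      _ ≤ ((1 : ℝ) / (2 * M + 3)) ^ (4 * θ) := Real.rpow_le_rpow (by positivity) hWN (by linarith)
  have hlow : 1 / (8 * ((M + 2 : ℕ) : ℝ) ^ (4 * θ)) ≤ ((((1 : ℝ) / (2 * M + 3)) ^ 2) ^ θ) ^ 2 / 2 := by
    rw [hsq]
    have e : 1 / (8 * ((M + 2 : ℕ) : ℝ) ^ (4 * θ)) = (1 / (4 * ((M + 2 : ℕ) : ℝ) ^ (4 * θ))) / 2 := by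
      rw [div_div]; ring_nf
    rw [e]
    linarith
  exact numeric_core8 hN2 hα hγ hCj (hlow.trans hmain) hT₁ hT₂

omit hM in
/-- **NO bound `‖XC^{(M)}‖ ≤ C/(M+2)^γ` with `γ > 1` can hold for all `M`** (EVERY real `θ`, `μ₁ ≠ μ₂`,
every `C`, `a > 0`) — the θ-blind centre-class witness of `B5G183RateWThetaCentre` against an abstract
witness bound.  The proof body is, verbatim, that of
`B5G183RateWThetaCentre.not_orderTwoOpRateResidualWθoff_of_one_lt` (as already transcribed in
`not_torusRateWθ_of_one_lt`) with the single use of the currency replaced by the hypothesis `hXC M`.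
[folklore] -/
theorem not_XC_bound_of_one_lt {μ₁ μ₂ : Fin d} (hne : μ₁ ≠ μ₂) (a : ℝ) (ha : 0 < a) (θ : ℝ)
    {C γ : ℝ} (hγ : 1 < γ)
    (hXC : ∀ (M : ℕ) [NeZero (M + 2)], ‖XC M μ₁ μ₂ a ha θ‖ ≤ C / ((M + 2 : ℕ) : ℝ) ^ γ) :
    False := by
  have hπ := Real.pi_pos
  have hd1 : (1 : ℝ) ≤ d := by
    have : 1 ≤ d := by
      rcases Nat.lt_or_ge 0 d with h0 | h0
      · omega
      · exact absurd (Fin.pos μ₁) (by omega)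
    exact_mod_cast this
  -- the θ-blind constant
  set g₀ : ℝ := 1 / (Real.pi ^ 2 * d + a) with hg₀
  have hg₀pos : 0 < g₀ := by positivity
  have hc : 0 < g₀ / 2 := by positivity
  obtain ⟨M, hM⟩ := exists_nat_ge ((|C| / (g₀ / 2) + 1) ^ (1 / (γ - 1)))
  haveI : NeZero (M + 2) := ⟨by omega⟩
  have hN : 1 ≤ M + 2 := by omega
  have hM0 : (0 : ℝ) ≤ M := Nat.cast_nonneg M
  have hNM : ((M + 2 : ℕ) : ℝ) = (M : ℝ) + 2 := by push_cast; ring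
  have hN1 : (1 : ℝ) ≤ ((M + 2 : ℕ) : ℝ) := by rw [hNM]; linarith
  have hN0 : (0 : ℝ) < ((M + 2 : ℕ) : ℝ) := by linarith
  have hT : (|C| / (g₀ / 2) + 1) ^ (1 / (γ - 1)) ≤ ((M + 2 : ℕ) : ℝ) := by rw [hNM]; linarith
  set Nr : ℝ := ((M + 2 : ℕ) : ℝ) with hNr
  have h2Nr : ((2 * (M + 2) : ℕ) : ℝ) = 2 * Nr := by rw [hNr]; push_cast; ring
  have hs := (sCen_zone_ne_zero μ₁ μ₂).1
  have hs0 := (sCen_zone_ne_zero μ₁ μ₂).2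
  -- the fibre data at the two levels
  set F₁ := balabanFiber (M + 2) (by omega) a ha (sCen μ₁ μ₂) hs hs0 with hF₁
  set F₂ := balabanFiber (2 * (M + 2)) (by omega) a ha (sCen μ₁ μ₂) hs hs0 with hF₂
  -- lower bound of the level-N centre entry g ≥ g₀
  have hg₁ : g₀ ≤ gC F₁ μ₁ := by
    have h1 := gC_ge F₁ μ₁
    have h2 := F₁.Δo_le_4dκ
    have hκ : F₁.κ = Real.pi ^ 2 / 4 := rfl
    have haF : F₁.a = a := rfl
    rw [hκ] at h2
    rw [haF] at h1
    refine le_trans ?_ h1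
    rw [hg₀]
    apply div_le_div_of_nonneg_left zero_le_one (by have := F₁.Δo_pos; positivity)
    nlinarith
  -- entry ≤ operator norm ≤ C/N^γ
  have hent := (norm_apply_le_norm (XC M μ₁ μ₂ a ha θ)
    ((0 : Fin d → Fin (2 * (M + 2))), μ₁) ((0 : Fin d → Fin (2 * (M + 2))), μ₁)).trans
    (hXC M)
  rw [XC_entry M hne a ha θ] at hent
  simp only [h2Nr] at hent
  rw [← hNr] at hent
  -- the amplitudes and phases
  set P₂ : ℝ := 4 * (2 * Nr) ^ 2 * Real.sin (Real.pi / (2 * (2 * Nr)))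
    * Real.sin (Real.pi / 2 / (2 * (2 * Nr))) * gC F₂ μ₁ with hP₂
  set P₁ : ℝ := 4 * Nr ^ 2 * Real.sin (Real.pi / (2 * Nr)) * Real.sin (Real.pi / 2 / (2 * Nr))
    * gC F₁ μ₁ with hP₁
  set φ₂ : ℝ := Real.pi / (2 * (2 * Nr)) - Real.pi / 2 / (2 * (2 * Nr)) with hφ₂
  set φ₁ : ℝ := Real.pi / (2 * Nr) - Real.pi / 2 / (2 * Nr) with hφ₁
  have hψ : φ₁ - φ₂ = Real.pi / (8 * Nr) := by rw [hφ₁, hφ₂]; field_simp; ring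
  -- Jordan's inequality at the three angles
  have hJ1 : 1 / Nr ≤ Real.sin (Real.pi / (2 * Nr)) := by
    have h0 : 0 ≤ Real.pi / (2 * Nr) := by positivity
    have h1 : Real.pi / (2 * Nr) ≤ Real.pi / 2 :=
      div_le_div_of_nonneg_left hπ.le (by norm_num) (by linarith)
    have := Real.mul_le_sin h0 h1
    have e : 2 / Real.pi * (Real.pi / (2 * Nr)) = 1 / Nr := by field_simp
    linarith
  have hJ2 : 1 / (2 * Nr) ≤ Real.sin (Real.pi / 2 / (2 * Nr)) := by
    have h0 : 0 ≤ Real.pi / 2 / (2 * Nr) := by positivity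
    have h1 : Real.pi / 2 / (2 * Nr) ≤ Real.pi / 2 := by
      rw [div_le_iff₀ (by positivity : (0 : ℝ) < 2 * Nr)]; nlinarith
    have := Real.mul_le_sin h0 h1
    have e : 2 / Real.pi * (Real.pi / 2 / (2 * Nr)) = 1 / (2 * Nr) := by field_simp
    linarith
  have hJ3 : 1 / (4 * Nr) ≤ Real.sin (φ₁ - φ₂) := by
    rw [hψ]
    have h0 : 0 ≤ Real.pi / (8 * Nr) := by positivity
    have h1 : Real.pi / (8 * Nr) ≤ Real.pi / 2 :=
      div_le_div_of_nonneg_left hπ.le (by norm_num) (by linarith)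
    have := Real.mul_le_sin h0 h1
    have e : 2 / Real.pi * (Real.pi / (8 * Nr)) = 1 / (4 * Nr) := by field_simp; ring
    linarith
  have hψ0 : 0 ≤ φ₁ - φ₂ := by rw [hψ]; positivity
  have hψ1 : φ₁ - φ₂ ≤ Real.pi := by
    rw [hψ, div_le_iff₀ (by positivity : (0 : ℝ) < 8 * Nr)]; nlinarith
  -- P₁ ≥ 2 g₀
  have hgpos := gC_pos F₁ μ₁
  have hP₁ge : 2 * g₀ ≤ P₁ := by
    rw [hP₁]
    have hs1 : 0 ≤ Real.sin (Real.pi / (2 * Nr)) := le_trans (by positivity) hJ1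
    have hs2 : 0 ≤ Real.sin (Real.pi / 2 / (2 * Nr)) := le_trans (by positivity) hJ2
    calc 2 * g₀ = 4 * Nr ^ 2 * (1 / Nr) * (1 / (2 * Nr)) * g₀ := by field_simp; ring
      _ ≤ 4 * Nr ^ 2 * Real.sin (Real.pi / (2 * Nr)) * Real.sin (Real.pi / 2 / (2 * Nr))
          * gC F₁ μ₁ := by
          gcongr
  have hP₁0 : 0 ≤ P₁ := le_trans (by positivity) hP₁ge
  -- |entry| ≥ P₁ sin(ψ) ≥ 2g₀/(4N) = (g₀/2)/N
  have hlow := polar_diff_lower (P₂ := P₂) hP₁0 hψ0 hψ1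
  have hchain : g₀ / 2 / Nr ≤ C / Nr ^ γ := by
    refine le_trans ?_ (hlow.trans hent)
    calc g₀ / 2 / Nr = 2 * g₀ * (1 / (4 * Nr)) := by field_simp; ring
      _ ≤ P₁ * Real.sin (φ₁ - φ₂) :=
          mul_le_mul hP₁ge hJ3 (by positivity) hP₁0
  exact numeric_core1 hN1 hc hγ hchain hT

omit hM in
/-- **NO mixed torus rate `η^γ` with `γ > 4θ`** (`0 ≤ θ < 1/2`, `d ≥ 2`, every `C`, `a > 0`).
[folklore] -/
theorem not_torusRateWθoff_of_lt {μ₁ μ₂ : Fin d} (hne : μ₁ ≠ μ₂) (a : ℝ) (ha : 0 < a) {C θ γ : ℝ}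
    (hθ0 : 0 ≤ θ) (hθ2 : θ < 1 / 2) (hγ : 4 * θ < γ) : ¬ TorusRateWθoff d a C θ γ :=
  fun hTor => not_XW2_bound_of_lt hne a ha hθ0 hθ2 hγ
    (fun M _ => opNorm_XW2_le_of_torus hTor M hne ha)

omit hM in
/-- **NO mixed torus rate `η^γ` with `γ > 1`** (every real `θ`, `d ≥ 2`, every `C`, `a > 0`).
[folklore] -/
theorem not_torusRateWθoff_of_one_lt {μ₁ μ₂ : Fin d} (hne : μ₁ ≠ μ₂) (a : ℝ) (ha : 0 < a) (θ : ℝ)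
    {C γ : ℝ} (hγ : 1 < γ) : ¬ TorusRateWθoff d a C θ γ :=
  fun hTor => not_XC_bound_of_one_lt hne a ha θ hγ
    (fun M _ => opNorm_XC_le_of_torusOff hTor M hne ha)

omit hM in
/-- **THE MIXED-DIRECTION TORUS EXPONENT LAW: `(∃ C, TorusRateWθoff d a C θ γ) ↔ γ ≤ min(4θ, 1)`** for
`0 ≤ θ ≤ 1` (`d ≥ 2`, `a > 0`) — on `ℓ²(T_η; ℂ^d)` the η-rate exponent of `𝒲_θ ∇_ν 𝒢 ∇_{ν′}^* 𝒲_θ`,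
`ν ≠ ν′`, under `J_R` is EXACTLY `min(4θ, 1)`: the fibrewise law
`B5G183RateWThetaCentre.orderTwoOpRateWθoff_law` survives the Plancherel packaging unchanged
(`⇐` `exists_torusRateWθoff`; `⇒` `not_torusRateWθoff_of_lt` for `θ < 1/2`,
`not_torusRateWθoff_of_one_lt` otherwise). [cite: Balaban1984PropagatorsI, Prop. 1.1 (1.89) p.33;
King1986, (4.19)-(4.20), (4.23) p.672, (4.24) p.673] [folklore] -/
theorem torusRateWθoff_law {μ₁ μ₂ : Fin d} (hne : μ₁ ≠ μ₂) {a : ℝ} (ha : 0 < a) {θ γ : ℝ}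
    (hθ0 : 0 ≤ θ) (hθ1 : θ ≤ 1) :
    (∃ C, TorusRateWθoff d a C θ γ) ↔ γ ≤ min (4 * θ) 1 := by
  constructor
  · rintro ⟨C, hC⟩
    by_contra hlt
    rcases min_lt_iff.mp (lt_of_not_ge hlt) with h4 | h1
    · rcases lt_or_ge θ (1 / 2) with hθ | hθ
      · exact not_torusRateWθoff_of_lt hne a ha hθ0 hθ h4 hC
      · exact not_torusRateWθoff_of_one_lt hne a ha θ (by linarith) hC
    · exact not_torusRateWθoff_of_one_lt hne a ha θ h1 hC
  · intro hγ
    exact exists_torusRateWθoff hθ0 hθ1 hγ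

omit hM in
/-- **`θ = 1/4`, mixed directions: rate `η`, and NOT `η^γ` for any `γ > 1`.** [folklore] -/
theorem torusRateWθoff_quarter_law {μ₁ μ₂ : Fin d} (hne : μ₁ ≠ μ₂) {a : ℝ} (ha : 0 < a) {γ : ℝ} :
    (∃ C, TorusRateWθoff d a C (1 / 4) γ) ↔ γ ≤ 1 := by
  rw [torusRateWθoff_law hne ha (by norm_num) (by norm_num)]
  norm_num

omit hM in
/-- **the UNweighted mixed item `θ = 0`: NO torus rate `η^γ` for ANY `γ > 0`** even for `ν ≠ ν′`
(`d ≥ 2`). [folklore] -/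
theorem not_torusRateWθoff_zero_of_pos {μ₁ μ₂ : Fin d} (hne : μ₁ ≠ μ₂) (a : ℝ) (ha : 0 < a) (C : ℝ)
    {γ : ℝ} (hγ : 0 < γ) : ¬ TorusRateWθoff d a C 0 γ :=
  not_torusRateWθoff_of_lt hne a ha le_rfl (by norm_num) (by linarith)

omit hM in
/-- **the two torus laws side by side** (`0 ≤ θ ≤ 1`, `d ≥ 2`, `a > 0`): all directions
`γ ≤ min(2θ,1)` (`torusRateWθ_law`), mixed directions `γ ≤ min(4θ,1)`; for `0 < θ < 1/2` the mixed
exponent is strictly larger (`B5G183RateWThetaMixed.mixed_exponent_gt`). [folklore] -/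
theorem torus_exponent_laws {μ₁ μ₂ : Fin d} (hne : μ₁ ≠ μ₂) {a : ℝ} (ha : 0 < a) {θ γ : ℝ}
    (hθ0 : 0 ≤ θ) (hθ1 : θ ≤ 1) :
    ((∃ C, TorusRateWθ d a C θ γ) ↔ γ ≤ min (2 * θ) 1)
      ∧ ((∃ C, TorusRateWθoff d a C θ γ) ↔ γ ≤ min (4 * θ) 1) :=
  ⟨torusRateWθ_law hne ha hθ0 hθ1, torusRateWθoff_law hne ha hθ0 hθ1⟩

end Mixed

/-! ## §7 (v1.2) KING's block averaging `Q_R` (2.10) versus the spectral injection `J_R`: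
`Q_R J_R = R^{−d/2}·mulOp(u_R)`, the first-order symbol rate of the averaging weight, and the `(0,0)` η-rate
of `𝒢` against `Q_R` [cite: King1986, (2.10) p.653, (4.2)-(4.3) p.670; Balaban1984PropagatorsI, (1.31) p.23,
(1.61) p.28, Prop. 1.1 (1.89) p.33] [folklore] -/

section Averaging

variable (N R : ℕ) [NeZero N] [NeZero R] (M : Fin d → ℕ) [hM : ∀ μ, NeZero (M μ)]

/-- the offset `j ∈ {0,…,R−1}^d` (fine index) inside an `R`-block of `T_{η/R}`. [folklore] -/
def off (j : Fin d → Fin R) : Tor (fine (R * N) M) := fun ν => ((j ν : ℕ) : ZMod (fine (R * N) M ν))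

/-- **KING's block averaging operator** from the `η/R`-lattice to the `η`-lattice, componentwise on vector
fields: «Q_k A_μ(y) = L^{−kd} Σ_{x ∈ B^k(y)} A_μ(x), (2.10)» with «B^k(y) = {x ∈ εZ^d : y_i ≤ x_i < y_i + L^kε,
i = 1, …, d}» (here `L^k = R`, the block of the coarse site `y` = the fine sites `R·y + j`, `j ∈ {0,…,R−1}^d`),
as a matrix with entries `R^{−d}` on the block and `0` elsewhere. [cite: King1986, (2.10) p.653] -/
def Qavg : Matrix (Tor (fine N M) × Fin d) (Tor (fine (R * N) M) × Fin d) ℂ :=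
  fun i x => ((R : ℂ) ^ d)⁻¹ * ∑ j : Fin d → Fin R, if x = (cpt N R M i.1 + off N R M j, i.2) then 1 else 0

/-- rows of `Q X`: block averages of the rows of `X`. [cite: King1986, (2.10) p.653] -/
theorem Qavg_mul_apply {β : Type*} (X : Matrix (Tor (fine (R * N) M) × Fin d) β ℂ)
    (i : Tor (fine N M) × Fin d) (b : β) :
    (Qavg N R M * X) i b
      = ((R : ℂ) ^ d)⁻¹ * ∑ j : Fin d → Fin R, X (cpt N R M i.1 + off N R M j, i.2) b := by
  simp only [Matrix.mul_apply, Qavg]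
  simp_rw [mul_assoc, ← Finset.mul_sum, Finset.sum_mul]
  congr 1
  rw [Finset.sum_comm]
  refine Finset.sum_congr rfl fun j _ => ?_
  simp_rw [ite_mul, one_mul, zero_mul]
  rw [Finset.sum_ite_eq']
  simp

/-- per coordinate: the character of the planted level-`RN` momentum `p′_ν + 2π(ι_R k)_ν` at `t` fine steps is
`e^{i t p̃_ν η/R}`, `p̃ = symmAlias N k p′` the centred coarse momentum (`|p̃_ν η| ≤ π`). [folklore] -/
private theorem stdAddChar_emb_iota_natCast (k : Fin d → Fin N) (μ : Fin d) (q : Tor M) (ν : Fin d) (t : ℕ) :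
    ZMod.stdAddChar (N := fine (R * N) M ν)
        ((B5Prop11Plancherel.emb (R * N) M ((iota R k (sOf M q), μ), q)).1 ν
          * ((t : ℕ) : ZMod (fine (R * N) M ν)))
      = Complex.exp ((((t : ℝ) * (symmAlias N k (sOf M q) ν / ((R : ℝ) * N)) : ℝ) : ℂ) * I) := by
  have hM0 : (M ν : ℂ) ≠ 0 := by exact_mod_cast NeZero.ne (M ν)
  have hN0 : (N : ℂ) ≠ 0 := by exact_mod_cast NeZero.ne N
  have hR0 : (R : ℂ) ≠ 0 := by exact_mod_cast NeZero.ne R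
  have h1 : (B5Prop11Plancherel.emb (R * N) M ((iota R k (sOf M q), μ), q)).1 ν
        * ((t : ℕ) : ZMod (fine (R * N) M ν))
      = ((((q ν).valMinAbs + (M ν : ℤ) * ((iota R k (sOf M q) ν : ℕ) : ℤ)) * (t : ℤ) : ℤ)
          : ZMod (fine (R * N) M ν)) := by
    rw [Int.cast_mul, Int.cast_natCast]; rfl
  rw [h1, ZMod.stdAddChar_coe, Complex.exp_eq_exp_iff_exists_int]
  refine ⟨(t : ℤ) * ((symmShift N k (sOf M q) ν : ℕ) : ℤ), ?_⟩
  unfold King1986.symmAlias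
  simp only [fine]
  push_cast
  rw [iota_cast]
  unfold shiftr sOf
  push_cast
  field_simp
  ring

/-- the planted plane wave at the block offset `j`: `e^{i(p′+2πι_R k)·(η/R) j} = Π_ν (e^{i p̃_ν η/R})^{j_ν}`.
[folklore] -/
private theorem chi_emb_iota_off (k : Fin d → Fin N) (μ : Fin d) (q : Tor M) (j : Fin d → Fin R) :
    chi (fine (R * N) M) (B5Prop11Plancherel.emb (R * N) M ((iota R k (sOf M q), μ), q)).1 (off N R M j)
      = ∏ ν, Complex.exp (((symmAlias N k (sOf M q) ν / ((R : ℝ) * N) : ℝ) : ℂ) * I) ^ (j ν : ℕ) := by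
  unfold chi off
  refine Finset.prod_congr rfl fun ν _ => ?_
  rw [stdAddChar_emb_iota_natCast, ← Complex.exp_nat_mul]
  congr 1
  push_cast
  ring

omit hM in
/-- THE GEOMETRIC SUM over one block direction: `Σ_{t<n} e^{its/n} = n · v(s)`, `v = B5Prop11Fiber.vSym n 0 s`
(Bałaban's «v_μ(p) = ∂¹_μ(p′)/∂_μ(p)» at `l = 0`, value `1` at `∂ = 0`).
[cite: Balaban1984PropagatorsI, (1.61) p.28] [folklore] -/
theorem sum_exp_pow_eq_vSym (n : ℕ) [NeZero n] (s : Fin d → ℝ) (ν : Fin d) :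
    ∑ t : Fin n, Complex.exp (((s ν / n : ℝ) : ℂ) * I) ^ (t : ℕ) = (n : ℂ) * vSym n 0 s ν := by
  have hnc : (n : ℂ) ≠ 0 := by exact_mod_cast NeZero.ne n
  have hsh : shiftr n (0 : Fin d → Fin n) s ν = s ν := by simp [shiftr]
  have hd : dSym n 0 s ν = (n : ℂ) * (Complex.exp (((s ν / n : ℝ) : ℂ) * I) - 1) := by
    rw [dSym, hsh]
  rw [Fin.sum_univ_eq_sum_range (fun t => Complex.exp (((s ν / n : ℝ) : ℂ) * I) ^ t) n]
  by_cases h : Complex.exp (((s ν / n : ℝ) : ℂ) * I) = 1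
  · have hd0 : dSym n 0 s ν = 0 := by rw [hd, h, sub_self, mul_zero]
    rw [vSym, if_pos hd0, h]
    simp
  · have h' : Complex.exp (((s ν / n : ℝ) : ℂ) * I) - 1 ≠ 0 := sub_ne_zero.mpr h
    have hd0 : dSym n 0 s ν ≠ 0 := by rw [hd]; exact mul_ne_zero hnc h'
    have hpow : Complex.exp (((s ν / n : ℝ) : ℂ) * I) ^ n = Complex.exp (((s ν : ℝ) : ℂ) * I) := by
      rw [← Complex.exp_nat_mul]
      congr 1
      push_cast
      field_simp
    rw [geom_sum_eq h, vSym, if_neg hd0, d1Sym, hd, hpow]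
    field_simp

/-- the CENTRED coarse momentum of the alias class `(k, p′)` per coarse site: `p̃_ν η = symmAlias N k p′ / N`,
in `[−π, π]` (`King1986.symmAlias_abs_le`). [folklore] -/
def cen (N : ℕ) (k : Fin d → Fin N) (s : Fin d → ℝ) : Fin d → ℝ := fun ν => symmAlias N k s ν / N

/-- **the symbol of `Q_R J_R`**: Bałaban's / King's AVERAGING WEIGHT of the `R`-block structure at the
CENTRAL alias, `u_R(p̃) = Π_ν (e^{ip̃_ν η} − 1)/(R(e^{ip̃_ν η/R} − 1)) = B5Prop11Fiber.uSym R 0 (p̃η)` («u(p) =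
Π_μ ∂¹_μ(p′)/∂_μ(p)», (1.31); King's «u_k^η(p) = Π_{μ=1}^d [(e^{−ip_μ} − 1)η(e^{−iηp_μ} − 1)^{−1}], (4.3)» with
`η = 1/R`, complex-conjugate convention), as a Fourier-multiplier symbol on `T_η`.
[cite: Balaban1984PropagatorsI, (1.31) p.23; King1986, (4.3) p.670] -/
def uCen : Tor (fine N M) × Fin d → ℂ :=
  fun P => uSym R 0 (cen N ((blockEquiv N M) P).1.1 (sOf M ((blockEquiv N M) P).2))

/-- the symbol on the coset point `((k, μ), q)`. [folklore] -/
private theorem uCen_emb (k : Fin d → Fin N) (μ : Fin d) (q : Tor M) :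
    uCen N R M (B5Prop11Plancherel.emb N M ((k, μ), q)) = uSym R 0 (cen N k (sOf M q)) := by
  simp only [uCen, blockEquiv_emb]

/-- THE BLOCK SUM: `R^{−d} Σ_{j∈{0,…,R−1}^d} e^{i(p′+2πι_R k)·(η/R)j} = u_R(p̃)`.
[cite: Balaban1984PropagatorsI, (1.31) p.23] [folklore] -/
theorem avg_chi_emb_iota_off (k : Fin d → Fin N) (μ : Fin d) (q : Tor M) :
    ((R : ℂ) ^ d)⁻¹ * ∑ j : Fin d → Fin R,
        chi (fine (R * N) M) (B5Prop11Plancherel.emb (R * N) M ((iota R k (sOf M q), μ), q)).1 (off N R M j)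
      = uSym R 0 (cen N k (sOf M q)) := by
  have hRc : (R : ℂ) ≠ 0 := by exact_mod_cast NeZero.ne R
  simp_rw [chi_emb_iota_off]
  rw [← Fintype.piFinset_univ, ← Finset.prod_univ_sum (fun _ => (Finset.univ : Finset (Fin R)))
    (fun ν (t : Fin R) => Complex.exp (((symmAlias N k (sOf M q) ν / ((R : ℝ) * N) : ℝ) : ℂ) * I) ^ (t : ℕ))]
  have hω : ∀ ν, symmAlias N k (sOf M q) ν / ((R : ℝ) * N) = cen N k (sOf M q) ν / R := by
    intro ν; simp only [cen]; rw [div_div, mul_comm]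
  simp_rw [hω, sum_exp_pow_eq_vSym R (cen N k (sOf M q))]
  rw [Finset.prod_mul_distrib, Finset.prod_const, Finset.card_univ, Fintype.card_fin, uSym, ← mul_assoc,
    inv_mul_cancel₀ (pow_ne_zero _ hRc), one_mul]

/-- **`Q F_{RN}^* Ĵ_R = (|T_η|/|T_{η/R}|)^{1/2} F_η^* diag(u_R)`**: block-averaging a planted plane wave returns
the coarse plane wave times the averaging weight at its (central) momentum. [cite: King1986, (4.2)-(4.3) p.670
(the averaging weight as the symbol of block averaging on plane waves); Balaban1984PropagatorsI, (1.31) p.23]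
[folklore] -/
theorem Qavg_star_dftV_Jhat :
    Qavg N R M * star (dftV (fine (R * N) M)) * Jhat N R M
      = (((Real.sqrt (Fintype.card (Tor (fine N M))) : ℝ) : ℂ)
          / ((Real.sqrt (Fintype.card (Tor (fine (R * N) M))) : ℝ) : ℂ))
          • (star (dftV (fine N M)) * Matrix.diagonal (uCen N R M)) := by
  have hT := sqrt_card_ne_zero M N
  have hT' := sqrt_card_ne_zero M (R * N)
  ext ⟨x, μ⟩ P
  obtain ⟨⟨⟨k, μ'⟩, q⟩, rfl⟩ := exists_emb_eq M N P
  rw [Matrix.smul_apply, Matrix.mul_apply, Matrix.mul_diagonal, uCen_emb]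
  simp_rw [Jhat_apply_emb, mul_ite, mul_one, mul_zero, Finset.sum_ite_eq', Finset.mem_univ, if_true,
    Qavg_mul_apply]
  rw [Matrix.star_eq_conjTranspose, Matrix.star_eq_conjTranspose]
  simp_rw [Matrix.conjTranspose_apply, dftV_emb_apply]
  by_cases hμ : μ' = μ
  · simp only [hμ, if_true, smul_eq_mul]
    unfold dft
    simp_rw [Complex.star_def, map_mul, Complex.conj_conj, Complex.conj_ofReal, chi_add_right, chi_emb_iota_cpt]
    rw [← avg_chi_emb_iota_off N R M k μ q]
    simp_rw [← Finset.mul_sum]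
    push_cast
    field_simp
  · simp only [hμ, if_false, star_zero, Finset.sum_const_zero, mul_zero, zero_mul, smul_zero]

/-- **`Q_R J_R = R^{−d/2} · F_η^* diag(u_R) F_η`**: King's block averaging of the spectral interpolant is the
Fourier multiplier with the central averaging weight `u_R(p̃)` (times the ratio `R^{−d/2}` of the `ℓ²`
normalisations).  Compare `B5G183RateTorus.Smp_mul_Jmat`: SAMPLING gives exactly `R^{−d/2}·1`.
[cite: King1986, (2.10) p.653, (4.2)-(4.3) p.670; Balaban1984PropagatorsI, (1.31) p.23] [folklore] -/
theorem Qavg_mul_Jmat :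
    Qavg N R M * Jmat N R M = (((Real.sqrt ((R : ℝ) ^ d))⁻¹ : ℝ) : ℂ) • mulOp N M (uCen N R M) := by
  rw [← sqrt_card_ratio N R M, Jmat, ← Matrix.mul_assoc, ← Matrix.mul_assoc, Qavg_star_dftV_Jhat,
    Matrix.smul_mul, mulOp]


/-- distinct (coarse site, offset) pairs are distinct fine sites: the `R`-blocks tile `T_{η/R}`. [folklore] -/
private theorem cpt_add_off_inj {x x' : Tor (fine N M)} {j j' : Fin d → Fin R}
    (h : cpt N R M x + off N R M j = cpt N R M x' + off N R M j') : x = x' ∧ j = j' := by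
  have hR : 0 < R := Nat.pos_of_ne_zero (NeZero.ne R)
  have hlt : ∀ (y : Tor (fine N M)) (i : Fin d → Fin R) (ν : Fin d),
      R * (y ν).val + (i ν : ℕ) < fine (R * N) M ν := by
    intro y i ν
    have hy : (y ν).val < N * M ν := ZMod.val_lt (y ν)
    have hi : (i ν : ℕ) < R := (i ν).isLt
    calc R * (y ν).val + (i ν : ℕ) < R * (y ν).val + R := by omega
      _ = R * ((y ν).val + 1) := by ring
      _ ≤ R * (N * M ν) := Nat.mul_le_mul_left _ hy
      _ = fine (R * N) M ν := by simp only [fine]; ring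
  have key : ∀ ν, (x ν).val = (x' ν).val ∧ (j ν : ℕ) = (j' ν : ℕ) := by
    intro ν
    have hν := congr_fun h ν
    simp only [Pi.add_apply, cpt, off] at hν
    rw [← Nat.cast_add, ← Nat.cast_add, ZMod.natCast_eq_natCast_iff',
      Nat.mod_eq_of_lt (hlt x j ν), Nat.mod_eq_of_lt (hlt x' j' ν)] at hν
    have h1 : (x ν).val = (x' ν).val := by
      have := congrArg (· / R) hν
      rwa [Nat.mul_add_div hR, Nat.mul_add_div hR, Nat.div_eq_of_lt (j ν).isLt,
        Nat.div_eq_of_lt (j' ν).isLt, add_zero, add_zero] at this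
    rw [h1] at hν
    exact ⟨h1, Nat.add_left_cancel hν⟩
  exact ⟨funext fun ν => ZMod.val_injective _ (key ν).1, funext fun ν => Fin.ext (key ν).2⟩

omit [NeZero N] [NeZero R] hM in
/-- the entries of `Q` are real. [folklore] -/
private theorem star_Qavg_apply (i : Tor (fine N M) × Fin d) (x : Tor (fine (R * N) M) × Fin d) :
    star (Qavg N R M i x) = Qavg N R M i x := by
  simp only [Qavg, Complex.star_def, map_mul, map_inv₀, map_pow, map_natCast, map_sum]
  congr 1
  refine Finset.sum_congr rfl fun j _ => ?_
  split_ifs <;> simp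

/-- **`Q Qᴴ = R^{−d}·1`**: the rows of `Q` (normalised block indicators) are orthogonal with squared norm
`R^{−d}` — the blocks tile the fine torus. [cite: King1986, (2.10) p.653 (the blocks `B^k(y)` partition the fine lattice)] -/
theorem Qavg_mul_conjTranspose :
    Qavg N R M * (Qavg N R M)ᴴ
      = ((R : ℂ) ^ d)⁻¹ • (1 : Matrix (Tor (fine N M) × Fin d) (Tor (fine N M) × Fin d) ℂ) := by
  have hRc : (R : ℂ) ≠ 0 := by exact_mod_cast NeZero.ne R
  ext i i'
  rw [Qavg_mul_apply, Matrix.smul_apply, smul_eq_mul]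
  simp_rw [Matrix.conjTranspose_apply, star_Qavg_apply]
  simp only [Qavg]
  by_cases hi : i = i'
  · subst hi
    rw [Matrix.one_apply_eq, mul_one]
    have hinner : ∀ j : Fin d → Fin R,
        (∑ j' : Fin d → Fin R,
          (if ((cpt N R M i.1 + off N R M j, i.2) : Tor (fine (R * N) M) × Fin d)
                = (cpt N R M i.1 + off N R M j', i.2) then (1 : ℂ) else 0)) = 1 := by
      intro j
      rw [Finset.sum_eq_single j]
      · rw [if_pos rfl]
      · intro j' _ hj'
        rw [if_neg]
        intro hh
        exact hj' (cpt_add_off_inj N R M (Prod.ext_iff.mp hh).1).2.symm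
      · intro hh; exact absurd (Finset.mem_univ j) hh
    simp_rw [hinner]
    rw [Finset.sum_const, Finset.card_univ, Fintype.card_fun, Fintype.card_fin, Fintype.card_fin,
      nsmul_eq_mul, mul_one]
    push_cast
    field_simp
  · rw [Matrix.one_apply_ne hi, mul_zero]
    have hzero : ∀ j j' : Fin d → Fin R,
        ¬ (((cpt N R M i.1 + off N R M j, i.2) : Tor (fine (R * N) M) × Fin d)
              = (cpt N R M i'.1 + off N R M j', i'.2)) := by
      intro j j' hh
      obtain ⟨h1, h2⟩ := Prod.ext_iff.mp hh
      exact hi (Prod.ext (cpt_add_off_inj N R M h1).1 h2)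
    simp [hzero]

/-- **`‖Q‖ ≤ R^{−d/2}`** (in fact `=`): King's block averaging, entries `R^{−d}` verbatim from (2.10), read
between the `ℓ²` spaces of the two tori. [cite: King1986, (2.10) p.653] [folklore] -/
theorem opNorm_Qavg_le : ‖Qavg N R M‖ ≤ (Real.sqrt ((R : ℝ) ^ d))⁻¹ := by
  have hRpos : (0 : ℝ) < (R : ℝ) ^ d := pow_pos (by exact_mod_cast Nat.pos_of_ne_zero (NeZero.ne R)) d
  have hsq : ‖Qavg N R M‖ ^ 2 ≤ ((R : ℝ) ^ d)⁻¹ := by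
    rw [sq, ← Matrix.l2_opNorm_conjTranspose (Qavg N R M), ← Matrix.l2_opNorm_conjTranspose_mul_self,
      Matrix.conjTranspose_conjTranspose, Qavg_mul_conjTranspose]
    refine opNorm_le_of_offDiag_eq_zero _ (le_of_lt (inv_pos.mpr hRpos)) (fun i j hij => ?_) (fun i => ?_)
    · rw [Matrix.smul_apply, Matrix.one_apply_ne hij, smul_zero]
    · rw [Matrix.smul_apply, Matrix.one_apply_eq, smul_eq_mul, mul_one, norm_inv, norm_pow]
      simp
  rw [← Real.sqrt_inv]
  exact (Real.le_sqrt (norm_nonneg _) (le_of_lt (inv_pos.mpr hRpos))).mpr hsq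

/-- **`‖Q J_R‖ ≤ R^{−d/2}`**: `|u_R| ≤ 1`. [cite: Balaban1984PropagatorsI, (1.66) p.28] [folklore] -/
theorem opNorm_Qavg_mul_Jmat_le (hR : 1 ≤ R) :
    ‖Qavg N R M * Jmat N R M‖ ≤ (Real.sqrt ((R : ℝ) ^ d))⁻¹ := by
  have hc : 0 ≤ (Real.sqrt ((R : ℝ) ^ d))⁻¹ := inv_nonneg.mpr (Real.sqrt_nonneg _)
  rw [Qavg_mul_Jmat, norm_smul, Complex.norm_real, Real.norm_of_nonneg hc]
  refine mul_le_of_le_one_right hc ?_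
  rw [mulOp, opNorm_unitary_conj' (dftV_mem_unitaryGroup _)]
  refine opNorm_le_of_offDiag_eq_zero _ zero_le_one (fun i j hij => Matrix.diagonal_apply_ne _ hij) ?_
  intro P
  rw [Matrix.diagonal_apply_eq, uCen]
  exact norm_uSym_le_one R hR 0 _


/-- multipliers compose pointwise. [folklore] -/
private theorem mulOp_mul_mulOp (V W : Tor (fine N M) × Fin d → ℂ) :
    mulOp N M V * mulOp N M W = mulOp N M (fun i => V i * W i) := by
  simp only [mulOp]
  have hU := dftV_mul_star (fine N M)
  set U := dftV (fine N M)
  calc star U * Matrix.diagonal V * U * (star U * Matrix.diagonal W * U)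
      = star U * Matrix.diagonal V * (U * star U) * Matrix.diagonal W * U := by
        simp only [Matrix.mul_assoc]
    _ = star U * Matrix.diagonal (fun i => V i * W i) * U := by
        rw [hU, Matrix.mul_one, ← Matrix.diagonal_mul_diagonal]
        simp only [Matrix.mul_assoc]

/-- multipliers are linear in the symbol: differences. [folklore] -/
private theorem mulOp_sub (V W : Tor (fine N M) × Fin d → ℂ) :
    mulOp N M V - mulOp N M W = mulOp N M (fun i => V i - W i) := by
  simp only [mulOp]
  rw [← Matrix.sub_mul, ← Matrix.mul_sub, show (Matrix.diagonal fun i => V i - W i)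
    = Matrix.diagonal V - Matrix.diagonal W from (Matrix.diagonal_sub V W).symm]

/-- multipliers are linear in the symbol: sums. [folklore] -/
private theorem mulOp_add (V W : Tor (fine N M) × Fin d → ℂ) :
    mulOp N M V + mulOp N M W = mulOp N M (fun i => V i + W i) := by
  simp only [mulOp]
  rw [← Matrix.add_mul, ← Matrix.mul_add, show (Matrix.diagonal fun i => V i + W i)
    = Matrix.diagonal V + Matrix.diagonal W from (Matrix.diagonal_add V W).symm]

/-- multipliers are linear in the symbol: scalars. [folklore] -/
private theorem smul_mulOp (c : ℂ) (V : Tor (fine N M) × Fin d → ℂ) :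
    c • mulOp N M V = mulOp N M (fun i => c * V i) := by
  simp only [mulOp]
  rw [← Matrix.smul_mul, ← Matrix.mul_smul, show (Matrix.diagonal fun i => c * V i)
    = c • Matrix.diagonal V by rw [← Matrix.diagonal_smul]; rfl]

/-- multipliers are linear in the symbol: finite sums. [folklore] -/
private theorem sum_mulOp {ι : Type*} (s : Finset ι) (V : ι → Tor (fine N M) × Fin d → ℂ) :
    ∑ l ∈ s, mulOp N M (V l) = mulOp N M (fun i => ∑ l ∈ s, V l i) := by
  classical
  refine Finset.induction_on s ?_ ?_
  · simp only [Finset.sum_empty]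
    rw [show (fun _ : Tor (fine N M) × Fin d => (0 : ℂ)) = fun _ => (0 : ℂ) * 1 by simp,
      ← smul_mulOp, zero_smul]
  · intro l s hl ih
    rw [Finset.sum_insert hl, ih, mulOp_add]
    congr 1
    funext i
    rw [Finset.sum_insert hl]

/-- the adjoint of a multiplier is the multiplier with the conjugate symbol. [folklore] -/
private theorem conjTranspose_mulOp (V : Tor (fine N M) × Fin d → ℂ) :
    (mulOp N M V)ᴴ = mulOp N M (star V) := by
  simp only [mulOp]
  rw [Matrix.conjTranspose_mul, Matrix.conjTranspose_mul, Matrix.diagonal_conjTranspose,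
    ← Matrix.star_eq_conjTranspose, ← Matrix.star_eq_conjTranspose, star_star, Matrix.mul_assoc]

/-- `mulOp 1 = 1` with the symbol written as a difference base: `mulOp V − 1 = mulOp (V − 1)`. [folklore] -/
private theorem mulOp_sub_one (V : Tor (fine N M) × Fin d → ℂ) :
    mulOp N M V - 1 = mulOp N M (fun i => V i - 1) := by
  rw [← mulOp_one N M, mulOp_sub]

/-- `‖F^* diag(V) F‖ ≤ sup |V|`. [folklore] -/
private theorem opNorm_mulOp_le (V : Tor (fine N M) × Fin d → ℂ) {C : ℝ} (hC : 0 ≤ C) (hV : ∀ i, ‖V i‖ ≤ C) :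
    ‖mulOp N M V‖ ≤ C := by
  rw [mulOp, opNorm_unitary_conj' (dftV_mem_unitaryGroup _)]
  refine opNorm_le_of_offDiag_eq_zero _ hC (fun i j hij => Matrix.diagonal_apply_ne _ hij) ?_
  intro i
  rw [Matrix.diagonal_apply_eq]
  exact hV i

/-- `∇^η_ν` is the multiplier with symbol `fsym_ν` (b05 `fdiff_eq`). [folklore] -/
private theorem fdiff_eq_mulOp (ν : Fin d) :
    fdiff (fine N M) (N : ℂ) ν = mulOp N M (fsym (fine N M) (N : ℂ) ν) :=
  fdiff_eq _ _ _

/-- `(∇^η_ν)ᴴ ∇^η_ν` is the multiplier with symbol `|fsym_ν|²`. [folklore] -/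
private theorem fdiff_conjTranspose_mul_fdiff (ν : Fin d) :
    (fdiff (fine N M) (N : ℂ) ν)ᴴ * fdiff (fine N M) (N : ℂ) ν
      = mulOp N M (fun i => ((‖fsym (fine N M) (N : ℂ) ν i‖ ^ 2 : ℝ) : ℂ)) := by
  rw [fdiff_eq_mulOp, conjTranspose_mulOp, mulOp_mul_mulOp]
  congr 1
  funext i
  rw [Pi.star_apply, Complex.star_def, Complex.conj_mul', Complex.ofReal_pow]


omit [NeZero N] in
/-- `|p̃_ν η| ≤ π`: the central alias lies in the first Brillouin zone of the coarse lattice. [folklore] -/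
private theorem abs_cen_le (hN : 1 ≤ N) (k : Fin d → Fin N) {s : Fin d → ℝ} (hs : ∀ μ, |s μ| ≤ Real.pi)
    (ν : Fin d) : |cen N k s ν| ≤ Real.pi := by
  have hNpos : (0 : ℝ) < N := by exact_mod_cast hN
  rw [cen, abs_div, abs_of_pos hNpos, div_le_iff₀ hNpos]
  exact symmAlias_abs_le hN k hs ν

/-- `∂^η_ν(p′ + 2πk) = N(e^{ip̃_ν η} − 1)` EXACTLY: the coarse symbol only sees the central alias. [folklore] -/
private theorem dSym_eq_cen (k : Fin d → Fin N) (s : Fin d → ℝ) (ν : Fin d) :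
    dSym N k s ν = (N : ℂ) * (Complex.exp (((cen N k s ν : ℝ) : ℂ) * I) - 1) := by
  have hN0 : (N : ℂ) ≠ 0 := by exact_mod_cast NeZero.ne N
  rw [dSym]
  congr 2
  rw [Complex.exp_eq_exp_iff_exists_int]
  refine ⟨((symmShift N k s ν : ℕ) : ℤ), ?_⟩
  rw [shiftr_symmAlias]
  simp only [cen]
  push_cast
  field_simp

omit hM in
/-- `|v(s) − 1| ≤ |s|` for the one-direction block average `v(s) = (1/n) Σ_{t<n} e^{its/n}`. [cite: King1986, Lemma 4.4 (4.29)-(4.30) p.673 (one factor, `k = 0`, `γ = 1`; constant ours)] [folklore] -/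
theorem norm_vSym_zero_sub_one_le (n : ℕ) [NeZero n] (s : Fin d → ℝ) (ν : Fin d) :
    ‖vSym n 0 s ν - 1‖ ≤ |s ν| := by
  have hnpos : (0 : ℝ) < n := by exact_mod_cast Nat.pos_of_ne_zero (NeZero.ne n)
  have key : (n : ℂ) * (vSym n 0 s ν - 1)
      = ∑ t : Fin n, (Complex.exp (((s ν / n : ℝ) : ℂ) * I) ^ (t : ℕ) - 1) := by
    rw [Finset.sum_sub_distrib, sum_exp_pow_eq_vSym, Finset.sum_const, Finset.card_univ,
      Fintype.card_fin, nsmul_eq_mul, mul_one, mul_sub, mul_one]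
  have hterm : ∀ t : Fin n, ‖Complex.exp (((s ν / n : ℝ) : ℂ) * I) ^ (t : ℕ) - 1‖ ≤ |s ν| := by
    intro t
    rw [← Complex.exp_nat_mul]
    have e : ((t : ℕ) : ℂ) * ((((s ν / n : ℝ)) : ℂ) * I) = ((((t : ℕ) : ℝ) * (s ν / n) : ℝ) : ℂ) * I := by
      push_cast; ring
    rw [e]
    have h1 := norm_d1Sym_le (fun _ : Fin d => ((t : ℕ) : ℝ) * (s ν / n)) ν
    simp only [d1Sym] at h1
    refine h1.trans ?_
    rw [abs_mul, abs_div, Nat.abs_cast, Nat.abs_cast]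
    have ht : ((t : ℕ) : ℝ) ≤ n := by exact_mod_cast (t.isLt).le
    calc ((t : ℕ) : ℝ) * (|s ν| / n) ≤ n * (|s ν| / n) := by gcongr
      _ = |s ν| := by field_simp
  have hsum : ‖(n : ℂ) * (vSym n 0 s ν - 1)‖ ≤ n * |s ν| := by
    rw [key]
    refine (norm_sum_le _ _).trans ?_
    calc ∑ t : Fin n, ‖Complex.exp (((s ν / n : ℝ) : ℂ) * I) ^ (t : ℕ) - 1‖
        ≤ ∑ _t : Fin n, |s ν| := Finset.sum_le_sum fun t _ => hterm t
      _ = n * |s ν| := by rw [Finset.sum_const, Finset.card_univ, Fintype.card_fin, nsmul_eq_mul]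
  rw [norm_mul, Complex.norm_natCast] at hsum
  exact le_of_mul_le_mul_left hsum hnpos

omit [NeZero N] [NeZero R] hM in
/-- `|Π a_i − 1| ≤ Σ |a_i − 1|` when all `|a_i| ≤ 1`. [folklore] -/
private theorem norm_prod_sub_one_le {ι : Type*} (s : Finset ι) (a : ι → ℂ) (h : ∀ i ∈ s, ‖a i‖ ≤ 1) :
    ‖∏ i ∈ s, a i - 1‖ ≤ ∑ i ∈ s, ‖a i - 1‖ := by
  classical
  revert h
  refine Finset.induction_on s (by simp) ?_
  intro j s hj ih h
  rw [Finset.prod_insert hj, Finset.sum_insert hj]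
  have e : a j * ∏ i ∈ s, a i - 1 = a j * (∏ i ∈ s, a i - 1) + (a j - 1) := by ring
  rw [e]
  calc ‖a j * (∏ i ∈ s, a i - 1) + (a j - 1)‖
      ≤ ‖a j * (∏ i ∈ s, a i - 1)‖ + ‖a j - 1‖ := norm_add_le _ _
    _ ≤ 1 * ‖∏ i ∈ s, a i - 1‖ + ‖a j - 1‖ := by
        rw [norm_mul]
        gcongr
        exact h j (Finset.mem_insert_self j s)
    _ ≤ ‖a j - 1‖ + ∑ i ∈ s, ‖a i - 1‖ := by
        rw [one_mul, add_comm]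
        gcongr
        exact ih (fun i hi => h i (Finset.mem_insert_of_mem hi))

omit [NeZero N] [NeZero R] hM in
/-- JORDAN: `|x| ≤ (π/2)|e^{ix} − 1|` on `|x| ≤ π` (`B4Strip.S1r_ge`). [folklore] -/
private theorem abs_le_pi_div_two_mul_norm (x : ℝ) (hx : |x| ≤ Real.pi) :
    |x| ≤ Real.pi / 2 * ‖Complex.exp ((x : ℂ) * I) - 1‖ := by
  have h1 : 4 * x ^ 2 / Real.pi ^ 2 ≤ S1r x := S1r_ge x hx
  rw [← norm_exp_mul_I_sub_one_sq] at h1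
  have hpi : 0 < Real.pi := Real.pi_pos
  have hpi2 : 0 < Real.pi ^ 2 := by positivity
  rw [div_le_iff₀ hpi2] at h1
  refine abs_le_of_sq_le_sq ?_ (by positivity)
  nlinarith [h1, norm_nonneg (Complex.exp ((x : ℂ) * I) - 1)]

/-- `|u_R| ≤ 1` as a symbol on `T_η`. [cite: Balaban1984PropagatorsI, (1.66) p.28] [folklore] -/
theorem norm_uCen_le_one (hR : 1 ≤ R) (P : Tor (fine N M) × Fin d) : ‖uCen N R M P‖ ≤ 1 := by
  obtain ⟨⟨⟨k, μ⟩, q⟩, rfl⟩ := exists_emb_eq M N P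
  rw [uCen_emb]
  exact norm_uSym_le_one R hR 0 _

/-- **THE SYMBOL RATE of `Q_R J_R − R^{−d/2}`**: `|u_R(p̃) − 1| ≤ (π/2)·η·Σ_ν |∂^η_ν(p̃)|` — the averaging
weight differs from `1` by ONE POWER of the lattice momentum `η|∂^η(p̃)| ≲ |p̃|η` (first order, no better:
at the band edge `p̃_ν η = π` the difference is `O(1)`). [cite: King1986, Lemma 4.4 (4.29) p.673 (`k = 0`, `γ = 1`: `|u_0 − u_n| ≤ C|p|·|u_0|` with `u_0 = 1`; constant ours); Balaban1984PropagatorsI, (1.31) p.23] [folklore] -/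
theorem norm_uCen_sub_one_le (hN : 1 ≤ N) (hR : 1 ≤ R) (P : Tor (fine N M) × Fin d) :
    ‖uCen N R M P - 1‖ ≤ Real.pi / (2 * N) * ∑ ν, ‖fsym (fine N M) (N : ℂ) ν P‖ := by
  have hNpos : (0 : ℝ) < N := by exact_mod_cast hN
  obtain ⟨⟨⟨k, μ⟩, q⟩, rfl⟩ := exists_emb_eq M N P
  rw [uCen_emb, uSym, Finset.mul_sum]
  have hs := abs_sOf_le M q
  refine (norm_prod_sub_one_le _ _ fun ν _ => norm_vSym_le_one R hR 0 _ ν).trans ?_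
  refine Finset.sum_le_sum fun ν _ => ?_
  calc ‖vSym R 0 (cen N k (sOf M q)) ν - 1‖
      ≤ |cen N k (sOf M q) ν| := norm_vSym_zero_sub_one_le R _ ν
    _ ≤ Real.pi / 2 * ‖Complex.exp (((cen N k (sOf M q) ν : ℝ) : ℂ) * I) - 1‖ :=
        abs_le_pi_div_two_mul_norm _ (abs_cen_le N hN k hs ν)
    _ = Real.pi / (2 * N) * ‖fsym (fine N M) (N : ℂ) ν (B5Prop11Plancherel.emb N M ((k, μ), q))‖ := by
        rw [fsym_emb, dSym_eq_cen, norm_mul, Complex.norm_natCast]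
        field_simp


/-- the size of the lattice momentum as a REAL symbol on `T_η`: `g(P) = η·(Σ_ν |∂^η_ν(P)|²)^{1/2}`
(`= |Δ^η(p)|^{1/2} η`). [folklore] -/
def gsym (P : Tor (fine N M) × Fin d) : ℝ := Real.sqrt (∑ ν, ‖fsym (fine N M) (N : ℂ) ν P‖ ^ 2) / N

/-- `g ≥ 0`. [folklore] -/
private theorem gsym_nonneg (P : Tor (fine N M) × Fin d) : 0 ≤ gsym N M P :=
  div_nonneg (Real.sqrt_nonneg _) (Nat.cast_nonneg _)

/-- `|u_R − 1| ≤ (π√d/2)·g` (Cauchy–Schwarz over the `d` directions). [folklore] -/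
private theorem norm_uCen_sub_one_le_gsym (hN : 1 ≤ N) (hR : 1 ≤ R) (P : Tor (fine N M) × Fin d) :
    ‖uCen N R M P - 1‖ ≤ Real.pi * Real.sqrt d / 2 * gsym N M P := by
  have hNpos : (0 : ℝ) < N := by exact_mod_cast hN
  have h1 := norm_uCen_sub_one_le N R M hN hR P
  have hcs : ∑ ν, ‖fsym (fine N M) (N : ℂ) ν P‖
      ≤ Real.sqrt d * Real.sqrt (∑ ν, ‖fsym (fine N M) (N : ℂ) ν P‖ ^ 2) := by
    rw [← Real.sqrt_mul (Nat.cast_nonneg d)]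
    refine (Real.le_sqrt (Finset.sum_nonneg fun ν _ => norm_nonneg _)
      (mul_nonneg (Nat.cast_nonneg d) (Finset.sum_nonneg fun ν _ => sq_nonneg _))).mpr ?_
    have := sq_sum_le_card_mul_sum_sq (s := (Finset.univ : Finset (Fin d)))
      (f := fun ν => ‖fsym (fine N M) (N : ℂ) ν P‖)
    simpa [Finset.card_univ, Fintype.card_fin] using this
  calc ‖uCen N R M P - 1‖ ≤ Real.pi / (2 * N) * ∑ ν, ‖fsym (fine N M) (N : ℂ) ν P‖ := h1
    _ ≤ Real.pi / (2 * N) * (Real.sqrt d * Real.sqrt (∑ ν, ‖fsym (fine N M) (N : ℂ) ν P‖ ^ 2)) := by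
        gcongr
    _ = Real.pi * Real.sqrt d / 2 * gsym N M P := by
        rw [gsym]
        field_simp

/-- the quotient symbol `ρ = (u_R − 1)/g` (`0` where `g = 0`, where also `u_R = 1`). [folklore] -/
def rhoSym (P : Tor (fine N M) × Fin d) : ℂ :=
  if gsym N M P = 0 then 0 else (uCen N R M P - 1) / (gsym N M P : ℂ)

/-- `ρ·g = u_R − 1` everywhere. [folklore] -/
private theorem rhoSym_mul_gsym (hN : 1 ≤ N) (hR : 1 ≤ R) (P : Tor (fine N M) × Fin d) :
    rhoSym N R M P * (gsym N M P : ℂ) = uCen N R M P - 1 := by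
  unfold rhoSym
  split_ifs with h
  · have h0 := norm_uCen_sub_one_le_gsym N R M hN hR P
    rw [h, mul_zero] at h0
    rw [zero_mul, eq_comm, ← norm_le_zero_iff]
    exact h0
  · have hg : (gsym N M P : ℂ) ≠ 0 := by exact_mod_cast h
    field_simp

/-- `|ρ| ≤ π√d/2`. [folklore] -/
private theorem norm_rhoSym_le (hN : 1 ≤ N) (hR : 1 ≤ R) (P : Tor (fine N M) × Fin d) :
    ‖rhoSym N R M P‖ ≤ Real.pi * Real.sqrt d / 2 := by
  have hK : 0 ≤ Real.pi * Real.sqrt d / 2 := by positivity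
  unfold rhoSym
  split_ifs with h
  · rw [norm_zero]; exact hK
  · have hgpos : 0 < gsym N M P := lt_of_le_of_ne (gsym_nonneg N M P) (Ne.symm h)
    rw [norm_div, Complex.norm_real, Real.norm_of_nonneg hgpos.le, div_le_iff₀ hgpos]
    exact norm_uCen_sub_one_le_gsym N R M hN hR P

/-- FACTORISATION `mulOp(u_R) − 1 = mulOp(ρ) · mulOp(g)`. [folklore] -/
private theorem mulOp_uCen_sub_one_eq (hN : 1 ≤ N) (hR : 1 ≤ R) :
    mulOp N M (uCen N R M) - 1
      = mulOp N M (rhoSym N R M) * mulOp N M (fun P => (gsym N M P : ℂ)) := by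
  rw [mulOp_sub_one, mulOp_mul_mulOp]
  congr 1
  funext P
  rw [rhoSym_mul_gsym N R M hN hR P]

/-- `mulOp(g)² = N⁻²·Σ_ν (∇^η_ν)ᴴ ∇^η_ν` (`= −η²Δ^η` on vector fields, componentwise). [folklore] -/
private theorem mulOp_gsym_mul_self :
    mulOp N M (fun P => (gsym N M P : ℂ)) * mulOp N M (fun P => (gsym N M P : ℂ))
      = ((N : ℂ) ^ 2)⁻¹ • ∑ ν, (fdiff (fine N M) (N : ℂ) ν)ᴴ * fdiff (fine N M) (N : ℂ) ν := by
  simp_rw [fdiff_conjTranspose_mul_fdiff]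
  rw [sum_mulOp, smul_mulOp, mulOp_mul_mulOp]
  congr 1
  funext P
  have hS : 0 ≤ ∑ ν, ‖fsym (fine N M) (N : ℂ) ν P‖ ^ 2 := Finset.sum_nonneg fun ν _ => sq_nonneg _
  have hN0 : (N : ℂ) ≠ 0 := by exact_mod_cast NeZero.ne N
  rw [← Complex.ofReal_mul, show gsym N M P * gsym N M P
      = (∑ ν, ‖fsym (fine N M) (N : ℂ) ν P‖ ^ 2) / (N : ℝ) ^ 2 by
        rw [gsym, div_mul_div_comm, Real.mul_self_sqrt hS, pow_two]]
  push_cast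
  rw [div_eq_inv_mul]

/-- **`‖mulOp(g) X‖² ≤ η² Σ_ν ‖∇^η_ν X‖²`** for every operator `X` on `ℓ²(T_η; ℂ^d)`. [folklore] -/
private theorem opNorm_mulOp_gsym_mul_sq_le (X : Matrix (Tor (fine N M) × Fin d) (Tor (fine N M) × Fin d) ℂ) :
    ‖mulOp N M (fun P => (gsym N M P : ℂ)) * X‖ ^ 2
      ≤ ((N : ℝ) ^ 2)⁻¹ * ∑ ν, ‖fdiff (fine N M) (N : ℂ) ν * X‖ ^ 2 := by
  have hreal : star (fun P : Tor (fine N M) × Fin d => (gsym N M P : ℂ)) = fun P => (gsym N M P : ℂ) := by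
    funext P
    simp [Pi.star_apply]
  have e : (mulOp N M (fun P => (gsym N M P : ℂ)) * X)ᴴ * (mulOp N M (fun P => (gsym N M P : ℂ)) * X)
      = ((N : ℂ) ^ 2)⁻¹ • ∑ ν, (fdiff (fine N M) (N : ℂ) ν * X)ᴴ * (fdiff (fine N M) (N : ℂ) ν * X) := by
    rw [Matrix.conjTranspose_mul, conjTranspose_mulOp, hreal, Matrix.mul_assoc,
      ← Matrix.mul_assoc (mulOp N M (fun P => (gsym N M P : ℂ))), mulOp_gsym_mul_self, Matrix.smul_mul,
      Matrix.mul_smul, Matrix.sum_mul, Matrix.mul_sum]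
    congr 1
    refine Finset.sum_congr rfl fun ν _ => ?_
    rw [Matrix.conjTranspose_mul]
    simp only [Matrix.mul_assoc]
  rw [sq, ← Matrix.l2_opNorm_conjTranspose_mul_self, e, norm_smul, norm_inv, norm_pow, Complex.norm_natCast]
  refine mul_le_mul_of_nonneg_left ?_ (by positivity)
  refine (norm_sum_le _ _).trans (Finset.sum_le_sum fun ν _ => ?_)
  rw [Matrix.l2_opNorm_conjTranspose_mul_self, sq]

/-- `‖mulOp(g) 𝒢^{(η)}‖ ≤ √d·Cst(d,a)·η` (b05 (1.89): `‖∇^η_ν 𝒢‖ ≤ Cst`). [folklore] -/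
private theorem opNorm_mulOp_gsym_calG_le (hN : 1 ≤ N) (a : ℝ) (ha : 0 < a) :
    ‖mulOp N M (fun P => (gsym N M P : ℂ)) * calG N hN M a ha‖ ≤ Real.sqrt d * Cst d a / N := by
  have hNpos : (0 : ℝ) < N := by exact_mod_cast hN
  have hC := Cst_nonneg d a
  have hsq := opNorm_mulOp_gsym_mul_sq_le N M (calG N hN M a ha)
  have hb : ∑ ν, ‖fdiff (fine N M) (N : ℂ) ν * calG N hN M a ha‖ ^ 2 ≤ d * Cst d a ^ 2 := by
    calc ∑ ν, ‖fdiff (fine N M) (N : ℂ) ν * calG N hN M a ha‖ ^ 2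
        ≤ ∑ _ν : Fin d, Cst d a ^ 2 := Finset.sum_le_sum fun ν _ => by
            gcongr
            exact opNorm_fdiff_calG_le N hN M a ha ν
      _ = d * Cst d a ^ 2 := by rw [Finset.sum_const, Finset.card_univ, Fintype.card_fin, nsmul_eq_mul]
  have h2 : ‖mulOp N M (fun P => (gsym N M P : ℂ)) * calG N hN M a ha‖ ^ 2
      ≤ (Real.sqrt d * Cst d a / N) ^ 2 := by
    rw [div_pow, mul_pow, Real.sq_sqrt (Nat.cast_nonneg d)]
    calc ‖mulOp N M (fun P => (gsym N M P : ℂ)) * calG N hN M a ha‖ ^ 2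
        ≤ ((N : ℝ) ^ 2)⁻¹ * ∑ ν, ‖fdiff (fine N M) (N : ℂ) ν * calG N hN M a ha‖ ^ 2 := hsq
      _ ≤ ((N : ℝ) ^ 2)⁻¹ * (d * Cst d a ^ 2) := by gcongr
      _ = d * Cst d a ^ 2 / (N : ℝ) ^ 2 := by rw [inv_mul_eq_div]
  have h3 := abs_le_of_sq_le_sq h2 (div_nonneg (mul_nonneg (Real.sqrt_nonneg _) hC) hNpos.le)
  rwa [abs_of_nonneg (norm_nonneg _)] at h3

/-- **`‖(mulOp(u_R) − 1) 𝒢^{(η)}‖ ≤ (π d/2)·Cst(d,a)·η`**: the averaging-weight defect costs ONE derivative,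
which `𝒢` absorbs ((1.89)). [folklore] -/
private theorem opNorm_mulOp_uCen_sub_one_calG_le (hN : 1 ≤ N) (hR : 1 ≤ R) (a : ℝ) (ha : 0 < a) :
    ‖(mulOp N M (uCen N R M) - 1) * calG N hN M a ha‖ ≤ Real.pi * d * Cst d a / (2 * N) := by
  have hNpos : (0 : ℝ) < N := by exact_mod_cast hN
  have hC := Cst_nonneg d a
  have hdd : Real.sqrt d * Real.sqrt d = d := Real.mul_self_sqrt (Nat.cast_nonneg d)
  rw [mulOp_uCen_sub_one_eq N R M hN hR, Matrix.mul_assoc]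
  calc ‖mulOp N M (rhoSym N R M) * (mulOp N M (fun P => (gsym N M P : ℂ)) * calG N hN M a ha)‖
      ≤ ‖mulOp N M (rhoSym N R M)‖ * ‖mulOp N M (fun P => (gsym N M P : ℂ)) * calG N hN M a ha‖ :=
        Matrix.l2_opNorm_mul _ _
    _ ≤ (Real.pi * Real.sqrt d / 2) * (Real.sqrt d * Cst d a / N) :=
        mul_le_mul (opNorm_mulOp_le N M (rhoSym N R M) (by positivity) (norm_rhoSym_le N R M hN hR))
          (opNorm_mulOp_gsym_calG_le N M hN a ha) (norm_nonneg _) (by positivity)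
    _ = Real.pi * (Real.sqrt d * Real.sqrt d) * Cst d a / (2 * N) := by ring
    _ = Real.pi * d * Cst d a / (2 * N) := by rw [hdd]

/-- the adjoint side: `‖𝒢^{(η)} (mulOp(ū_R) − 1)‖ ≤ (π d/2)·Cst(d,a)·η` (`𝒢` Hermitian). [folklore] -/
private theorem opNorm_calG_mul_mulOp_star_uCen_sub_one_le (hN : 1 ≤ N) (hR : 1 ≤ R) (a : ℝ) (ha : 0 < a) :
    ‖calG N hN M a ha * (mulOp N M (star (uCen N R M)) - 1)‖ ≤ Real.pi * d * Cst d a / (2 * N) := by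
  have e : calG N hN M a ha * (mulOp N M (star (uCen N R M)) - 1)
      = ((mulOp N M (uCen N R M) - 1) * calG N hN M a ha)ᴴ := by
    rw [Matrix.conjTranspose_mul, (calG_isHermitian N hN M a ha).eq, Matrix.conjTranspose_sub,
      conjTranspose_mulOp, Matrix.conjTranspose_one]
  rw [e, Matrix.l2_opNorm_conjTranspose]
  exact opNorm_mulOp_uCen_sub_one_calG_le N R M hN hR a ha

/-- **`‖mulOp(u_R) 𝒢^{(η)} mulOp(ū_R) − 𝒢^{(η)}‖ ≤ π d·Cst(d,a)·η`**. [folklore] -/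
private theorem opNorm_mulOp_uCen_conj_calG_sub_le (hN : 1 ≤ N) (hR : 1 ≤ R) (a : ℝ) (ha : 0 < a) :
    ‖mulOp N M (uCen N R M) * calG N hN M a ha * mulOp N M (star (uCen N R M)) - calG N hN M a ha‖
      ≤ Real.pi * d * Cst d a / N := by
  have hNpos : (0 : ℝ) < N := by exact_mod_cast hN
  have hK0 : 0 ≤ Real.pi * d * Cst d a / (2 * N) := by
    have := Cst_nonneg d a
    positivity
  have hstar : ‖mulOp N M (star (uCen N R M))‖ ≤ 1 :=
    opNorm_mulOp_le N M _ zero_le_one fun P => by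
      rw [Pi.star_apply, norm_star]; exact norm_uCen_le_one N R M hR P
  have h1 := opNorm_mulOp_uCen_sub_one_calG_le N R M hN hR a ha
  have h2 := opNorm_calG_mul_mulOp_star_uCen_sub_one_le N R M hN hR a ha
  have e : mulOp N M (uCen N R M) * calG N hN M a ha * mulOp N M (star (uCen N R M)) - calG N hN M a ha
      = (mulOp N M (uCen N R M) - 1) * calG N hN M a ha * mulOp N M (star (uCen N R M))
        + calG N hN M a ha * (mulOp N M (star (uCen N R M)) - 1) := by
    rw [Matrix.sub_mul, Matrix.one_mul, Matrix.sub_mul, Matrix.mul_sub, Matrix.mul_one, sub_add_sub_cancel]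
  rw [e]
  have h1' : ‖(mulOp N M (uCen N R M) - 1) * calG N hN M a ha * mulOp N M (star (uCen N R M))‖
      ≤ Real.pi * d * Cst d a / (2 * N) * 1 :=
    (Matrix.l2_opNorm_mul _ _).trans (mul_le_mul h1 hstar (norm_nonneg _) hK0)
  calc ‖(mulOp N M (uCen N R M) - 1) * calG N hN M a ha * mulOp N M (star (uCen N R M))
          + calG N hN M a ha * (mulOp N M (star (uCen N R M)) - 1)‖
      ≤ ‖(mulOp N M (uCen N R M) - 1) * calG N hN M a ha * mulOp N M (star (uCen N R M))‖
          + ‖calG N hN M a ha * (mulOp N M (star (uCen N R M)) - 1)‖ := norm_add_le _ _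
    _ ≤ Real.pi * d * Cst d a / (2 * N) * 1 + Real.pi * d * Cst d a / (2 * N) := add_le_add h1' h2
    _ = Real.pi * d * Cst d a / N := by ring

omit [NeZero N] [NeZero R] hM in
/-- the constant of the `(0,0)` rate against King's `Q`: the `J_R`-rate constant `CT` plus the averaging-weight
defect `π d·Cst`. [folklore] -/
def CQ (d : ℕ) (a : ℝ) : ℝ := CT d a + Real.pi * d * Cst d a

omit [NeZero N] [NeZero R] hM in
/-- `CQ ≥ 0`. [folklore] -/
private theorem CQ_nonneg (d : ℕ) (a : ℝ) : 0 ≤ CQ d a :=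
  add_nonneg (CT_nonneg d a) (by have := Cst_nonneg d a; positivity)

/-- **THE `(0,0)` η-RATE AGAINST KING's BLOCK AVERAGING** (`U = 1`, finite torus, all `N, R ≥ 1`, `a > 0`):
`‖Q_R 𝒢^{(η/R)} Q_Rᴴ − R^{−d} 𝒢^{(η)}‖_{ℓ²(T_η; ℂ^d)} ≤ R^{−d}·CQ(d,a)·η`, `Q_R` = King's (2.10) verbatim
(entries `R^{−d}`; `R^{−d} = ‖Q_R‖²` is the ratio of the `ℓ²` normalisations of the two tori): the block
averages of the fine-lattice covariance ARE the coarse-lattice covariance up to `O(η)`.  Assembled from the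
`J_R`-rate `‖𝒢^{(η/R)} − J_R 𝒢^{(η)} J_Rᴴ‖ ≤ CT·η` (`B5G183RateTorus.opNorm_calG_rate`), `Q_R J_R = R^{−d/2}
mulOp(u_R)` and the first-order defect of the averaging weight absorbed by one derivative of `𝒢` ((1.89)).
Bałaban prints no rate; King's scalar mechanism (4.19)–(4.23) is the model; statement and constant OURS.
[cite: King1986, (2.10) p.653, (4.2)-(4.3) p.670, (4.19)-(4.23) p.672; Balaban1984PropagatorsI, (1.31) p.23,
Prop. 1.1 (1.89) p.33] [folklore] -/
theorem opNorm_Qavg_calG_rate (hN : 1 ≤ N) (hR : 1 ≤ R) (hRN : 1 ≤ R * N) (a : ℝ) (ha : 0 < a) :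
    ‖Qavg N R M * calG (R * N) hRN M a ha * (Qavg N R M)ᴴ - ((R : ℂ) ^ d)⁻¹ • calG N hN M a ha‖
      ≤ ((R : ℝ) ^ d)⁻¹ * CQ d a / N := by
  have hNpos : (0 : ℝ) < N := by exact_mod_cast hN
  have hRd : (0 : ℝ) < (R : ℝ) ^ d := pow_pos (by exact_mod_cast Nat.pos_of_ne_zero (NeZero.ne R)) d
  have hcc : (Real.sqrt ((R : ℝ) ^ d))⁻¹ * (Real.sqrt ((R : ℝ) ^ d))⁻¹ = ((R : ℝ) ^ d)⁻¹ := by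
    rw [← mul_inv, Real.mul_self_sqrt hRd.le]
  have hc2 : ((((Real.sqrt ((R : ℝ) ^ d))⁻¹ : ℝ) : ℂ) * (((Real.sqrt ((R : ℝ) ^ d))⁻¹ : ℝ) : ℂ))
      = ((R : ℂ) ^ d)⁻¹ := by
    rw [← Complex.ofReal_mul, hcc]
    push_cast
    rfl
  have hQJ := Qavg_mul_Jmat N R M
  have hQJt : (Jmat N R M)ᴴ * (Qavg N R M)ᴴ
      = (((Real.sqrt ((R : ℝ) ^ d))⁻¹ : ℝ) : ℂ) • mulOp N M (star (uCen N R M)) := by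
    rw [← Matrix.conjTranspose_mul, hQJ, Matrix.conjTranspose_smul, conjTranspose_mulOp]
    congr 1
    exact Complex.conj_ofReal _
  have key : Qavg N R M * (Jmat N R M * calG N hN M a ha * (Jmat N R M)ᴴ) * (Qavg N R M)ᴴ
      = ((R : ℂ) ^ d)⁻¹ • (mulOp N M (uCen N R M) * calG N hN M a ha * mulOp N M (star (uCen N R M))) := by
    calc Qavg N R M * (Jmat N R M * calG N hN M a ha * (Jmat N R M)ᴴ) * (Qavg N R M)ᴴ
        = (Qavg N R M * Jmat N R M) * calG N hN M a ha * ((Jmat N R M)ᴴ * (Qavg N R M)ᴴ) := by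
          simp only [Matrix.mul_assoc]
      _ = ((R : ℂ) ^ d)⁻¹
          • (mulOp N M (uCen N R M) * calG N hN M a ha * mulOp N M (star (uCen N R M))) := by
          rw [hQJ, hQJt, Matrix.smul_mul, Matrix.smul_mul, Matrix.mul_smul, smul_smul, hc2]
  have split : Qavg N R M * calG (R * N) hRN M a ha * (Qavg N R M)ᴴ - ((R : ℂ) ^ d)⁻¹ • calG N hN M a ha
      = Qavg N R M * (calG (R * N) hRN M a ha - Jmat N R M * calG N hN M a ha * (Jmat N R M)ᴴ)
          * (Qavg N R M)ᴴ
        + ((R : ℂ) ^ d)⁻¹ • (mulOp N M (uCen N R M) * calG N hN M a ha * mulOp N M (star (uCen N R M))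
          - calG N hN M a ha) := by
    rw [Matrix.mul_sub, Matrix.sub_mul, key, smul_sub, sub_add_sub_cancel]
  rw [split]
  have hQ := opNorm_Qavg_le N R M
  have hQt : ‖(Qavg N R M)ᴴ‖ ≤ (Real.sqrt ((R : ℝ) ^ d))⁻¹ := by rw [Matrix.l2_opNorm_conjTranspose]; exact hQ
  have hc0 : 0 ≤ (Real.sqrt ((R : ℝ) ^ d))⁻¹ := inv_nonneg.mpr (Real.sqrt_nonneg _)
  have hT1 : ‖Qavg N R M * (calG (R * N) hRN M a ha - Jmat N R M * calG N hN M a ha * (Jmat N R M)ᴴ)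
        * (Qavg N R M)ᴴ‖ ≤ ((R : ℝ) ^ d)⁻¹ * (CT d a / N) := by
    calc ‖Qavg N R M * (calG (R * N) hRN M a ha - Jmat N R M * calG N hN M a ha * (Jmat N R M)ᴴ)
          * (Qavg N R M)ᴴ‖
        ≤ ‖Qavg N R M‖ * ‖calG (R * N) hRN M a ha - Jmat N R M * calG N hN M a ha * (Jmat N R M)ᴴ‖
            * ‖(Qavg N R M)ᴴ‖ :=
          (Matrix.l2_opNorm_mul _ _).trans (mul_le_mul_of_nonneg_right (Matrix.l2_opNorm_mul _ _)
            (norm_nonneg _))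
      _ ≤ (Real.sqrt ((R : ℝ) ^ d))⁻¹ * (CT d a / N) * (Real.sqrt ((R : ℝ) ^ d))⁻¹ := by
          have hrate := opNorm_calG_rate N R M hN hR hRN a ha
          have h0 : 0 ≤ CT d a / N := div_nonneg (CT_nonneg d a) hNpos.le
          exact mul_le_mul (mul_le_mul hQ hrate (norm_nonneg _) hc0) hQt (norm_nonneg _)
            (mul_nonneg hc0 h0)
      _ = ((R : ℝ) ^ d)⁻¹ * (CT d a / N) := by rw [mul_comm _ (CT d a / N), mul_assoc, hcc, mul_comm]
  have hT2 : ‖((R : ℂ) ^ d)⁻¹ • (mulOp N M (uCen N R M) * calG N hN M a ha * mulOp N M (star (uCen N R M))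
          - calG N hN M a ha)‖ ≤ ((R : ℝ) ^ d)⁻¹ * (Real.pi * d * Cst d a / N) := by
    rw [norm_smul, norm_inv, norm_pow, Complex.norm_natCast]
    exact mul_le_mul_of_nonneg_left (opNorm_mulOp_uCen_conj_calG_sub_le N R M hN hR a ha)
      (le_of_lt (inv_pos.mpr hRd))
  calc _ ≤ _ := norm_add_le _ _
    _ ≤ ((R : ℝ) ^ d)⁻¹ * (CT d a / N) + ((R : ℝ) ^ d)⁻¹ * (Real.pi * d * Cst d a / N) := add_le_add hT1 hT2
    _ = ((R : ℝ) ^ d)⁻¹ * CQ d a / N := by rw [CQ]; ring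

/-- the same with the `R^{−d}` dropped (`R ≥ 1`): `‖Q_R 𝒢^{(η/R)} Q_Rᴴ − R^{−d} 𝒢^{(η)}‖ ≤ CQ(d,a)·η`. [cite: King1986, (2.10) p.653, (4.19)-(4.23) p.672; Balaban1984PropagatorsI, Prop. 1.1 (1.89) p.33] [folklore] -/
theorem opNorm_Qavg_calG_rate' (hN : 1 ≤ N) (hR : 1 ≤ R) (hRN : 1 ≤ R * N) (a : ℝ) (ha : 0 < a) :
    ‖Qavg N R M * calG (R * N) hRN M a ha * (Qavg N R M)ᴴ - ((R : ℂ) ^ d)⁻¹ • calG N hN M a ha‖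
      ≤ CQ d a / N := by
  have hNpos : (0 : ℝ) < N := by exact_mod_cast hN
  have hR1 : (1 : ℝ) ≤ (R : ℝ) ^ d := one_le_pow₀ (by exact_mod_cast hR)
  refine (opNorm_Qavg_calG_rate N R M hN hR hRN a ha).trans ?_
  rw [mul_div_assoc]
  exact mul_le_of_le_one_left (div_nonneg (CQ_nonneg d a) hNpos.le) (inv_le_one_of_one_le₀ hR1)

end Averaging

/-! ## §8 (v1.3) The ONE-SIDED order-two items `∇_ν∇_{ν′}(𝒲²𝒢)` and `(𝒢𝒲²)∇*_ν∇*_{ν′}` of (1.89) on the torus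
(fifth and sixth items, King-weighted as in `B5G183RateO2Op` §5: one full weight `W²` on the pair of
derivatives), rate `η` [cite: Balaban1984PropagatorsI, Prop. 1.1 (1.89) p.33; King1986, (4.19)-(4.20), (4.23) p.672] -/

section OneSidedSymbol

open Literature.MathematicalPhysics.QuantumFieldTheory.Balaban1983to89.B5G183RateO2Op

variable (n : ℕ) [NeZero n] (hn : 1 ≤ n) (M : Fin d → ℕ) [hM : ∀ μ, NeZero (M μ)] (a : ℝ) (ha : 0 < a)

/-- **the weighted fifth item is a LEFT multiplier sandwich of `𝒢`:**
`∇_ν ∇_{ν′} 𝒲_2 𝒢 = mulW (∂_ν·W²·∂_{ν′}) 1` (`𝒲_2 = Wop 2`, symbol `W²`). [cite: Balaban1984PropagatorsI,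
Prop. 1.1 (1.89) p.33 (fifth item `∇∇G`); King1986, (4.19)-(4.20) p.672 (the weight)] [folklore] -/
theorem oneSidedL_eq_mulW (ν ν' : Fin d) :
    fdiff (fine n M) (n : ℂ) ν * fdiff (fine n M) (n : ℂ) ν' * Wop n M 2 * calG n hn M a ha
      = mulW n hn M a ha
          (fun i => fsym (fine n M) (n : ℂ) ν i * (wsym n M 2 i * fsym (fine n M) (n : ℂ) ν' i))
          (fun _ => (1 : ℂ)) := by
  rw [calG_eq_mulW, Wop]
  simp only [Matrix.mul_assoc]
  rw [mulOp_mul_mulW, fdiff_mul_mulW, fdiff_mul_mulW]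
  congr 1
  funext i
  simp only [mul_one]
  ring

/-- **the weighted sixth item is a RIGHT multiplier sandwich of `𝒢`:**
`𝒢 𝒲_2 ∇*_ν ∇*_{ν′} = mulW 1 (∂_ν·W²·∂_{ν′})`. [cite: Balaban1984PropagatorsI, Prop. 1.1 (1.89) p.33
(sixth item `G∇*∇*`); King1986, (4.19)-(4.20) p.672 (the weight)] [folklore] -/
theorem oneSidedR_eq_mulW (ν ν' : Fin d) :
    calG n hn M a ha * Wop n M 2 * star (fdiff (fine n M) (n : ℂ) ν) * star (fdiff (fine n M) (n : ℂ) ν')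
      = mulW n hn M a ha (fun _ => (1 : ℂ))
          (fun i => fsym (fine n M) (n : ℂ) ν i * (wsym n M 2 i * fsym (fine n M) (n : ℂ) ν' i)) := by
  rw [calG_eq_mulW, Wop, mulW_mul_mulOp, mulW_mul_star_fdiff, mulW_mul_star_fdiff]
  congr 1
  funext i
  rw [star_wsym]
  ring

/-- the symbol `∂_ν·W²·∂_{ν′}` restricts to the cosets as `dSym ν · wdSym ν′` — EXACTLY the left / right
weight of `B5G183RateO2Op.opNorm_DDW_G_rate` / `opNorm_G_DDW_rate`. [folklore] -/
private theorem ddwsym_restrict (ν ν' : Fin d) (I : ((Fin d → Fin n) × Fin d) × Tor M) :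
    (fun i => fsym (fine n M) (n : ℂ) ν i * (wsym n M 2 i * fsym (fine n M) (n : ℂ) ν' i))
        ((blockEquiv n M).symm I)
      = dSym n I.1.1 (sOf M I.2) ν * wdSym n I.1.1 (sOf M I.2) ν' := by
  show fsym (fine n M) (n : ℂ) ν ((blockEquiv n M).symm I)
      * (wsym n M 2 ((blockEquiv n M).symm I) * fsym (fine n M) (n : ℂ) ν' ((blockEquiv n M).symm I)) = _
  rw [wsym_restrict, restrict_fsym, restrict_fsym, wdSym, Real.rpow_two]

end OneSidedSymbol

section OneSidedZero

open Literature.MathematicalPhysics.QuantumFieldTheory.Balaban1983to89.B5G183RateO2Op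

variable {N R : ℕ} [NeZero N] [NeZero R]

/-- at `p′ = 0` the symbol `∂_ν·W²·∂_{ν′}` vanishes on EVERY class (zero class: `∂(0) = 0`; the others:
weight `0`, `Wc_zero_of_ne`). [folklore] -/
private theorem ddwSym_zero_fibre {n : ℕ} [NeZero n] (K : Fin d → Fin n) (ν ν' : Fin d) :
    dSym n K (0 : Fin d → ℝ) ν * wdSym n K (0 : Fin d → ℝ) ν' = 0 := by
  by_cases hK : K = 0
  · subst hK
    have h0 : dSym n (0 : Fin d → Fin n) (0 : Fin d → ℝ) ν = 0 := dSym_const_zero ν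
    rw [h0, zero_mul]
  · rw [wdSym, Wc_zero_of_ne hK]
    simp

omit [NeZero N] [NeZero R] in
/-- a sandwich with zero LEFT weight vanishes. [folklore] -/
private theorem sandwich_zero_left {Λ : Type*} (r : Λ → ℂ) (X : Matrix (Λ × Fin d) (Λ × Fin d) ℂ) :
    sandwich (fun _ => (0 : ℂ)) r X = 0 := by
  ext i j
  simp [sandwich]

omit [NeZero N] [NeZero R] in
/-- a sandwich with zero RIGHT weight vanishes. [folklore] -/
private theorem sandwich_zero_right {Λ : Type*} (ℓ : Λ → ℂ) (X : Matrix (Λ × Fin d) (Λ × Fin d) ℂ) :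
    sandwich ℓ (fun _ => (0 : ℂ)) X = 0 := by
  ext i j
  simp [sandwich]

/-- **the one-sided zero cosets are the zero matrix at both levels**, so their η-difference is `0`. [folklore] -/
private theorem opNorm_zeroFibDDW_left (a : ℝ) (ν ν' : Fin d) :
    ‖sandwich (fun K => dSym (R * N) K (0 : Fin d → ℝ) ν * wdSym (R * N) K (0 : Fin d → ℝ) ν')
          (fun _ => (1 : ℂ)) (zeroFib (R * N) a)
        - Pmat N R (0 : Fin d → ℝ)
          * sandwich (fun k => dSym N k (0 : Fin d → ℝ) ν * wdSym N k (0 : Fin d → ℝ) ν')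
              (fun _ => (1 : ℂ)) (zeroFib N a)
          * (Pmat N R (0 : Fin d → ℝ))ᴴ‖ = 0 := by
  have h1 : (fun K : Fin d → Fin (R * N) => dSym (R * N) K (0 : Fin d → ℝ) ν * wdSym (R * N) K 0 ν')
      = fun _ => 0 := funext fun K => ddwSym_zero_fibre K ν ν'
  have h2 : (fun k : Fin d → Fin N => dSym N k (0 : Fin d → ℝ) ν * wdSym N k 0 ν') = fun _ => 0 :=
    funext fun k => ddwSym_zero_fibre k ν ν'
  rw [h1, h2, sandwich_zero_left, sandwich_zero_left, Matrix.mul_zero, Matrix.zero_mul, sub_zero, norm_zero]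

/-- the mirrored zero coset. [folklore] -/
private theorem opNorm_zeroFibDDW_right (a : ℝ) (ν ν' : Fin d) :
    ‖sandwich (fun _ => (1 : ℂ))
          (fun K => dSym (R * N) K (0 : Fin d → ℝ) ν * wdSym (R * N) K (0 : Fin d → ℝ) ν') (zeroFib (R * N) a)
        - Pmat N R (0 : Fin d → ℝ)
          * sandwich (fun _ => (1 : ℂ))
              (fun k => dSym N k (0 : Fin d → ℝ) ν * wdSym N k (0 : Fin d → ℝ) ν') (zeroFib N a)
          * (Pmat N R (0 : Fin d → ℝ))ᴴ‖ = 0 := by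
  have h1 : (fun K : Fin d → Fin (R * N) => dSym (R * N) K (0 : Fin d → ℝ) ν * wdSym (R * N) K 0 ν')
      = fun _ => 0 := funext fun K => ddwSym_zero_fibre K ν ν'
  have h2 : (fun k : Fin d → Fin N => dSym N k (0 : Fin d → ℝ) ν * wdSym N k 0 ν') = fun _ => 0 :=
    funext fun k => ddwSym_zero_fibre k ν ν'
  rw [h1, h2, sandwich_zero_right, sandwich_zero_right, Matrix.mul_zero, Matrix.zero_mul, sub_zero,
    norm_zero]

end OneSidedZero

section OneSidedTorus

open Literature.MathematicalPhysics.QuantumFieldTheory.Balaban1983to89.B5G183RateO2Op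

variable (N R : ℕ) [NeZero N] [NeZero R] (M : Fin d → ℕ) [hM : ∀ μ, NeZero (M μ)]

omit [NeZero N] [NeZero R] hM in
/-- the constant of the one-sided torus rates: the fibrewise `C2op d a` of `B5G183RateO2Op` (`p′ ≠ 0`)
against the zero-coset floor `CzrW a` of §2 (the one-sided zero coset itself contributes `0`; the floor is
kept for uniformity with `CTW`, `CTX` and makes `CT2 > 0` evident). [folklore] -/
def CT2 (d : ℕ) (a : ℝ) : ℝ := max (C2op d a) (CzrW a)

omit [NeZero N] [NeZero R] hM in
/-- `0 < CT2`. [folklore] -/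
private theorem CT2_pos (d : ℕ) (a : ℝ) : 0 < CT2 d a := lt_of_lt_of_le (CzrW_pos a) (le_max_right _ _)

/-- blockwise one-sided (LEFT) weighted order-two rate over EVERY coset: `p′ ≠ 0` is the kernel theorem
`B5G183RateO2Op.opNorm_DDW_G_rate` (via `plant_eq_conj`), `p′ = 0` is the zero matrix. [folklore] -/
private theorem blocksDDW_rate (hN : 1 ≤ N) (hR : 1 ≤ R) (hRN : 1 ≤ R * N) (a : ℝ) (ha : 0 < a)
    (ν ν' : Fin d) (q : Tor M) :
    ‖sandwich (fun k => dSym (R * N) k (sOf M q) ν * wdSym (R * N) k (sOf M q) ν') (fun _ => (1 : ℂ))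
          (blocks (R * N) hRN M a ha q)
        - Pmat N R (sOf M q)
          * sandwich (fun k => dSym N k (sOf M q) ν * wdSym N k (sOf M q) ν') (fun _ => (1 : ℂ))
              (blocks N hN M a ha q)
          * (Pmat N R (sOf M q))ᴴ‖ ≤ CT2 d a / N := by
  have hN0 : (0 : ℝ) < N := by exact_mod_cast hN
  by_cases hq : q = 0
  · subst hq
    unfold blocks
    rw [dif_pos rfl, dif_pos rfl, sOf_zero, opNorm_zeroFibDDW_left]
    exact div_nonneg (CT2_pos d a).le hN0.le
  · unfold blocks
    rw [dif_neg hq, dif_neg hq, ← plant_eq_conj hN (abs_sOf_le M q)]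
    exact (opNorm_DDW_G_rate hN hR hRN a ha (abs_sOf_le M q) (sOf_ne_zero M hq) ν ν').trans
      (div_le_div_of_nonneg_right (le_max_left _ _) hN0.le)

/-- blockwise one-sided (RIGHT) weighted order-two rate over every coset (`B5G183RateO2Op.opNorm_G_DDW_rate`). [folklore] -/
private theorem blocksGDDW_rate (hN : 1 ≤ N) (hR : 1 ≤ R) (hRN : 1 ≤ R * N) (a : ℝ) (ha : 0 < a)
    (ν ν' : Fin d) (q : Tor M) :
    ‖sandwich (fun _ => (1 : ℂ)) (fun k => dSym (R * N) k (sOf M q) ν * wdSym (R * N) k (sOf M q) ν')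
          (blocks (R * N) hRN M a ha q)
        - Pmat N R (sOf M q)
          * sandwich (fun _ => (1 : ℂ)) (fun k => dSym N k (sOf M q) ν * wdSym N k (sOf M q) ν')
              (blocks N hN M a ha q)
          * (Pmat N R (sOf M q))ᴴ‖ ≤ CT2 d a / N := by
  have hN0 : (0 : ℝ) < N := by exact_mod_cast hN
  by_cases hq : q = 0
  · subst hq
    unfold blocks
    rw [dif_pos rfl, dif_pos rfl, sOf_zero, opNorm_zeroFibDDW_right]
    exact div_nonneg (CT2_pos d a).le hN0.le
  · unfold blocks
    rw [dif_neg hq, dif_neg hq, ← plant_eq_conj hN (abs_sOf_le M q)]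
    exact (opNorm_G_DDW_rate hN hR hRN a ha (abs_sOf_le M q) (sOf_ne_zero M hq) ν ν').trans
      (div_le_div_of_nonneg_right (le_max_left _ _) hN0.le)

/-- **THE TORUS η-RATE OF THE WEIGHTED FIFTH ITEM `∇_ν ∇_{ν′} 𝒲_2 𝒢`** (Bałaban's (1.89) `∇∇G` at `U = 1`,
with one full King weight `W²` (4.20) on the pair of derivatives, as in the fibrewise
`B5G183RateO2Op.opNorm_DDW_G_rate`): for every finite unit torus, `N, R ≥ 1`, `a > 0`, `ν, ν′`,
`‖∇_ν^{(η/R)} ∇_{ν′}^{(η/R)} 𝒲_2^{(η/R)} 𝒢^{(η/R)} − J_R (∇_ν^{(η)} ∇_{ν′}^{(η)} 𝒲_2^{(η)} 𝒢^{(η)}) J_Rᴴ‖ ≤ CT2(d,a)·η`,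
`CT2 = max(C2op, CzrW)`.  The `p′ ≠ 0` cosets are the kernel theorem BY NAME, the `p′ = 0` coset is the zero matrix at both levels.
Bałaban prints the UNIFORM bound (`B5Prop11Plancherel.opNorm_fdiff_fdiff_calG_le`) and no rate; King's
scalar (4.19)–(4.23) is the model; weight placement, statement and constant OURS.
[cite: Balaban1984PropagatorsI, Prop. 1.1 (1.89) p.33; King1986, (4.19)-(4.20), (4.23) p.672] [folklore] -/
theorem opNorm_oneSidedL_rate (hN : 1 ≤ N) (hR : 1 ≤ R) (hRN : 1 ≤ R * N) (a : ℝ) (ha : 0 < a)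
    (ν ν' : Fin d) :
    ‖fdiff (fine (R * N) M) ((R * N : ℕ) : ℂ) ν * fdiff (fine (R * N) M) ((R * N : ℕ) : ℂ) ν'
          * Wop (R * N) M 2 * calG (R * N) hRN M a ha
        - Jmat N R M
          * (fdiff (fine N M) (N : ℂ) ν * fdiff (fine N M) (N : ℂ) ν' * Wop N M 2 * calG N hN M a ha)
          * (Jmat N R M)ᴴ‖ ≤ CT2 d a / N := by
  rw [oneSidedL_eq_mulW, oneSidedL_eq_mulW,
    mulW_eq_conj_blocks M hRN a ha _ _ (fun q k => dSym (R * N) k (sOf M q) ν * wdSym (R * N) k (sOf M q) ν')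
      (fun _ _ => (1 : ℂ)) (ddwsym_restrict (R * N) M ν ν') (fun _ => rfl),
    mulW_eq_conj_blocks M hN a ha _ _ (fun q k => dSym N k (sOf M q) ν * wdSym N k (sOf M q) ν')
      (fun _ _ => (1 : ℂ)) (ddwsym_restrict N M ν ν') (fun _ => rfl)]
  unfold Jmat Jhat
  exact opNorm_diff_planted_le (dftV_mul_star _) (dftV_mem_unitaryGroup _) (blockEquiv N M)
    (blockEquiv (R * N) M) _ _ _ (div_nonneg (CT2_pos d a).le (Nat.cast_nonneg N))
    (blocksDDW_rate N R M hN hR hRN a ha ν ν')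

/-- **THE TORUS η-RATE OF THE WEIGHTED SIXTH ITEM `𝒢 𝒲_2 ∇*_ν ∇*_{ν′}`** (Bałaban's (1.89) `G∇*∇*` at `U = 1`,
King weight `W²` on the pair of derivatives, fibrewise `B5G183RateO2Op.opNorm_G_DDW_rate`):
`‖𝒢^{(η/R)} 𝒲_2^{(η/R)} ∇_ν^{(η/R)*} ∇_{ν′}^{(η/R)*} − J_R (𝒢^{(η)} 𝒲_2^{(η)} ∇_ν^{(η)*} ∇_{ν′}^{(η)*}) J_Rᴴ‖ ≤ CT2(d,a)·η`,
every finite unit torus, `N, R ≥ 1`, `a > 0`.  Uniform bound: b05's `opNorm_calG_star_fdiff_star_fdiff_le`;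
no rate is printed; statement and constant OURS.
[cite: Balaban1984PropagatorsI, Prop. 1.1 (1.89) p.33; King1986, (4.19)-(4.20), (4.23) p.672] [folklore] -/
theorem opNorm_oneSidedR_rate (hN : 1 ≤ N) (hR : 1 ≤ R) (hRN : 1 ≤ R * N) (a : ℝ) (ha : 0 < a)
    (ν ν' : Fin d) :
    ‖calG (R * N) hRN M a ha * Wop (R * N) M 2 * star (fdiff (fine (R * N) M) ((R * N : ℕ) : ℂ) ν)
          * star (fdiff (fine (R * N) M) ((R * N : ℕ) : ℂ) ν')
        - Jmat N R M
          * (calG N hN M a ha * Wop N M 2 * star (fdiff (fine N M) (N : ℂ) ν)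
              * star (fdiff (fine N M) (N : ℂ) ν'))
          * (Jmat N R M)ᴴ‖ ≤ CT2 d a / N := by
  rw [oneSidedR_eq_mulW, oneSidedR_eq_mulW,
    mulW_eq_conj_blocks M hRN a ha _ _ (fun _ _ => (1 : ℂ))
      (fun q k => dSym (R * N) k (sOf M q) ν * wdSym (R * N) k (sOf M q) ν') (fun _ => rfl)
      (ddwsym_restrict (R * N) M ν ν'),
    mulW_eq_conj_blocks M hN a ha _ _ (fun _ _ => (1 : ℂ))
      (fun q k => dSym N k (sOf M q) ν * wdSym N k (sOf M q) ν') (fun _ => rfl) (ddwsym_restrict N M ν ν')]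
  unfold Jmat Jhat
  exact opNorm_diff_planted_le (dftV_mul_star _) (dftV_mem_unitaryGroup _) (blockEquiv N M)
    (blockEquiv (R * N) M) _ _ _ (div_nonneg (CT2_pos d a).le (Nat.cast_nonneg N))
    (blocksGDDW_rate N R M hN hR hRN a ha ν ν')

omit [NeZero N] [NeZero R] hM in
/-- the common constant of the six-item table: the largest of `CT`, `CTL`, `CTW`, `CT2`. [folklore] -/
def C6 (d : ℕ) (a : ℝ) : ℝ := max (max (CT d a) (CTL d a)) (max (CTW d a) (CT2 d a))

/-- **ALL SIX ITEMS OF (1.89) CARRY A TORUS-LEVEL η-RATE AT `U = 1`** against the spectral injection `J_R`,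
the order-two ones in the King-weighted currencies, with ONE constant `C6(d,a)` and the full rate `η`:
`𝒢` (`B5G183RateTorus.opNorm_calG_rate`), `∇_ν𝒢`, `𝒢∇_ν^*` (`B5G183RateTorus`, §5 there), `𝒲_1∇_ν𝒢∇_{ν′}^*𝒲_1`
(King's placement `θ = 1`, §3 here), `∇_ν∇_{ν′}𝒲_2𝒢`, `𝒢𝒲_2∇_ν^*∇_{ν′}^*` (§8 here) — uniform bounds of all
six UNweighted items are b05's Prop. 1.1 (`B5Prop11Plancherel.opNorm_*_le`, constant `Cst`), not restated.
Packaging for the cell's carver; every rate statement and constant OURS, nothing printed by either author.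
[cite: Balaban1984PropagatorsI, Prop. 1.1 (1.89) p.33; King1986, (4.19)-(4.20), (4.23) p.672] [folklore] -/
theorem sixItems_torus_rate (hN : 1 ≤ N) (hR : 1 ≤ R) (hRN : 1 ≤ R * N) (a : ℝ) (ha : 0 < a)
    (ν ν' : Fin d) :
    ‖calG (R * N) hRN M a ha - Jmat N R M * calG N hN M a ha * (Jmat N R M)ᴴ‖ ≤ C6 d a / N
    ∧ ‖fdiff (fine (R * N) M) ((R * N : ℕ) : ℂ) ν * calG (R * N) hRN M a ha
          - Jmat N R M * (fdiff (fine N M) (N : ℂ) ν * calG N hN M a ha) * (Jmat N R M)ᴴ‖ ≤ C6 d a / N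
    ∧ ‖calG (R * N) hRN M a ha * star (fdiff (fine (R * N) M) ((R * N : ℕ) : ℂ) ν)
          - Jmat N R M * (calG N hN M a ha * star (fdiff (fine N M) (N : ℂ) ν)) * (Jmat N R M)ᴴ‖
        ≤ C6 d a / N
    ∧ ‖Wop (R * N) M 1
            * (fdiff (fine (R * N) M) ((R * N : ℕ) : ℂ) ν * calG (R * N) hRN M a ha
                * star (fdiff (fine (R * N) M) ((R * N : ℕ) : ℂ) ν'))
            * Wop (R * N) M 1
          - Jmat N R M
            * (Wop N M 1
                * (fdiff (fine N M) (N : ℂ) ν * calG N hN M a ha * star (fdiff (fine N M) (N : ℂ) ν'))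
                * Wop N M 1)
            * (Jmat N R M)ᴴ‖ ≤ C6 d a / N
    ∧ ‖fdiff (fine (R * N) M) ((R * N : ℕ) : ℂ) ν * fdiff (fine (R * N) M) ((R * N : ℕ) : ℂ) ν'
            * Wop (R * N) M 2 * calG (R * N) hRN M a ha
          - Jmat N R M
            * (fdiff (fine N M) (N : ℂ) ν * fdiff (fine N M) (N : ℂ) ν' * Wop N M 2 * calG N hN M a ha)
            * (Jmat N R M)ᴴ‖ ≤ C6 d a / N
    ∧ ‖calG (R * N) hRN M a ha * Wop (R * N) M 2 * star (fdiff (fine (R * N) M) ((R * N : ℕ) : ℂ) ν)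
            * star (fdiff (fine (R * N) M) ((R * N : ℕ) : ℂ) ν')
          - Jmat N R M
            * (calG N hN M a ha * Wop N M 2 * star (fdiff (fine N M) (N : ℂ) ν)
                * star (fdiff (fine N M) (N : ℂ) ν'))
            * (Jmat N R M)ᴴ‖ ≤ C6 d a / N := by
  have hN0 : (0 : ℝ) < N := by exact_mod_cast hN
  have e1 : CT d a ≤ C6 d a := (le_max_left _ _).trans (le_max_left _ _)
  have e2 : CTL d a ≤ C6 d a := (le_max_right _ _).trans (le_max_left _ _)
  have e3 : CTW d a ≤ C6 d a := (le_max_left _ _).trans (le_max_right _ _)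
  have e4 : CT2 d a ≤ C6 d a := (le_max_right _ _).trans (le_max_right _ _)
  have m : ∀ {x C : ℝ}, x ≤ C / N → C ≤ C6 d a → x ≤ C6 d a / N := fun h hC =>
    h.trans (div_le_div_of_nonneg_right hC hN0.le)
  exact ⟨m (opNorm_calG_rate N R M hN hR hRN a ha) e1,
    m (opNorm_fdiff_calG_rate N R M hN hR hRN a ha ν) e2,
    m (opNorm_calG_star_fdiff_rate N R M hN hR hRN a ha ν) e2,
    m (opNorm_weightedItem_rate_one N R M hN hR hRN a ha ν ν') e3,
    m (opNorm_oneSidedL_rate N R M hN hR hRN a ha ν ν') e4,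
    m (opNorm_oneSidedR_rate N R M hN hR hRN a ha ν ν') e4⟩

end OneSidedTorus

/-! ## §9 (v1.3) The FIRST-ORDER items `∇_ν𝒢`, `𝒢∇*_ν` and King's `θ = 1` order-two item against King's
block-averaging `Q_R` [cite: King1986, (2.10) p.653, (4.19)-(4.23) p.672; Balaban1984PropagatorsI, Prop. 1.1 (1.89) p.33] -/

section AveragingItems

variable (N R : ℕ) [NeZero N] [NeZero R] (M : Fin d → ℕ) [hM : ∀ μ, NeZero (M μ)]

/-- `‖mulOp(ū_R)‖ ≤ 1`. [folklore] -/
private theorem opNorm_mulOp_star_uCen_le (hR : 1 ≤ R) : ‖mulOp N M (star (uCen N R M))‖ ≤ 1 :=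
  opNorm_mulOp_le N M _ zero_le_one fun P => by
    rw [Pi.star_apply, norm_star]; exact norm_uCen_le_one N R M hR P

/-- **THE `Q_R`-PACKAGING LAW** (abstract form of §7's `(0,0)` argument): if an item `X′` on the fine torus is
`J_R`-close to `X` on the coarse one (`‖X′ − J_R X J_Rᴴ‖ ≤ r`) and the averaging-weight defects of `X` are
small (`‖(mulOp(u_R) − 1)X‖, ‖X(mulOp(ū_R) − 1)‖ ≤ K`), then `‖Q_R X′ Q_Rᴴ − R^{−d} X‖ ≤ R^{−d}(r + 2K)` —
from `Q_R J_R = R^{−d/2} mulOp(u_R)` (`Qavg_mul_Jmat`) and `‖Q_R‖ ≤ R^{−d/2}`. [folklore] -/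
private theorem opNorm_Qavg_conj_sub_le (hR : 1 ≤ R)
    (X' : Matrix (Tor (fine (R * N) M) × Fin d) (Tor (fine (R * N) M) × Fin d) ℂ)
    (X : Matrix (Tor (fine N M) × Fin d) (Tor (fine N M) × Fin d) ℂ) {r K : ℝ} (hr : 0 ≤ r) (hK : 0 ≤ K)
    (hrate : ‖X' - Jmat N R M * X * (Jmat N R M)ᴴ‖ ≤ r)
    (h1 : ‖(mulOp N M (uCen N R M) - 1) * X‖ ≤ K) (h2 : ‖X * (mulOp N M (star (uCen N R M)) - 1)‖ ≤ K) :
    ‖Qavg N R M * X' * (Qavg N R M)ᴴ - ((R : ℂ) ^ d)⁻¹ • X‖ ≤ ((R : ℝ) ^ d)⁻¹ * (r + 2 * K) := by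
  have hRd : (0 : ℝ) < (R : ℝ) ^ d := pow_pos (by exact_mod_cast Nat.pos_of_ne_zero (NeZero.ne R)) d
  have hcc : (Real.sqrt ((R : ℝ) ^ d))⁻¹ * (Real.sqrt ((R : ℝ) ^ d))⁻¹ = ((R : ℝ) ^ d)⁻¹ := by
    rw [← mul_inv, Real.mul_self_sqrt hRd.le]
  have hc2 : ((((Real.sqrt ((R : ℝ) ^ d))⁻¹ : ℝ) : ℂ) * (((Real.sqrt ((R : ℝ) ^ d))⁻¹ : ℝ) : ℂ))
      = ((R : ℂ) ^ d)⁻¹ := by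
    rw [← Complex.ofReal_mul, hcc]
    push_cast
    rfl
  have hQJ := Qavg_mul_Jmat N R M
  have hQJt : (Jmat N R M)ᴴ * (Qavg N R M)ᴴ
      = (((Real.sqrt ((R : ℝ) ^ d))⁻¹ : ℝ) : ℂ) • mulOp N M (star (uCen N R M)) := by
    rw [← Matrix.conjTranspose_mul, hQJ, Matrix.conjTranspose_smul, conjTranspose_mulOp]
    congr 1
    exact Complex.conj_ofReal _
  have key : Qavg N R M * (Jmat N R M * X * (Jmat N R M)ᴴ) * (Qavg N R M)ᴴ
      = ((R : ℂ) ^ d)⁻¹ • (mulOp N M (uCen N R M) * X * mulOp N M (star (uCen N R M))) := by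
    calc Qavg N R M * (Jmat N R M * X * (Jmat N R M)ᴴ) * (Qavg N R M)ᴴ
        = (Qavg N R M * Jmat N R M) * X * ((Jmat N R M)ᴴ * (Qavg N R M)ᴴ) := by
          simp only [Matrix.mul_assoc]
      _ = ((R : ℂ) ^ d)⁻¹ • (mulOp N M (uCen N R M) * X * mulOp N M (star (uCen N R M))) := by
          rw [hQJ, hQJt, Matrix.smul_mul, Matrix.smul_mul, Matrix.mul_smul, smul_smul, hc2]
  have split : Qavg N R M * X' * (Qavg N R M)ᴴ - ((R : ℂ) ^ d)⁻¹ • X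
      = Qavg N R M * (X' - Jmat N R M * X * (Jmat N R M)ᴴ) * (Qavg N R M)ᴴ
        + ((R : ℂ) ^ d)⁻¹ • ((mulOp N M (uCen N R M) - 1) * X * mulOp N M (star (uCen N R M))
          + X * (mulOp N M (star (uCen N R M)) - 1)) := by
    rw [Matrix.mul_sub, Matrix.sub_mul, key, Matrix.sub_mul, Matrix.one_mul, Matrix.sub_mul, Matrix.mul_sub,
      Matrix.mul_one, sub_add_sub_cancel, smul_sub, sub_add_sub_cancel]
  rw [split]
  have hQ := opNorm_Qavg_le N R M
  have hQt : ‖(Qavg N R M)ᴴ‖ ≤ (Real.sqrt ((R : ℝ) ^ d))⁻¹ := by rw [Matrix.l2_opNorm_conjTranspose]; exact hQ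
  have hc0 : 0 ≤ (Real.sqrt ((R : ℝ) ^ d))⁻¹ := inv_nonneg.mpr (Real.sqrt_nonneg _)
  have hT1 : ‖Qavg N R M * (X' - Jmat N R M * X * (Jmat N R M)ᴴ) * (Qavg N R M)ᴴ‖ ≤ ((R : ℝ) ^ d)⁻¹ * r := by
    calc ‖Qavg N R M * (X' - Jmat N R M * X * (Jmat N R M)ᴴ) * (Qavg N R M)ᴴ‖
        ≤ ‖Qavg N R M‖ * ‖X' - Jmat N R M * X * (Jmat N R M)ᴴ‖ * ‖(Qavg N R M)ᴴ‖ :=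
          (Matrix.l2_opNorm_mul _ _).trans (mul_le_mul_of_nonneg_right (Matrix.l2_opNorm_mul _ _)
            (norm_nonneg _))
      _ ≤ (Real.sqrt ((R : ℝ) ^ d))⁻¹ * r * (Real.sqrt ((R : ℝ) ^ d))⁻¹ :=
          mul_le_mul (mul_le_mul hQ hrate (norm_nonneg _) hc0) hQt (norm_nonneg _) (mul_nonneg hc0 hr)
      _ = ((R : ℝ) ^ d)⁻¹ * r := by rw [mul_comm _ r, mul_assoc, hcc, mul_comm]
  have hT2 : ‖((R : ℂ) ^ d)⁻¹ • ((mulOp N M (uCen N R M) - 1) * X * mulOp N M (star (uCen N R M))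
          + X * (mulOp N M (star (uCen N R M)) - 1))‖ ≤ ((R : ℝ) ^ d)⁻¹ * (2 * K) := by
    rw [norm_smul, norm_inv, norm_pow, Complex.norm_natCast]
    refine mul_le_mul_of_nonneg_left ?_ (le_of_lt (inv_pos.mpr hRd))
    have h1' : ‖(mulOp N M (uCen N R M) - 1) * X * mulOp N M (star (uCen N R M))‖ ≤ K * 1 :=
      (Matrix.l2_opNorm_mul _ _).trans
        (mul_le_mul h1 (opNorm_mulOp_star_uCen_le N R M hR) (norm_nonneg _) hK)
    calc _ ≤ _ := norm_add_le _ _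
      _ ≤ K * 1 + K := add_le_add h1' h2
      _ = 2 * K := by ring
  calc _ ≤ _ := norm_add_le _ _
    _ ≤ ((R : ℝ) ^ d)⁻¹ * r + ((R : ℝ) ^ d)⁻¹ * (2 * K) := add_le_add hT1 hT2
    _ = ((R : ℝ) ^ d)⁻¹ * (r + 2 * K) := by ring

/-- **`‖mulOp(g) X‖ ≤ √d·C·η` whenever `‖∇^η_μ X‖ ≤ C` for every `μ`** (`opNorm_mulOp_gsym_mul_sq_le`). [folklore] -/
private theorem opNorm_mulOp_gsym_mul_le (hN : 1 ≤ N)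
    (X : Matrix (Tor (fine N M) × Fin d) (Tor (fine N M) × Fin d) ℂ) {C : ℝ} (hC : 0 ≤ C)
    (hX : ∀ μ, ‖fdiff (fine N M) (N : ℂ) μ * X‖ ≤ C) :
    ‖mulOp N M (fun P => (gsym N M P : ℂ)) * X‖ ≤ Real.sqrt d * C / N := by
  have hNpos : (0 : ℝ) < N := by exact_mod_cast hN
  have hsq := opNorm_mulOp_gsym_mul_sq_le N M X
  have hb : ∑ μ, ‖fdiff (fine N M) (N : ℂ) μ * X‖ ^ 2 ≤ d * C ^ 2 := by
    calc ∑ μ, ‖fdiff (fine N M) (N : ℂ) μ * X‖ ^ 2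
        ≤ ∑ _μ : Fin d, C ^ 2 := Finset.sum_le_sum fun μ _ => by
            gcongr
            exact hX μ
      _ = d * C ^ 2 := by rw [Finset.sum_const, Finset.card_univ, Fintype.card_fin, nsmul_eq_mul]
  have h2 : ‖mulOp N M (fun P => (gsym N M P : ℂ)) * X‖ ^ 2 ≤ (Real.sqrt d * C / N) ^ 2 := by
    rw [div_pow, mul_pow, Real.sq_sqrt (Nat.cast_nonneg d)]
    calc ‖mulOp N M (fun P => (gsym N M P : ℂ)) * X‖ ^ 2
        ≤ ((N : ℝ) ^ 2)⁻¹ * ∑ μ, ‖fdiff (fine N M) (N : ℂ) μ * X‖ ^ 2 := hsq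
      _ ≤ ((N : ℝ) ^ 2)⁻¹ * (d * C ^ 2) := by gcongr
      _ = d * C ^ 2 / (N : ℝ) ^ 2 := by rw [inv_mul_eq_div]
  have h3 := abs_le_of_sq_le_sq h2 (div_nonneg (mul_nonneg (Real.sqrt_nonneg _) hC) hNpos.le)
  rwa [abs_of_nonneg (norm_nonneg _)] at h3

/-- **`‖(mulOp(u_R) − 1) X‖ ≤ (π d/2)·C·η` whenever `‖∇^η_μ X‖ ≤ C`**: the averaging-weight defect costs ONE
derivative. [folklore] -/
private theorem opNorm_mulOp_uCen_sub_one_mul_le (hN : 1 ≤ N) (hR : 1 ≤ R)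
    (X : Matrix (Tor (fine N M) × Fin d) (Tor (fine N M) × Fin d) ℂ) {C : ℝ} (hC : 0 ≤ C)
    (hX : ∀ μ, ‖fdiff (fine N M) (N : ℂ) μ * X‖ ≤ C) :
    ‖(mulOp N M (uCen N R M) - 1) * X‖ ≤ Real.pi * d * C / (2 * N) := by
  have hNpos : (0 : ℝ) < N := by exact_mod_cast hN
  have hdd : Real.sqrt d * Real.sqrt d = d := Real.mul_self_sqrt (Nat.cast_nonneg d)
  rw [mulOp_uCen_sub_one_eq N R M hN hR, Matrix.mul_assoc]
  calc ‖mulOp N M (rhoSym N R M) * (mulOp N M (fun P => (gsym N M P : ℂ)) * X)‖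
      ≤ ‖mulOp N M (rhoSym N R M)‖ * ‖mulOp N M (fun P => (gsym N M P : ℂ)) * X‖ := Matrix.l2_opNorm_mul _ _
    _ ≤ (Real.pi * Real.sqrt d / 2) * (Real.sqrt d * C / N) :=
        mul_le_mul (opNorm_mulOp_le N M (rhoSym N R M) (by positivity) (norm_rhoSym_le N R M hN hR))
          (opNorm_mulOp_gsym_mul_le N M hN X hC hX) (norm_nonneg _) (by positivity)
    _ = Real.pi * (Real.sqrt d * Real.sqrt d) * C / (2 * N) := by ring
    _ = Real.pi * d * C / (2 * N) := by rw [hdd]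

omit [NeZero N] [NeZero R] hM in
/-- `(star A)ᴴ = A`. [folklore] -/
private theorem conjTranspose_star_fdiff {n : ℕ} [NeZero n] (ν : Fin d) :
    (star (fdiff (fine n M) (n : ℂ) ν))ᴴ = fdiff (fine n M) (n : ℂ) ν := by
  rw [Matrix.star_eq_conjTranspose, Matrix.conjTranspose_conjTranspose]

/-- `(∇_ν 𝒢)ᴴ = 𝒢 ∇*_ν` (`𝒢` Hermitian). [folklore] -/
private theorem conjTranspose_fdiff_calG {n : ℕ} [NeZero n] (hn : 1 ≤ n) (a : ℝ) (ha : 0 < a) (ν : Fin d) :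
    (fdiff (fine n M) (n : ℂ) ν * calG n hn M a ha)ᴴ = calG n hn M a ha * star (fdiff (fine n M) (n : ℂ) ν) := by
  rw [Matrix.conjTranspose_mul, (calG_isHermitian n hn M a ha).eq, Matrix.star_eq_conjTranspose]

/-- the RIGHT defect of `∇_ν𝒢` is the adjoint of the LEFT defect of `𝒢∇*_ν`. [folklore] -/
private theorem fdiff_calG_mul_defect_eq (hN : 1 ≤ N) (a : ℝ) (ha : 0 < a) (ν : Fin d) :
    fdiff (fine N M) (N : ℂ) ν * calG N hN M a ha * (mulOp N M (star (uCen N R M)) - 1)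
      = ((mulOp N M (uCen N R M) - 1) * (calG N hN M a ha * star (fdiff (fine N M) (N : ℂ) ν)))ᴴ := by
  rw [Matrix.conjTranspose_mul, Matrix.conjTranspose_mul, conjTranspose_star_fdiff,
    (calG_isHermitian N hN M a ha).eq, Matrix.conjTranspose_sub, conjTranspose_mulOp, Matrix.conjTranspose_one]

omit [NeZero N] [NeZero R] hM in
/-- the constant of the first-order rates against `Q_R`: the `J_R`-rate constant `CTL` plus the
averaging-weight defect `π d·Cst` (one more derivative, absorbed by b05's order-two uniform bounds). [folklore] -/
def CQL (d : ℕ) (a : ℝ) : ℝ := CTL d a + Real.pi * d * Cst d a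

omit [NeZero N] [NeZero R] hM in
/-- `0 ≤ CQL`. [folklore] -/
private theorem CQL_nonneg (d : ℕ) (a : ℝ) : 0 ≤ CQL d a := by
  have h1 := (CTL_nonneg d a)
  have h2 := Cst_nonneg d a
  unfold CQL
  positivity

/-- **THE FIRST-ORDER ITEM `∇_ν𝒢` AGAINST KING'S BLOCK-AVERAGING `Q_R`** — for every finite unit torus,
`N, R ≥ 1`, `a > 0`, `ν`:
`‖Q_R (∇_ν^{(η/R)} 𝒢^{(η/R)}) Q_Rᴴ − R^{−d} ∇_ν^{(η)} 𝒢^{(η)}‖ ≤ R^{−d}·CQL(d,a)·η`, `CQL = CTL + π d·Cst`: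
the `J_R`-rate `B5G183RateTorus.opNorm_fdiff_calG_rate` plus the averaging-weight defect
`‖(mulOp(u_R) − 1)∇_ν𝒢‖ ≤ (π d/2)·Cst·η` (one more derivative, absorbed by b05's FIFTH uniform bound
`‖∇∇𝒢‖ ≤ Cst`, `opNorm_fdiff_fdiff_calG_le`) and its adjoint (`𝒢` Hermitian; b05's FOURTH bound
`‖∇𝒢∇*‖ ≤ Cst`).  King (4.19) p.672 carries ONE alias factor `u` on the `Q*`-leg of his scalar kernel `∂_α∂_μ a G Q*` and
compares the two spacings factor by factor (text after (4.23)); here the whole conjugation `Q_R(·)Q_Rᴴ` (King's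
(2.10) `Q`) is taken; statement and constant OURS.
[cite: King1986, (2.10) p.653, (4.19)-(4.23) p.672; Balaban1984PropagatorsI, Prop. 1.1 (1.89) p.33] [folklore] -/
theorem opNorm_Qavg_fdiff_calG_rate (hN : 1 ≤ N) (hR : 1 ≤ R) (hRN : 1 ≤ R * N) (a : ℝ) (ha : 0 < a)
    (ν : Fin d) :
    ‖Qavg N R M * (fdiff (fine (R * N) M) ((R * N : ℕ) : ℂ) ν * calG (R * N) hRN M a ha) * (Qavg N R M)ᴴ
        - ((R : ℂ) ^ d)⁻¹ • (fdiff (fine N M) (N : ℂ) ν * calG N hN M a ha)‖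
      ≤ ((R : ℝ) ^ d)⁻¹ * CQL d a / N := by
  have hNpos : (0 : ℝ) < N := by exact_mod_cast hN
  have hC := Cst_nonneg d a
  have hK0 : 0 ≤ Real.pi * d * Cst d a / (2 * N) := by positivity
  have h1 : ‖(mulOp N M (uCen N R M) - 1) * (fdiff (fine N M) (N : ℂ) ν * calG N hN M a ha)‖
      ≤ Real.pi * d * Cst d a / (2 * N) :=
    opNorm_mulOp_uCen_sub_one_mul_le N R M hN hR _ hC fun μ => by
      rw [← Matrix.mul_assoc]; exact opNorm_fdiff_fdiff_calG_le N hN M a ha μ ν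
  have h2 : ‖fdiff (fine N M) (N : ℂ) ν * calG N hN M a ha * (mulOp N M (star (uCen N R M)) - 1)‖
      ≤ Real.pi * d * Cst d a / (2 * N) := by
    rw [fdiff_calG_mul_defect_eq N R M hN a ha ν, Matrix.l2_opNorm_conjTranspose]
    exact opNorm_mulOp_uCen_sub_one_mul_le N R M hN hR _ hC fun μ => by
      rw [← Matrix.mul_assoc]; exact opNorm_fdiff_calG_star_fdiff_le N hN M a ha μ ν
  refine (opNorm_Qavg_conj_sub_le N R M hR _ _ (div_nonneg (CTL_nonneg d a) hNpos.le) hK0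
    (opNorm_fdiff_calG_rate N R M hN hR hRN a ha ν) h1 h2).trans ?_
  rw [CQL]
  apply le_of_eq
  field_simp

/-- **THE FIRST-ORDER ITEM `𝒢∇*_ν` AGAINST `Q_R`** (the adjoint of `opNorm_Qavg_fdiff_calG_rate`):
`‖Q_R (𝒢^{(η/R)} ∇_ν^{(η/R)*}) Q_Rᴴ − R^{−d} 𝒢^{(η)} ∇_ν^{(η)*}‖ ≤ R^{−d}·CQL(d,a)·η`. Statement and constant OURS.
[cite: King1986, (2.10) p.653, (4.19)-(4.23) p.672; Balaban1984PropagatorsI, Prop. 1.1 (1.89) p.33] [folklore] -/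
theorem opNorm_Qavg_calG_star_fdiff_rate (hN : 1 ≤ N) (hR : 1 ≤ R) (hRN : 1 ≤ R * N) (a : ℝ) (ha : 0 < a)
    (ν : Fin d) :
    ‖Qavg N R M * (calG (R * N) hRN M a ha * star (fdiff (fine (R * N) M) ((R * N : ℕ) : ℂ) ν)) * (Qavg N R M)ᴴ
        - ((R : ℂ) ^ d)⁻¹ • (calG N hN M a ha * star (fdiff (fine N M) (N : ℂ) ν))‖
      ≤ ((R : ℝ) ^ d)⁻¹ * CQL d a / N := by
  have e : Qavg N R M * (calG (R * N) hRN M a ha * star (fdiff (fine (R * N) M) ((R * N : ℕ) : ℂ) ν))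
        * (Qavg N R M)ᴴ - ((R : ℂ) ^ d)⁻¹ • (calG N hN M a ha * star (fdiff (fine N M) (N : ℂ) ν))
      = (Qavg N R M * (fdiff (fine (R * N) M) ((R * N : ℕ) : ℂ) ν * calG (R * N) hRN M a ha) * (Qavg N R M)ᴴ
          - ((R : ℂ) ^ d)⁻¹ • (fdiff (fine N M) (N : ℂ) ν * calG N hN M a ha))ᴴ := by
    have hc : star (((R : ℂ) ^ d)⁻¹) = ((R : ℂ) ^ d)⁻¹ := by
      rw [Complex.star_def, map_inv₀, map_pow, Complex.conj_natCast]
    rw [Matrix.conjTranspose_sub, Matrix.conjTranspose_smul, Matrix.conjTranspose_mul,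
      Matrix.conjTranspose_mul, Matrix.conjTranspose_conjTranspose, conjTranspose_fdiff_calG,
      conjTranspose_fdiff_calG, hc]
    simp only [Matrix.mul_assoc]
  rw [e, Matrix.l2_opNorm_conjTranspose]
  exact opNorm_Qavg_fdiff_calG_rate N R M hN hR hRN a ha ν

end AveragingItems

section AveragingKing

open Literature.MathematicalPhysics.QuantumFieldTheory.Balaban1983to89.B5G183RateO2Op

variable (N R : ℕ) [NeZero N] [NeZero R] (M : Fin d → ℕ) [hM : ∀ μ, NeZero (M μ)]

/-- `|W| ≤ 1` on the fine torus: `‖wsym 1 i‖ ≤ 1`. [folklore] -/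
private theorem norm_wsym_one_le (i : Tor (fine N M) × Fin d) : ‖wsym N M 1 i‖ ≤ 1 := by
  obtain ⟨I, rfl⟩ := (blockEquiv N M).symm.surjective i
  rw [wsym_restrict, Real.rpow_one, Complex.norm_real,
    Real.norm_of_nonneg (Wc_nonneg_le_one I.1.1 (abs_sOf_le M I.2)).1]
  exact (Wc_nonneg_le_one I.1.1 (abs_sOf_le M I.2)).2

/-- `‖𝒲_1‖ ≤ 1`. [folklore] -/
private theorem opNorm_Wop_one_le : ‖Wop N M 1‖ ≤ 1 :=
  opNorm_mulOp_le N M _ zero_le_one (norm_wsym_one_le N M)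

/-- `|W·∂_μ| ≤ π` on the fine torus (`B5G183RateO2Op.norm_w1dSym_le`). [folklore] -/
private theorem norm_wsym_one_mul_fsym_le (hN : 1 ≤ N) (μ : Fin d) (i : Tor (fine N M) × Fin d) :
    ‖wsym N M 1 i * fsym (fine N M) (N : ℂ) μ i‖ ≤ Real.pi := by
  obtain ⟨I, rfl⟩ := (blockEquiv N M).symm.surjective i
  have h := wfsym_restrict N M 1 μ I
  rw [show (fun i => wsym N M 1 i * fsym (fine N M) (N : ℂ) μ i) ((blockEquiv N M).symm I)
      = wsym N M 1 ((blockEquiv N M).symm I) * fsym (fine N M) (N : ℂ) μ ((blockEquiv N M).symm I)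
      from rfl] at h
  rw [h, wθdSym_one]
  exact norm_w1dSym_le hN I.1.1 (abs_sOf_le M I.2) μ

/-- **the King-weighted averaging defect `‖(mulOp(u_R) − 1)·𝒲_1‖ ≤ (d π²/2)·η`**: `|u_R − 1| ≤ (π/2)η Σ_μ|∂_μ|`
(`norm_uCen_sub_one_le`) against `|W ∂_μ| ≤ π`. [folklore] -/
private theorem opNorm_mulOp_uCen_sub_one_mul_Wop_le (hN : 1 ≤ N) (hR : 1 ≤ R) :
    ‖(mulOp N M (uCen N R M) - 1) * Wop N M 1‖ ≤ d * Real.pi ^ 2 / (2 * N) := by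
  have hNpos : (0 : ℝ) < N := by exact_mod_cast hN
  rw [mulOp_sub_one, Wop, mulOp_mul_mulOp]
  refine opNorm_mulOp_le N M _ (by positivity) fun i => ?_
  have hu := norm_uCen_sub_one_le N R M hN hR i
  calc ‖(uCen N R M i - 1) * wsym N M 1 i‖ = ‖uCen N R M i - 1‖ * ‖wsym N M 1 i‖ := norm_mul _ _
    _ ≤ (Real.pi / (2 * N) * ∑ μ, ‖fsym (fine N M) (N : ℂ) μ i‖) * ‖wsym N M 1 i‖ :=
        mul_le_mul_of_nonneg_right hu (norm_nonneg _)
    _ = Real.pi / (2 * N) * ∑ μ, ‖wsym N M 1 i * fsym (fine N M) (N : ℂ) μ i‖ := by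
        rw [mul_assoc, Finset.sum_mul]
        congr 1
        refine Finset.sum_congr rfl fun μ _ => ?_
        rw [norm_mul, mul_comm]
    _ ≤ Real.pi / (2 * N) * ∑ _μ : Fin d, Real.pi := by
        gcongr with μ _
        exact norm_wsym_one_mul_fsym_le N M hN μ i
    _ = d * Real.pi ^ 2 / (2 * N) := by
        rw [Finset.sum_const, Finset.card_univ, Fintype.card_fin, nsmul_eq_mul]
        field_simp

/-- the adjoint defect `‖𝒲_1·(mulOp(ū_R) − 1)‖ ≤ (d π²/2)·η`. [folklore] -/
private theorem opNorm_Wop_mul_mulOp_star_uCen_sub_one_le (hN : 1 ≤ N) (hR : 1 ≤ R) :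
    ‖Wop N M 1 * (mulOp N M (star (uCen N R M)) - 1)‖ ≤ d * Real.pi ^ 2 / (2 * N) := by
  have hsw : star (wsym N M 1) = wsym N M 1 := funext fun i => by rw [Pi.star_apply, star_wsym]
  have e : Wop N M 1 * (mulOp N M (star (uCen N R M)) - 1) = ((mulOp N M (uCen N R M) - 1) * Wop N M 1)ᴴ := by
    rw [Matrix.conjTranspose_mul, Wop, conjTranspose_mulOp, hsw, Matrix.conjTranspose_sub,
      conjTranspose_mulOp, Matrix.conjTranspose_one]
  rw [e, Matrix.l2_opNorm_conjTranspose]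
  exact opNorm_mulOp_uCen_sub_one_mul_Wop_le N R M hN hR

omit [NeZero N] [NeZero R] hM in
/-- the constant of King's `θ = 1` order-two item against `Q_R`: `CTW` plus the weighted averaging defect
`d π²·Cst`. [folklore] -/
def CQW (d : ℕ) (a : ℝ) : ℝ := CTW d a + d * Real.pi ^ 2 * Cst d a

omit [NeZero N] [NeZero R] hM in
/-- `0 ≤ CQW`. [folklore] -/
private theorem CQW_nonneg (d : ℕ) (a : ℝ) : 0 ≤ CQW d a := by
  have h1 := (CTW_pos d a).le
  have h2 := Cst_nonneg d a
  unfold CQW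
  positivity

/-- **KING'S ORDER-TWO ITEM AT HIS OWN PLACEMENT `θ = 1` AGAINST HIS BLOCK-AVERAGING `Q_R`** — for every
finite unit torus, `N, R ≥ 1`, `a > 0`, `ν, ν′`:
`‖Q_R (𝒲_1′ ∇_ν′ 𝒢′ ∇_{ν′}′^* 𝒲_1′) Q_Rᴴ − R^{−d} 𝒲_1 ∇_ν 𝒢 ∇_{ν′}^* 𝒲_1‖ ≤ R^{−d}·CQW(d,a)·η`
(primes = spacing `η/R`), `CQW = CTW + d π²·Cst`: the `J_R`-rate `opNorm_weightedItem_rate_one` (§3) plus the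
King-weighted averaging defect `‖(mulOp(u_R) − 1)𝒲_1‖ ≤ (d π²/2)·η` (the weight `W` absorbs the derivative
that `u_R − 1` costs: `|W ∂_μ| ≤ π`) against b05's FOURTH uniform bound `‖∇𝒢∇*‖ ≤ Cst`.  King (4.19)–(4.20)
p.672: ONE alias factor `u` on the `Q*`-leg of his scalar kernel `∂_α∂_μ a G Q*`; the symmetric placement
`𝒲_1(·)𝒲_1` and the conjugation by `Q_R` ((2.10)) are OURS, as are statement and constant.
[cite: King1986, (2.10) p.653, (4.19)-(4.23) p.672; Balaban1984PropagatorsI, Prop. 1.1 (1.89) p.33] [folklore] -/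
theorem opNorm_Qavg_weightedItem_rate_one (hN : 1 ≤ N) (hR : 1 ≤ R) (hRN : 1 ≤ R * N) (a : ℝ) (ha : 0 < a)
    (ν ν' : Fin d) :
    ‖Qavg N R M
          * (Wop (R * N) M 1
              * (fdiff (fine (R * N) M) ((R * N : ℕ) : ℂ) ν * calG (R * N) hRN M a ha
                  * star (fdiff (fine (R * N) M) ((R * N : ℕ) : ℂ) ν'))
              * Wop (R * N) M 1)
          * (Qavg N R M)ᴴ
        - ((R : ℂ) ^ d)⁻¹
          • (Wop N M 1 * (fdiff (fine N M) (N : ℂ) ν * calG N hN M a ha * star (fdiff (fine N M) (N : ℂ) ν'))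
              * Wop N M 1)‖
      ≤ ((R : ℝ) ^ d)⁻¹ * CQW d a / N := by
  have hNpos : (0 : ℝ) < N := by exact_mod_cast hN
  have hC := Cst_nonneg d a
  have hK0 : 0 ≤ d * Real.pi ^ 2 / (2 * N) * Cst d a := by positivity
  set Y := fdiff (fine N M) (N : ℂ) ν * calG N hN M a ha * star (fdiff (fine N M) (N : ℂ) ν') with hY
  have hYb : ‖Y‖ ≤ Cst d a := opNorm_fdiff_calG_star_fdiff_le N hN M a ha ν ν'
  have hW := opNorm_Wop_one_le N M
  have h1 : ‖(mulOp N M (uCen N R M) - 1) * (Wop N M 1 * Y * Wop N M 1)‖ ≤ d * Real.pi ^ 2 / (2 * N) * Cst d a := by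
    rw [show (mulOp N M (uCen N R M) - 1) * (Wop N M 1 * Y * Wop N M 1)
        = (mulOp N M (uCen N R M) - 1) * Wop N M 1 * Y * Wop N M 1 by simp only [Matrix.mul_assoc]]
    calc ‖(mulOp N M (uCen N R M) - 1) * Wop N M 1 * Y * Wop N M 1‖
        ≤ ‖(mulOp N M (uCen N R M) - 1) * Wop N M 1‖ * ‖Y‖ * ‖Wop N M 1‖ :=
          (Matrix.l2_opNorm_mul _ _).trans
            (mul_le_mul_of_nonneg_right (Matrix.l2_opNorm_mul _ _) (norm_nonneg _))
      _ ≤ d * Real.pi ^ 2 / (2 * N) * Cst d a * 1 :=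
          mul_le_mul (mul_le_mul (opNorm_mulOp_uCen_sub_one_mul_Wop_le N R M hN hR) hYb (norm_nonneg _)
            (by positivity)) hW (norm_nonneg _) hK0
      _ = d * Real.pi ^ 2 / (2 * N) * Cst d a := mul_one _
  have h2 : ‖Wop N M 1 * Y * Wop N M 1 * (mulOp N M (star (uCen N R M)) - 1)‖ ≤ d * Real.pi ^ 2 / (2 * N) * Cst d a := by
    rw [Matrix.mul_assoc]
    calc ‖Wop N M 1 * Y * (Wop N M 1 * (mulOp N M (star (uCen N R M)) - 1))‖
        ≤ ‖Wop N M 1‖ * ‖Y‖ * ‖Wop N M 1 * (mulOp N M (star (uCen N R M)) - 1)‖ :=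
          (Matrix.l2_opNorm_mul _ _).trans
            (mul_le_mul_of_nonneg_right (Matrix.l2_opNorm_mul _ _) (norm_nonneg _))
      _ ≤ 1 * Cst d a * (d * Real.pi ^ 2 / (2 * N)) :=
          mul_le_mul (mul_le_mul hW hYb (norm_nonneg _) zero_le_one)
            (opNorm_Wop_mul_mulOp_star_uCen_sub_one_le N R M hN hR) (norm_nonneg _) (by positivity)
      _ = d * Real.pi ^ 2 / (2 * N) * Cst d a := by ring
  refine (opNorm_Qavg_conj_sub_le N R M hR _ _ (div_nonneg (CTW_pos d a).le hNpos.le) hK0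
    (opNorm_weightedItem_rate_one N R M hN hR hRN a ha ν ν') h1 h2).trans ?_
  rw [CQW]
  apply le_of_eq
  field_simp

/-- **THE `Q_R`-TABLE OF THE FOUR ITEMS WITH KING'S CURRENCY**: `𝒢` (§7), `∇_ν𝒢`, `𝒢∇*_ν` (§9) and
`𝒲_1∇_ν𝒢∇*_{ν′}𝒲_1` (King's `θ = 1`), each `‖Q_R X^{(η/R)} Q_Rᴴ − R^{−d} X^{(η)}‖ ≤ CQ6(d,a)·η` with ONE constant
`CQ6 = max(CQ, CQL, CQW)` (the `R^{−d} ≤ 1` dropped).  Packaging for the carver; every statement OURS.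
[cite: King1986, (2.10) p.653, (4.19)-(4.23) p.672; Balaban1984PropagatorsI, Prop. 1.1 (1.89) p.33] [folklore] -/
theorem fourItems_Qavg_rate (hN : 1 ≤ N) (hR : 1 ≤ R) (hRN : 1 ≤ R * N) (a : ℝ) (ha : 0 < a) (ν ν' : Fin d) :
    ‖Qavg N R M * calG (R * N) hRN M a ha * (Qavg N R M)ᴴ - ((R : ℂ) ^ d)⁻¹ • calG N hN M a ha‖
        ≤ max (CQ d a) (max (CQL d a) (CQW d a)) / N
    ∧ ‖Qavg N R M * (fdiff (fine (R * N) M) ((R * N : ℕ) : ℂ) ν * calG (R * N) hRN M a ha) * (Qavg N R M)ᴴ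
          - ((R : ℂ) ^ d)⁻¹ • (fdiff (fine N M) (N : ℂ) ν * calG N hN M a ha)‖
        ≤ max (CQ d a) (max (CQL d a) (CQW d a)) / N
    ∧ ‖Qavg N R M * (calG (R * N) hRN M a ha * star (fdiff (fine (R * N) M) ((R * N : ℕ) : ℂ) ν))
            * (Qavg N R M)ᴴ
          - ((R : ℂ) ^ d)⁻¹ • (calG N hN M a ha * star (fdiff (fine N M) (N : ℂ) ν))‖
        ≤ max (CQ d a) (max (CQL d a) (CQW d a)) / N
    ∧ ‖Qavg N R M
            * (Wop (R * N) M 1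
                * (fdiff (fine (R * N) M) ((R * N : ℕ) : ℂ) ν * calG (R * N) hRN M a ha
                    * star (fdiff (fine (R * N) M) ((R * N : ℕ) : ℂ) ν'))
                * Wop (R * N) M 1)
            * (Qavg N R M)ᴴ
          - ((R : ℂ) ^ d)⁻¹
            • (Wop N M 1 * (fdiff (fine N M) (N : ℂ) ν * calG N hN M a ha * star (fdiff (fine N M) (N : ℂ) ν'))
                * Wop N M 1)‖
        ≤ max (CQ d a) (max (CQL d a) (CQW d a)) / N := by
  have hNpos : (0 : ℝ) < N := by exact_mod_cast hN
  have hR1 : (1 : ℝ) ≤ (R : ℝ) ^ d := one_le_pow₀ (by exact_mod_cast hR)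
  have hRi : ((R : ℝ) ^ d)⁻¹ ≤ 1 := inv_le_one_of_one_le₀ hR1
  have m : ∀ {x C : ℝ}, 0 ≤ C → x ≤ ((R : ℝ) ^ d)⁻¹ * C / N → C ≤ max (CQ d a) (max (CQL d a) (CQW d a)) →
      x ≤ max (CQ d a) (max (CQL d a) (CQW d a)) / N := fun hC h hle => by
    refine h.trans ?_
    rw [mul_div_assoc]
    exact (mul_le_of_le_one_left (div_nonneg hC hNpos.le) hRi).trans (div_le_div_of_nonneg_right hle hNpos.le)
  exact ⟨m (CQ_nonneg d a) (opNorm_Qavg_calG_rate N R M hN hR hRN a ha) (le_max_left _ _),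
    m (CQL_nonneg d a) (opNorm_Qavg_fdiff_calG_rate N R M hN hR hRN a ha ν)
      ((le_max_left _ _).trans (le_max_right _ _)),
    m (CQL_nonneg d a) (opNorm_Qavg_calG_star_fdiff_rate N R M hN hR hRN a ha ν)
      ((le_max_left _ _).trans (le_max_right _ _)),
    m (CQW_nonneg d a) (opNorm_Qavg_weightedItem_rate_one N R M hN hR hRN a ha ν ν')
      ((le_max_right _ _).trans (le_max_right _ _))⟩

end AveragingKing

end Literature.MathematicalPhysics.QuantumFieldTheory.Balaban1983to89.B5G183RateTorusW

end
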